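import Literature.NumberTheory.LFunctions.RodgersTaoAsymptotics
import Literature.NumberTheory.LFunctions.RodgersTaoAsymptoticsIntegralProofs
import Literature.NumberTheory.LFunctions.XiIntegralStirlingProofs
import Literature.NumberTheory.LFunctions.ZetaFractionalPartIntegral
import Literature.Analysis.Complex.HorizontalStripResidues
import Literature.Analysis.SpecialFunctions.GammaStirlingComplex
import Literature.Analysis.SpecialFunctions.DigammaLogBound
import Mathlib.Analysis.Calculus.MeanValue
import Mathlib.Analysis.SpecialFunctions.Trigonometric.Bounds
import Mathlib.Analysis.Complex.ExponentialBounds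
import Mathlib.Analysis.Real.Pi.Bounds
import Mathlib.Analysis.SpecialFunctions.Gaussian.GaussianIntegral
import Mathlib.Analysis.SpecialFunctions.Gaussian.FourierTransform
import HarnessLib

/-!
# Rodgers–Tao 2020, §2 — discharges: (13), the `t = 0` forms of (8)/(9), (7), (22), (18), Lemma 2.3, (31), (36)

RH-FREE proofs (cell rh-crit, corpus C3, seat rt-t1; bears_on N-C/N-P; nothing here bears on the
truth of RH). Companion of `RodgersTaoAsymptotics.lean` (the statements of §2 of B. Rodgers, T. Tao,
*The de Bruijn–Newman constant is non-negative*, Forum Math. Pi 8 (2020) e6, as printed). This file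
DISCHARGES, with CONTENT proofs (no ex-falso from `Λ ≥ 0`):

* `rodgersTao_H0_upper_holds : rodgersTao_H0_upper` — eq. (13) (FMP p. 9): for `y ≥ 0`,
  `‖H_0(x − iy)‖ ≤ exp(−π|x|/8 + A(1+y) log₊(|x|+y))`, here with `A = 20`;
* `rodgersTao_H0_twoSided_holds : rodgersTao_H0_twoSided` — the display after (13) (p. 9): the
  matching lower bound for `y ≥ 4` (`σ = (1+y)/2 ≥ 5/2`, where `|ζ(s)| ≍ 1`), `A = 20`;
* `rodgersTao_H_bound_holds : rodgersTao_H_bound` — Lemma 2.1 eq. (7) (FMP Lemma 4, p. 8) in the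
  typed range `−T₀ ≤ t ≤ 0`: from (13) and the Gaussian smoothing (15)
  (`rodgersTao_deBruijnH_eq_gaussian`), exactly as on FMP p. 10;
* `rodgersTao_I_shift_holds : rodgersTao_I_shift` — eq. (22) (FMP p. 12), the contour shift
  `I_t(b, ζ) = exp(tw₀² + ζw₀) I_t(b e^{4w₀}, ζ + 2tw₀)` for `w₀` in the strip (21): Cauchy's theorem
  on the horizontal strip `0 ≤ im w ≤ Im w₀` (the tree's
  `Literature.Analysis.Complex.integral_horizontal_eq_of_differentiableOn`; the integrand is entire,
  Gaussian-dominated on horizontal lines since `t < 0` and `cos 4y ≥ 0`, and decays on the vertical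
  cross-sections) followed by the real translation by `Re w₀`.

* `rodgersTao_logDeriv_H0_asymp_holds : rodgersTao_logDeriv_H0_asymp` — the `t = 0` case of
  Lemma 2.1 eq. (9) for all `x > 0` (FMP pp. 9–10): `H₀'/H₀(z) = (i/4) log(iz/4π) + O_C(log₊ x/x)`
  at `z = x − iκ log₊ x`, `6 ≤ κ ≤ C`, from the identity `rodgersTao_logDeriv_H0_eq`, the complex
  Stirling formula for `ψ` (`GammaStirling.norm_digamma_sub_stirling_le_of_im_pos`), the bound
  `ζ'/ζ(s) ≪ 2^{−σ}` on `σ ≥ 2` and the mean value inequality for `log`.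

* `rodgersTao_H_hasSum_Q_holds : rodgersTao_H_hasSum_Q` — eq. (18) = (32) (FMP pp. 11, 17):
  `H_t(x − iy) = ½ Σ_{n≥1} Q_{t,n}` for `t < 0`, by Fubini over the series of `Φ`
  (`trigIntegral_deBruijnKernel`, `summable_deBruijnPhi_holds`, `deBruijnPhi_neg_holds`,
  `MeasureTheory.hasSum_integral_of_summable_integral_norm`).

* `rodgersTao_saddlePoint` (Lemma 2.3 = FMP Lemma 6, a named fact bundling existence,
  uniqueness and (i)–(iii)): the THEOREMS `rodgersTao_saddleEq_unique` (uniqueness of the saddle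
  point in the strip (21), for `t ≤ 0`, `b > 0`, all `ζ` — Noshiro–Warschawski in place of the
  argument principle), `rodgersTao_saddleEq_exists` (existence for `ζ ∈ Ω`, by the intermediate
  value theorem on eq. (24)/(25)) and `rodgersTao_saddleEq_re_ge` (part (i), `Re(4be^{4w₀}) ≥ M`
  for any fixed `M` once `C' ≥ |T₀| + max M 0 + 1`), `rodgersTao_saddleEq_existsUnique` (the `∃!`
  clause), `rodgersTao_saddleEq_re_neg_of_huge` (part (iii), `−Re w₀ ≥ ⅛ log₊ b` for
  `b > x e^{√x/|t|}`), `rodgersTao_saddleEq_expansion` (part (ii), the expansions of `Re w₀` and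
  `Im w₀` with errors `O(1/x)` and `O(log²₊ x / x^{3/2})`), and the DISCHARGE
  `rodgersTao_saddlePoint_holds : rodgersTao_saddlePoint` assembling them;
* `rodgersTao_I_asymp_of_I_stationary : rodgersTao_I_stationary → rodgersTao_I_asymp` — eq. (31)
  follows from Lemma 2.4 by (22) at the saddle point and `Re(b e^{4w₀}) ≥ 1` (Lemma 2.3 (i) with
  `M = 4`); with `rodgersTao_I_stationary_holds` (Lemma 2.4, file
  `RodgersTaoAsymptoticsIntegralProofs`) this gives the DISCHARGE `rodgersTao_I_asymp_holds`;
* `rodgersTao_Q_one_asymp_holds : rodgersTao_Q_one_asymp` — eq. (36) (FMP p. 18): the key lemma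
  `rodgersTao_norm_I_pi_asymp` (`|I_t(π, a+y+ix)| = (x/4π)^{(a+y)/4} J_t(x)(1 + O(log³₊x/x))`, from
  (31), Lemma 2.3 (ii) and the real phase computation `rt_phase_real` of FMP p. 18) at `a = 9, 5`.
* `rodgersTao_H_asymp_of_Q_one : rodgersTao_Q_one_asymp → rodgersTao_H_eq_half_Q_one →
  rodgersTao_H_asymp` — eq. (8) is not independent debt either: for `t < 0` it follows from (36)
  and the p. 19 display (`|H_t| ≍ |Q_{t,1}| ≍ (x/4π)^{(9+y)/4} J_t(x) = e^{−πx/8 + O(log²₊ x)}`),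
  for `t = 0` from `rodgersTao_H0_twoSided_holds`.

(`log₊` is written out as `Real.log (2 + |·|)` in the auxiliary statements of this file, so that they
do not depend on the name of the carrier of `log₊`; the discharged facts are those of
`RodgersTaoAsymptotics.lean` verbatim.)

## Proofs

As printed (FMP pp. 9–10). For (13): `H_0(z) = ξ(s)/8`, `s = 1/2 + iz/2 = (1+y)/2 + ix/2`
(`deBruijnH_zero_eq_holds`), `ξ(s) = (s/2) Γ_ℝ(s) ζ₁(s)` (`riemannXi_eq_mul_of_re_pos`, `ζ₁(s) =
(s−1)ζ(s)` entire), the polynomial bound `‖ζ₁(s)‖ ≤ |s| + |s||s−1|/σ` (`norm_riemannZeta₁_le_of_re_pos`,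
the tree's form of (10)) and Stirling's formula in the uniform modulus form
`Literature.Analysis.SpecialFunctions.GammaStirling.abs_log_norm_Gamma_sub_le` (the tree's form of
(11)–(12)), which gives the display after (12), `Γ(σ+iτ) ≪ exp(−π|τ|/2 + O(σ log₊(|σ|+|τ|)))`, here
as `log_norm_Gamma_le_of_quarter_le_re`. For the lower bound at `σ ≥ 5/2`: `|ζ(s)| ≥ e^{−2}`
(`abs_log_norm_riemannZeta_le`), the factorisation `norm_riemannXi_eq_of_one_lt_re` and the lower
Stirling bound `log_norm_Gamma_ge_of_quarter_le_re`. For (7): `|H_0(x + r|t|^{1/2} − iy)| ≤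
exp(−π|x|/8 + π|t|^{1/2}|r|/8 + O_C(log²₊x)(1 + |r|))`, `e^{−r²/4 + B|r|} ≤ e^{2B²} e^{−r²/8}` and
`∫ e^{−r²/8} = √(8π)` (`integral_gaussian`); the constant obtained is
`A = 20(2+|C|)(7+|C|) + 2(1+|T₀|)²(42+40|C|)² + 8`.
-/

noncomputable section

open Complex Set MeasureTheory
open scoped Real

namespace Literature.NumberTheory.LFunctions


/-- `arctan c ≤ c` for `c ≥ 0` (from `x ≤ tan x` on `[0, π/2)`). [folklore] -/
private theorem rt_arctan_le_self {c : ℝ} (hc : 0 ≤ c) : Real.arctan c ≤ c := by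
  have h := Real.le_tan (Real.arctan_nonneg.2 hc) (Real.arctan_lt_pi_div_two c)
  rwa [Real.tan_arctan] at h

/-- For `a > 0`, `c > 0`: `c · arctan(c/a) ≥ πc/2 − a` (`arctan u + arctan u⁻¹ = π/2`, `arctan v ≤ v`). [folklore] -/
private theorem rt_mul_arctan_div_ge {a c : ℝ} (ha : 0 < a) (hc : 0 < c) :
    π * c / 2 - a ≤ c * Real.arctan (c / a) := by
  have h1 : Real.arctan (c / a) = π / 2 - Real.arctan (a / c) := by
    have := Real.arctan_inv_of_pos (div_pos ha hc)
    rw [inv_div] at this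
    exact this
  have h2 : Real.arctan (a / c) ≤ a / c := rt_arctan_le_self (div_pos ha hc).le
  rw [h1]
  have h3 : c * (a / c) = a := by field_simp
  nlinarith [mul_le_mul_of_nonneg_left h2 hc.le]

/-- `b · arctan(b/a) ≥ π|b|/2 − a` for `a > 0` and all real `b`. [folklore] -/
private theorem rt_mul_arctan_div_ge_abs {a : ℝ} (ha : 0 < a) (b : ℝ) :
    π * |b| / 2 - a ≤ b * Real.arctan (b / a) := by
  rcases lt_trichotomy b 0 with hb | hb | hb
  · have h := rt_mul_arctan_div_ge ha (neg_pos.2 hb)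
    rw [abs_of_neg hb]
    have : -b * Real.arctan (-b / a) = b * Real.arctan (b / a) := by
      rw [neg_div, Real.arctan_neg]; ring
    linarith [this]
  · subst hb; simp; exact ha.le
  · have h := rt_mul_arctan_div_ge ha hb
    rwa [abs_of_pos hb]

/-- **Stirling, upper form** (Rodgers–Tao 2020, §2, display after (12), FMP p. 9:
«`Γ(σ + iτ) ≪ exp(−(π/2)|τ| + O(σ log₊(|σ| + |τ|)))`»), made explicit: for `Re w ≥ 1/4`,
`‖w‖ ≤ M`, `M ≥ 2`, `log ‖Γ(w)‖ ≤ Re w · log M − π|Im w|/2 + 8`. From the tree's uniform Stirling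
bound `GammaStirling.abs_log_norm_Gamma_sub_le` and `−Im w · Arg w ≤ −π|Im w|/2 + Re w`
(`Arg w = arctan(Im w/Re w)`, `arctan v ≤ v`). [cite: RodgersTaoFMP2020, §2 display after eq. (12) (FMP p. 9)] -/
theorem log_norm_Gamma_le_of_quarter_le_re {w : ℂ} {M : ℝ} (hw : 1 / 4 ≤ w.re) (hwM : ‖w‖ ≤ M)
    (hM : 2 ≤ M) :
    Real.log ‖Complex.Gamma w‖ ≤ w.re * Real.log M - π * |w.im| / 2 + 8 := by
  have hw0 : 0 < w.re := by linarith
  have hst := Literature.Analysis.SpecialFunctions.GammaStirling.abs_log_norm_Gamma_sub_le hw0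
  have hn4 : 1 / 4 ≤ ‖w‖ := hw.trans (Complex.re_le_norm w)
  have hn0 : 0 < ‖w‖ := by linarith
  have herr : (1 / 12) * (1 / ‖w‖ ^ 2 + π / (2 * ‖w‖)) ≤ 2 := by
    have h1 : 1 / ‖w‖ ^ 2 ≤ 16 := by
      rw [div_le_iff₀ (by positivity)]; nlinarith
    have h2 : π / (2 * ‖w‖) ≤ 8 := by
      rw [div_le_iff₀ (by positivity)]; nlinarith [Real.pi_le_four]
    nlinarith
  have hlogM : 0 ≤ Real.log M := Real.log_nonneg (by linarith)
  have hterm1 : (w.re - 1 / 2) * Real.log ‖w‖ ≤ w.re * Real.log M + 2 := by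
    by_cases h1 : 1 ≤ ‖w‖
    · have hl0 : 0 ≤ Real.log ‖w‖ := Real.log_nonneg h1
      have hlM : Real.log ‖w‖ ≤ Real.log M := Real.log_le_log (by linarith) hwM
      nlinarith [mul_le_mul_of_nonneg_left hlM hw0.le]
    · have h1' : ‖w‖ < 1 := not_le.1 h1
      have hl0 : Real.log ‖w‖ ≤ 0 := Real.log_nonpos hn0.le h1'.le
      have hl3 : -3 ≤ Real.log ‖w‖ := by
        have := Real.one_sub_inv_le_log_of_pos hn0
        have h4 : ‖w‖⁻¹ ≤ 4 := by rw [inv_le_comm₀ hn0 (by norm_num)]; linarith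
        linarith
      nlinarith [mul_nonpos_iff.2 (Or.inl ⟨hw0.le, hl0⟩), mul_nonneg hw0.le hlogM]
  have hterm2 : -(w.im * Complex.arg w) ≤ -(π * |w.im| / 2) + w.re := by
    have harg : Complex.arg w = Real.arctan (w.im / w.re) := by
      have := arg_ofReal_add_mul_I hw0 w.im
      rwa [Complex.re_add_im] at this
    rw [harg]
    linarith [rt_mul_arctan_div_ge_abs hw0 w.im]
  have hlog2pi : Real.log (2 * π) / 2 ≤ 4 := by
    have := Real.log_le_sub_one_of_pos (by positivity : 0 < 2 * π)
    linarith [Real.pi_le_four]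
  have := (abs_le.1 hst).2
  linarith

set_option maxHeartbeats 400000 in
/-- **Stirling, lower form** (the modulus of (11)–(12), FMP p. 9): for `Re w ≥ 1/4`,
`log ‖Γ(w)‖ ≥ (Re w − ½) log ‖w‖ − π|Im w|/2 − Re w − 2`, from the tree's
`GammaStirling.abs_log_norm_Gamma_sub_le` and `|Arg w| < π/2`.
[cite: RodgersTaoFMP2020, §2 eq. (12) (FMP p. 9)] -/
theorem log_norm_Gamma_ge_of_quarter_le_re {w : ℂ} (hw : 1 / 4 ≤ w.re) :
    (w.re - 1 / 2) * Real.log ‖w‖ - π * |w.im| / 2 - w.re - 2 ≤ Real.log ‖Complex.Gamma w‖ := by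
  have hw0 : 0 < w.re := by linarith
  have hst := Literature.Analysis.SpecialFunctions.GammaStirling.abs_log_norm_Gamma_sub_le hw0
  have hn4 : 1 / 4 ≤ ‖w‖ := hw.trans (Complex.re_le_norm w)
  have hn0 : 0 < ‖w‖ := by linarith
  have herr : (1 / 12) * (1 / ‖w‖ ^ 2 + π / (2 * ‖w‖)) ≤ 2 := by
    have h1 : 1 / ‖w‖ ^ 2 ≤ 16 := by
      rw [div_le_iff₀ (by positivity)]; nlinarith
    have h2 : π / (2 * ‖w‖) ≤ 8 := by
      rw [div_le_iff₀ (by positivity)]; nlinarith [Real.pi_le_four]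
    nlinarith
  have hterm2 : -(π * |w.im| / 2) ≤ -(w.im * Complex.arg w) := by
    have h1 : |Complex.arg w| < π / 2 :=
      Complex.abs_arg_lt_pi_div_two_iff.2 (Or.inl hw0)
    have h2 : w.im * Complex.arg w ≤ |w.im| * |Complex.arg w| := by
      rw [← abs_mul]; exact le_abs_self _
    nlinarith [abs_nonneg w.im]
  have hlog2pi : 0 ≤ Real.log (2 * π) / 2 := by
    have := Real.log_nonneg (by linarith [Real.pi_gt_three] : (1 : ℝ) ≤ 2 * π)
    linarith
  have := (abs_le.1 hst).1
  linarith

/-- the point `s = 1/2 + iz/2` for `z = x − iy` has real part `(1+y)/2`. [folklore] -/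
private theorem rt_s_re (x y : ℝ) : (1 / 2 + I * ((x : ℂ) - I * y) / 2).re = (1 + y) / 2 := by
  simp [Complex.mul_re, Complex.mul_im]; ring

/-- the point `s = 1/2 + iz/2` for `z = x − iy` has imaginary part `x/2`. [folklore] -/
private theorem rt_s_im (x y : ℝ) : (1 / 2 + I * ((x : ℂ) - I * y) / 2).im = x / 2 := by
  simp [Complex.mul_re, Complex.mul_im]

set_option maxHeartbeats 400000 in
/-- **Eq. (13) with an explicit constant** (Rodgers–Tao 2020, §2, FMP p. 9): for `y ≥ 0`,
`‖H_0(x − iy)‖ ≤ exp(−π|x|/8 + 20 (1+y) log₊(|x| + y))`. CONTENT proof: `ξ = (s/2) Γ_ℝ ζ₁`,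
`‖ζ₁(s)‖ ≤ |s| + |s||s−1|/σ` (the tree's form of (10)), `π^{−σ/2} ≤ 1`, and
`log_norm_Gamma_le_of_quarter_le_re` at `w = s/2`. [cite: RodgersTaoFMP2020, §2 eq. (13) (FMP p. 9)] -/
theorem norm_deBruijnH_zero_le (x y : ℝ) (hy : 0 ≤ y) :
    ‖deBruijnH 0 ((x : ℂ) - I * y)‖ ≤
      Real.exp (-(π * |x| / 8) + 20 * (1 + y) * Real.log (2 + |(|x| + y)|)) := by
  set z : ℂ := (x : ℂ) - I * y with hz
  set s : ℂ := 1 / 2 + I * z / 2 with hs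
  have hsre : s.re = (1 + y) / 2 := by rw [hs, hz]; exact rt_s_re x y
  have hsim : s.im = x / 2 := by rw [hs, hz]; exact rt_s_im x y
  set M : ℝ := 2 + |x| + y with hM
  have habs : |(|x| + y)| = |x| + y := abs_of_nonneg (by positivity)
  rw [habs, show (2 : ℝ) + (|x| + y) = M by rw [hM]; ring]
  have hM2 : 2 ≤ M := by rw [hM]; linarith [abs_nonneg x]
  have hM0 : 0 < M := by linarith
  have hlogM : 1 / 2 ≤ Real.log M := by
    have := Real.log_two_gt_d9
    have h2 : Real.log 2 ≤ Real.log M := Real.log_le_log two_pos hM2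
    linarith
  have hs0 : 0 < s.re := by rw [hsre]; linarith
  -- norms of s, s - 1, s/2
  have hns : ‖s‖ ≤ M := by
    have h := Complex.norm_le_abs_re_add_abs_im s
    rw [hsre, hsim, abs_of_pos (by linarith : 0 < (1 + y) / 2), abs_div, abs_two] at h
    rw [hM]; linarith [abs_nonneg x]
  have hns1 : ‖s - 1‖ ≤ M + 1 := by
    calc ‖s - 1‖ ≤ ‖s‖ + ‖(1 : ℂ)‖ := norm_sub_le _ _
      _ ≤ M + 1 := by rw [norm_one]; linarith
  -- H_0(z) = ξ(s)/8 = (s/2) Γ_ℝ(s) ζ₁(s) / 8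
  have hH : deBruijnH 0 z = riemannXi s / 8 := deBruijnH_zero_eq_holds z
  have hξ : riemannXi s = s / 2 * Gammaℝ s * riemannZeta₁ s := riemannXi_eq_mul_of_re_pos hs0
  -- the Gamma factor
  have hw : 1 / 4 ≤ (s / 2).re := by
    rw [Complex.div_ofNat_re, hsre]; linarith
  have hwM : ‖s / 2‖ ≤ M := by
    rw [norm_div, Complex.norm_ofNat]; linarith [norm_nonneg s]
  have hΓlog := log_norm_Gamma_le_of_quarter_le_re hw hwM hM2
  rw [Complex.div_ofNat_re, Complex.div_ofNat_im, hsre, hsim] at hΓlog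
  have hΓpos : 0 < ‖Complex.Gamma (s / 2)‖ :=
    norm_pos_iff.2 (Complex.Gamma_ne_zero_of_re_pos (by linarith))
  have hΓ : ‖Complex.Gamma (s / 2)‖ ≤
      Real.exp ((1 + y) / 2 / 2 * Real.log M - π * |x / 2 / 2| / 2 + 8) := by
    rw [← Real.exp_log hΓpos]; exact Real.exp_le_exp.2 hΓlog
  have hΓR : ‖Gammaℝ s‖ ≤ ‖Complex.Gamma (s / 2)‖ := by
    rw [Gammaℝ_def, norm_mul, Complex.norm_cpow_eq_rpow_re_of_pos Real.pi_pos]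
    have h1 : (π : ℝ) ^ ((-s / 2).re) ≤ 1 := by
      apply Real.rpow_le_one_of_one_le_of_nonpos (by linarith [Real.pi_gt_three])
      simp [hsre]; linarith
    calc (π : ℝ) ^ ((-s / 2).re) * ‖Complex.Gamma (s / 2)‖ ≤ 1 * ‖Complex.Gamma (s / 2)‖ := by
          gcongr
      _ = _ := one_mul _
  -- the ζ₁ factor
  have hζ : ‖riemannZeta₁ s‖ ≤ 5 * M ^ 2 := by
    have h := norm_riemannZeta₁_le_of_re_pos hs0
    rw [hsre] at h
    have hprod : ‖s‖ * ‖s - 1‖ ≤ M * (M + 1) := mul_le_mul hns hns1 (norm_nonneg _) hM0.le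
    have h2 : ‖s‖ * ‖s - 1‖ / ((1 + y) / 2) ≤ 2 * (M * (M + 1)) := by
      rw [div_le_iff₀ (by linarith)]
      nlinarith [mul_nonneg (mul_nonneg hM0.le (by linarith : (0:ℝ) ≤ M + 1)) hy]
    nlinarith
  -- assemble
  set E : ℝ := Real.exp ((1 + y) / 2 / 2 * Real.log M - π * |x / 2 / 2| / 2 + 8) with hE
  have hE0 : 0 < E := Real.exp_pos _
  have hnorm : ‖deBruijnH 0 z‖ ≤ M * E * (5 * M ^ 2) / 16 := by
    rw [hH, hξ, norm_div, norm_mul, norm_mul, norm_div, Complex.norm_ofNat, Complex.norm_ofNat]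
    have h1 : ‖s‖ / 2 * ‖Gammaℝ s‖ ≤ M / 2 * E :=
      mul_le_mul (by linarith) (hΓR.trans hΓ) (norm_nonneg _) (by linarith)
    have h2 : ‖s‖ / 2 * ‖Gammaℝ s‖ * ‖riemannZeta₁ s‖ ≤ M / 2 * E * (5 * M ^ 2) :=
      mul_le_mul h1 hζ (norm_nonneg _) (by positivity)
    linarith
  have habsx : |x / 2 / 2| = |x| / 4 := by rw [abs_div, abs_div]; norm_num; ring
  have hM3 : M ^ 3 = Real.exp (3 * Real.log M) := by
    rw [show (3 : ℝ) * Real.log M = ((3 : ℕ) : ℝ) * Real.log M by norm_num, Real.exp_nat_mul,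
      Real.exp_log hM0]
  have hsum := Real.exp_add (3 * Real.log M) ((1 + y) / 2 / 2 * Real.log M - π * |x / 2 / 2| / 2 + 8)
  calc ‖deBruijnH 0 z‖ ≤ M * E * (5 * M ^ 2) / 16 := hnorm
    _ ≤ M ^ 3 * E := by nlinarith [pow_pos hM0 2, pow_pos hM0 3]
    _ = Real.exp (3 * Real.log M + ((1 + y) / 2 / 2 * Real.log M - π * |x / 2 / 2| / 2 + 8)) := by
      rw [hsum, hM3]
    _ ≤ Real.exp (-(π * |x| / 8) + 20 * (1 + y) * Real.log M) := by
      apply Real.exp_le_exp.2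
      rw [habsx]
      have h1 : 0 ≤ y * Real.log M := by nlinarith
      nlinarith

/-- **Lower half of the `t = 0` case of (8)** (Rodgers–Tao 2020, §2, display after (13), FMP
p. 9: «when `σ ≥ 2` (say) we can improve (10) to `|ζ(σ+iτ)| ≍ 1` … it would suffice to have
`y ≥ 4`»): for `y ≥ 4`, `exp(−π|x|/8 − 20 (1+y) log₊(|x| + y)) ≤ ‖H_0(x − iy)‖`. CONTENT proof:
`‖ξ(s)‖ = ½|s||s−1| π^{−σ/2} |Γ(s/2)| |ζ(s)|` (`norm_riemannXi_eq_of_one_lt_re`), `|ζ(s)| ≥ e^{−2}`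
for `σ ≥ 2` (`abs_log_norm_riemannZeta_le`), and `log_norm_Gamma_ge_of_quarter_le_re`.
[cite: RodgersTaoFMP2020, §2 display after eq. (13) (FMP p. 9)] -/
theorem norm_deBruijnH_zero_ge (x y : ℝ) (hy : 4 ≤ y) :
    Real.exp (-(π * |x| / 8) - 20 * (1 + y) * Real.log (2 + |(|x| + y)|)) ≤
      ‖deBruijnH 0 ((x : ℂ) - I * y)‖ := by
  set z : ℂ := (x : ℂ) - I * y with hz
  set s : ℂ := 1 / 2 + I * z / 2 with hs
  have hsre : s.re = (1 + y) / 2 := by rw [hs, hz]; exact rt_s_re x y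
  have hsim : s.im = x / 2 := by rw [hs, hz]; exact rt_s_im x y
  set M : ℝ := 2 + |x| + y with hM
  have habs : |(|x| + y)| = |x| + y := abs_of_nonneg (by positivity)
  rw [habs, show (2 : ℝ) + (|x| + y) = M by rw [hM]; ring]
  have hM2 : 2 ≤ M := by rw [hM]; linarith [abs_nonneg x]
  have hM0 : 0 < M := by linarith
  have hlogM : 1 / 2 ≤ Real.log M := by
    have := Real.log_two_gt_d9
    have h2 : Real.log 2 ≤ Real.log M := Real.log_le_log two_pos hM2
    linarith
  have hs1 : 1 < s.re := by rw [hsre]; linarith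
  have hs2 : 2 ≤ s.re := by rw [hsre]; linarith
  -- factorisation of ‖ξ(s)‖
  have hH : deBruijnH 0 z = riemannXi s / 8 := deBruijnH_zero_eq_holds z
  have hξ := norm_riemannXi_eq_of_one_lt_re hs1
  -- the factors and their logarithms
  have hns : (5 : ℝ) / 2 ≤ ‖s‖ := by
    have := Complex.re_le_norm s; rw [hsre] at this; linarith
  have hns1 : (3 : ℝ) / 2 ≤ ‖s - 1‖ := by
    have := Complex.re_le_norm (s - 1)
    rw [Complex.sub_re, Complex.one_re, hsre] at this; linarith
  have hlog_s : 0 ≤ Real.log ‖s‖ := Real.log_nonneg (by linarith)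
  have hlog_s1 : 0 ≤ Real.log ‖s - 1‖ := Real.log_nonneg (by linarith)
  have hpi : 0 < (π : ℝ) ^ (-s.re / 2) := Real.rpow_pos_of_pos Real.pi_pos _
  have hlog_pi : -((1 + y) / 2) ≤ Real.log ((π : ℝ) ^ (-s.re / 2)) := by
    rw [Real.log_rpow Real.pi_pos, hsre]
    have h1 := log_pi_lt_two
    have h2 : 0 < Real.log π := Real.log_pos (by linarith [Real.pi_gt_three])
    nlinarith
  -- Gamma factor, lower Stirling
  have hw : 1 / 4 ≤ (s / 2).re := by rw [Complex.div_ofNat_re, hsre]; linarith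
  have hΓlog := log_norm_Gamma_ge_of_quarter_le_re hw
  rw [Complex.div_ofNat_re, Complex.div_ofNat_im, hsre, hsim] at hΓlog
  have hwnorm : (5 : ℝ) / 4 ≤ ‖s / 2‖ := by
    rw [norm_div, Complex.norm_ofNat]; linarith
  have hlogw : 0 ≤ Real.log ‖s / 2‖ := Real.log_nonneg (by linarith)
  have hΓpos : 0 < ‖Complex.Gamma (s / 2)‖ :=
    norm_pos_iff.2 (Complex.Gamma_ne_zero_of_re_pos (by rw [Complex.div_ofNat_re]; linarith))
  have habsx : |x / 2 / 2| = |x| / 4 := by rw [abs_div, abs_div]; norm_num; ring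
  rw [habsx] at hΓlog
  have hΓlog' : -(π * |x| / 8) - (1 + y) / 4 - 2 ≤ Real.log ‖Complex.Gamma (s / 2)‖ := by
    have h1 : 0 ≤ ((1 + y) / 2 / 2 - 1 / 2) * Real.log ‖s / 2‖ := mul_nonneg (by linarith) hlogw
    linarith
  -- zeta factor
  have hζ0 : riemannZeta s ≠ 0 := riemannZeta_ne_zero_of_one_le_re hs1.le
  have hζpos : 0 < ‖riemannZeta s‖ := norm_pos_iff.2 hζ0
  have hζlog : -2 ≤ Real.log ‖riemannZeta s‖ := by
    have h := abs_log_norm_riemannZeta_le hs2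
    have h2 : (2 : ℝ) ^ (-s.re) ≤ 1 / 4 := by
      have h3 : (2 : ℝ) ^ (-s.re) ≤ (2 : ℝ) ^ (-2 : ℝ) :=
        Real.rpow_le_rpow_of_exponent_le one_le_two (by linarith)
      have h4 : (2 : ℝ) ^ (-2 : ℝ) = 1 / 4 := by
        rw [Real.rpow_neg (by norm_num), Real.rpow_two]; norm_num
      exact h3.trans h4.le
    have := (abs_le.1 h).1
    linarith
  -- logarithm of ‖H_0 z‖
  have hξpos : 0 < ‖riemannXi s‖ := norm_pos_iff.2 (riemannXi_ne_zero_of_one_le_re hs1.le)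
  have hH0pos : 0 < ‖deBruijnH 0 z‖ := by rw [hH, norm_div, Complex.norm_ofNat]; positivity
  have hlogξ : Real.log ‖riemannXi s‖ = Real.log ‖s‖ + Real.log ‖s - 1‖ - Real.log 2 +
      Real.log ((π : ℝ) ^ (-s.re / 2)) + Real.log ‖Complex.Gamma (s / 2)‖ +
      Real.log ‖riemannZeta s‖ := by
    rw [hξ, Real.log_mul (by positivity) hζpos.ne', Real.log_mul (by positivity) hΓpos.ne',
      Real.log_mul (by positivity) hpi.ne', Real.log_div (by positivity) two_ne_zero,
      Real.log_mul (by positivity) (by positivity)]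
  have hlogH : Real.log ‖deBruijnH 0 z‖ = Real.log ‖riemannXi s‖ - Real.log 8 := by
    rw [hH, norm_div, Complex.norm_ofNat, Real.log_div hξpos.ne' (by norm_num)]
  have hlog2 : Real.log 2 ≤ 1 := by
    have := Real.log_le_sub_one_of_pos two_pos; linarith
  have hlog8 : Real.log 8 ≤ 7 := by
    have := Real.log_le_sub_one_of_pos (by norm_num : (0 : ℝ) < 8); linarith
  rw [← Real.exp_log hH0pos]
  apply Real.exp_le_exp.2
  rw [hlogH, hlogξ]
  nlinarith

/-- **DISCHARGE of `rodgersTao_H0_upper`** (eq. (13), FMP p. 9), CONTENT, with `A = 20`.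
[cite: RodgersTaoFMP2020, §2 eq. (13) (FMP p. 9)] -/
theorem rodgersTao_H0_upper_holds : rodgersTao_H0_upper :=
  ⟨20, by norm_num, fun x y hy ↦ norm_deBruijnH_zero_le x y hy⟩

/-- **DISCHARGE of `rodgersTao_H0_twoSided`** (display after (13), FMP p. 9), CONTENT, with
`A = 20`. [cite: RodgersTaoFMP2020, §2 display after eq. (13) (FMP p. 9)] -/
theorem rodgersTao_H0_twoSided_holds : rodgersTao_H0_twoSided :=
  ⟨20, by norm_num, fun x y hy ↦ ⟨norm_deBruijnH_zero_ge x y hy,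
    norm_deBruijnH_zero_le x y (by linarith)⟩⟩



/-- `√u ≤ 1 + u` for `u ≥ 0`. [folklore] -/
private theorem rt_sqrt_le_one_add {u : ℝ} (hu : 0 ≤ u) : Real.sqrt u ≤ 1 + u := by
  nlinarith [Real.sq_sqrt hu, Real.sqrt_nonneg u, sq_nonneg (Real.sqrt u - 1)]

/-- `log (2 + a + b) ≤ log (2 + a) + log (2 + b)` for `a, b ≥ 0`. [folklore] -/
private theorem rt_log_two_add_add_le {a b : ℝ} (ha : 0 ≤ a) (hb : 0 ≤ b) :
    Real.log (2 + a + b) ≤ Real.log (2 + a) + Real.log (2 + b) := by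
  rw [← Real.log_mul (by linarith) (by linarith)]
  exact Real.log_le_log (by linarith) (by nlinarith)

/-- the exponent bookkeeping in the proof of (7), pointwise in `r` (FMP p. 10: «`−r²/4 + O(|r|) +
O((1+y+|r|)(1 + log₊ r)) ≤ −r²/8 + O((1+y)²)`»). [folklore] -/
private theorem rt_exponent_pointwise {A₀ P S L₀ x y u r axr logv : ℝ} (hA₀ : 0 < A₀)
    (hP : 1 ≤ P) (hS : 0 ≤ S) (hu : 0 ≤ u) (hur : u ^ 2 = r ^ 2)
    (hyP : 1 + y ≤ P) (hlow : x - S * u ≤ axr) (hlogv0 : 0 ≤ logv)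
    (hlogv : logv ≤ L₀ + (1 + y) + (1 + S * u)) :
    -(π * axr / 8) + A₀ * (1 + y) * logv + -(r ^ 2 / 4) ≤
      -(π * x / 8) + A₀ * P * (L₀ + 2 + P) + 2 * (S * (1 + A₀ * P)) ^ 2 + -(1 / 8) * r ^ 2 := by
  set K : ℝ := A₀ * P * (L₀ + 2 + P) with hK
  set B : ℝ := S * (1 + A₀ * P) with hB
  have hB0 : 0 ≤ B := by positivity
  have h1 : A₀ * (1 + y) * logv ≤ A₀ * P * (L₀ + 2 + P + S * u) := by
    calc A₀ * (1 + y) * logv ≤ A₀ * P * logv := by gcongr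
      _ ≤ A₀ * P * (L₀ + (1 + y) + (1 + S * u)) := by gcongr
      _ ≤ A₀ * P * (L₀ + 2 + P + S * u) := by
          have : L₀ + (1 + y) + (1 + S * u) ≤ L₀ + 2 + P + S * u := by linarith
          gcongr
  have h2 : -(π * axr / 8) ≤ -(π * x / 8) + π * (S * u) / 8 := by
    have := mul_le_mul_of_nonneg_left hlow Real.pi_pos.le
    linarith
  have hSu : 0 ≤ S * u := by positivity
  have h3 : π * (S * u) / 8 ≤ S * u := by
    have := mul_le_mul_of_nonneg_right Real.pi_le_four hSu
    linarith
  have h4 : B * u ≤ u ^ 2 / 8 + 2 * B ^ 2 := by nlinarith [sq_nonneg (u / 2 - 2 * B)]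
  have h5 : A₀ * P * (L₀ + 2 + P + S * u) + S * u = K + B * u := by rw [hK, hB]; ring
  linarith

/-- the final comparison of constants in the proof of (7) (`(1+y)² = O_C(log²₊ x)`). [folklore] -/
private theorem rt_exponent_final {A₀ C₁ S L₀ : ℝ} (hA₀ : 0 < A₀) (hC₁ : 0 ≤ C₁) (hS : 1 ≤ S)
    (hL₀ : 1 / 2 ≤ L₀) :
    A₀ * (1 + C₁ * L₀) * (L₀ + 2 + (1 + C₁ * L₀)) + 2 * (S * (1 + A₀ * (1 + C₁ * L₀))) ^ 2 + 2 ≤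
      (A₀ * (2 + C₁) * (7 + C₁) + 2 * S ^ 2 * (2 + 2 * A₀ * (2 + C₁)) ^ 2 + 8) * L₀ ^ 2 := by
  set P : ℝ := 1 + C₁ * L₀ with hP
  have hCL : 0 ≤ C₁ * L₀ := by positivity
  have hP1 : 1 ≤ P := by rw [hP]; linarith
  have hP2 : P ≤ (2 + C₁) * L₀ := by rw [hP]; nlinarith
  have hK : A₀ * P * (L₀ + 2 + P) ≤ A₀ * (2 + C₁) * (7 + C₁) * L₀ ^ 2 := by
    have h1 : L₀ + 2 + P ≤ (7 + C₁) * L₀ := by rw [hP]; nlinarith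
    have h0 : 0 ≤ L₀ + 2 + P := by linarith
    calc A₀ * P * (L₀ + 2 + P) ≤ A₀ * ((2 + C₁) * L₀) * ((7 + C₁) * L₀) := by gcongr
      _ = A₀ * (2 + C₁) * (7 + C₁) * L₀ ^ 2 := by ring
  have hB : S * (1 + A₀ * P) ≤ S * (2 + 2 * A₀ * (2 + C₁)) * L₀ := by
    have h1 : 1 + A₀ * P ≤ (2 + 2 * A₀ * (2 + C₁)) * L₀ := by
      have := mul_le_mul_of_nonneg_left hP2 hA₀.le
      nlinarith
    have hS0 : 0 ≤ S := by linarith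
    calc S * (1 + A₀ * P) ≤ S * ((2 + 2 * A₀ * (2 + C₁)) * L₀) := by gcongr
      _ = _ := by ring
  have hB0 : 0 ≤ S * (1 + A₀ * P) := by
    have : 0 ≤ S := by linarith
    positivity
  have hB2 : (S * (1 + A₀ * P)) ^ 2 ≤ (S * (2 + 2 * A₀ * (2 + C₁)) * L₀) ^ 2 :=
    pow_le_pow_left₀ hB0 hB 2
  have h2 : (2 : ℝ) ≤ 8 * L₀ ^ 2 := by nlinarith
  have e : (S * (2 + 2 * A₀ * (2 + C₁)) * L₀) ^ 2 = S ^ 2 * (2 + 2 * A₀ * (2 + C₁)) ^ 2 * L₀ ^ 2 := by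
    ring
  rw [e] at hB2
  nlinarith

/-- **Eq. (7) from (13) and (15)** (Rodgers–Tao 2020, proof of Lemma 2.1 = FMP Lemma 4, p. 10:
«Applying (13), the triangle inequality … we conclude that `H_t(x−iy) ≪ exp(−π|x|/8 +
O((1+y) log₊|x| + (1+y)²))`. Since `y = O_C(log₊ x)`, this gives (7).»), in the typed range
`−T₀ ≤ t ≤ 0` (the argument uses only `t ≤ 0` and `|t|^{1/2} ≤ 1 + T₀`). CONTENT proof.
[cite: RodgersTaoFMP2020, Lemma 2.1 eq. (7) (FMP Lemma 4 p. 10)] -/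
theorem rodgersTao_H_bound_of_H0_upper (h13 : rodgersTao_H0_upper) : rodgersTao_H_bound := by
  obtain ⟨A₀, hA₀, h0⟩ := h13
  intro C T₀
  set C₁ : ℝ := |C| with hC₁
  set S : ℝ := 1 + |T₀| with hS
  have hS1 : 1 ≤ S := by rw [hS]; linarith [abs_nonneg T₀]
  have hS0 : 0 ≤ S := by linarith
  have hC₁0 : 0 ≤ C₁ := abs_nonneg C
  refine ⟨A₀ * (2 + C₁) * (7 + C₁) + 2 * S ^ 2 * (2 + 2 * A₀ * (2 + C₁)) ^ 2 + 8, by positivity, ?_⟩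
  intro t ht x hx κ hκ
  have hT₀ : 0 ≤ T₀ := by linarith [ht.1, ht.2]
  have hC : 0 ≤ C := hκ.1.trans hκ.2
  have hCC : C = C₁ := by rw [hC₁, abs_of_nonneg hC]
  have habsT : |T₀| = T₀ := abs_of_nonneg hT₀
  -- the data at the point
  show _ ≤ Real.exp (-(π * x / 8) + _ * Real.log (2 + |x|) ^ 2)
  set L₀ : ℝ := Real.log (2 + |x|) with hL₀
  have hL₀half : 1 / 2 ≤ L₀ := by
    have : Real.log 2 ≤ L₀ := Real.log_le_log two_pos (by linarith [abs_nonneg x])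
    have := Real.log_two_gt_d9; linarith
  have hL₀x : Real.log (2 + x) = L₀ := by rw [hL₀, abs_of_nonneg hx]
  set y : ℝ := κ * L₀ with hy
  have hy0 : 0 ≤ y := mul_nonneg hκ.1 (by linarith)
  have hyC : y ≤ C₁ * L₀ := by
    rw [hy, ← hCC]; exact mul_le_mul_of_nonneg_right hκ.2 (by linarith)
  set σ : ℝ := Real.sqrt |t| with hσ
  have hσ0 : 0 ≤ σ := Real.sqrt_nonneg _
  have hσS : σ ≤ S := by
    have h1 : |t| ≤ T₀ := by rw [abs_of_nonpos ht.2]; linarith [ht.1]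
    calc σ ≤ 1 + |t| := rt_sqrt_le_one_add (abs_nonneg t)
      _ ≤ S := by rw [hS, habsT]; linarith
  set P : ℝ := 1 + C₁ * L₀ with hP
  have hP1 : 1 ≤ P := by
    have : 0 ≤ C₁ * L₀ := mul_nonneg hC₁0 (by linarith)
    rw [hP]; linarith
  have hyP : 1 + y ≤ P := by rw [hP]; linarith
  set K : ℝ := A₀ * P * (L₀ + 2 + P) with hK
  set B : ℝ := S * (1 + A₀ * P) with hB
  -- (15)
  have h15 := rodgersTao_deBruijnH_eq_gaussian ht.2 (rodgersTaoZ x κ)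
  -- the dominating Gaussian
  set g : ℝ → ℝ := fun r ↦ Real.exp (-(π * x / 8) + K + 2 * B ^ 2) * Real.exp (-(1 / 8) * r ^ 2)
    with hg
  have hg_int : Integrable g :=
    (integrable_exp_neg_mul_sq (by norm_num : (0:ℝ) < 1 / 8)).const_mul _
  have hpt : ∀ r : ℝ,
      ‖Complex.exp (-(r : ℂ) ^ 2 / 4) * deBruijnH 0 (rodgersTaoZ x κ + σ * r)‖ ≤ g r := by
    intro r
    rw [norm_mul, Complex.norm_exp]
    have hre : (-(r : ℂ) ^ 2 / 4).re = -(r ^ 2 / 4) := by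
      rw [show -(r : ℂ) ^ 2 / 4 = ((-(r ^ 2 / 4) : ℝ) : ℂ) by push_cast; ring, Complex.ofReal_re]
    rw [hre]
    have hpoint : rodgersTaoZ x κ + (σ : ℂ) * (r : ℂ) = ((x + σ * r : ℝ) : ℂ) - I * (y : ℂ) := by
      change (x : ℂ) - I * ((κ * Real.log (2 + |x|) : ℝ) : ℂ) + (σ : ℂ) * (r : ℂ) = _
      rw [hy, hL₀]; push_cast; ring
    rw [hpoint]
    have hH0 : ‖deBruijnH 0 (((x + σ * r : ℝ) : ℂ) - I * (y : ℂ))‖ ≤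
        Real.exp (-(π * |x + σ * r| / 8) +
          A₀ * (1 + y) * Real.log (2 + |(|x + σ * r| + y)|)) := h0 (x + σ * r) y hy0
    set u : ℝ := |r| with hu
    have hu0 : 0 ≤ u := abs_nonneg r
    have hur : u ^ 2 = r ^ 2 := by rw [hu, sq_abs]
    have hσu : σ * u ≤ S * u := mul_le_mul_of_nonneg_right hσS hu0
    have hxr_up : |x + σ * r| ≤ x + S * u := by
      calc |x + σ * r| ≤ |x| + |σ * r| := abs_add_le _ _
        _ = x + σ * u := by rw [abs_of_nonneg hx, abs_mul, abs_of_nonneg hσ0]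
        _ ≤ x + S * u := by linarith
    have hxr_low : x - S * u ≤ |x + σ * r| := by
      have h1 : |x| - |σ * r| ≤ |x + σ * r| := by
        have := abs_sub_abs_le_abs_sub x (-(σ * r))
        rw [abs_neg, sub_neg_eq_add] at this; exact this
      rw [abs_of_nonneg hx, abs_mul, abs_of_nonneg hσ0] at h1
      linarith
    have hlogv0 : 0 ≤ Real.log (2 + |(|x + σ * r| + y)|) :=
      Real.log_nonneg (by linarith [abs_nonneg (|x + σ * r| + y)])
    have hlog1 : Real.log (2 + |(|x + σ * r| + y)|) ≤ L₀ + (1 + y) + (1 + S * u) := by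
      rw [abs_of_nonneg (by positivity : (0:ℝ) ≤ |x + σ * r| + y)]
      have h1 : Real.log (2 + (|x + σ * r| + y)) ≤ Real.log (2 + (x + y) + S * u) :=
        Real.log_le_log (by positivity) (by linarith)
      have h2 := rt_log_two_add_add_le (by positivity : (0:ℝ) ≤ x + y) (by positivity : 0 ≤ S * u)
      have h3 : Real.log (2 + (x + y)) ≤ Real.log (2 + x) + Real.log (2 + y) := by
        have := rt_log_two_add_add_le hx hy0
        rwa [show (2:ℝ) + x + y = 2 + (x + y) by ring] at this
      have h4 : Real.log (2 + y) ≤ 1 + y := by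
        have := Real.log_le_sub_one_of_pos (by linarith : (0:ℝ) < 2 + y); linarith
      have h5 : Real.log (2 + S * u) ≤ 1 + S * u := by
        have := Real.log_le_sub_one_of_pos (by positivity : (0:ℝ) < 2 + S * u); linarith
      linarith
    have hexp_le := rt_exponent_pointwise hA₀ hP1 hS0 hu0 hur hyP hxr_low hlogv0 hlog1
    calc Real.exp (-(r ^ 2 / 4)) * ‖deBruijnH 0 (((x + σ * r : ℝ) : ℂ) - I * (y : ℂ))‖
        ≤ Real.exp (-(r ^ 2 / 4)) * Real.exp (-(π * |x + σ * r| / 8) +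
            A₀ * (1 + y) * Real.log (2 + |(|x + σ * r| + y)|)) := by gcongr
      _ = Real.exp (-(π * |x + σ * r| / 8) + A₀ * (1 + y) * Real.log (2 + |(|x + σ * r| + y)|) +
            -(r ^ 2 / 4)) := by rw [← Real.exp_add]; ring_nf
      _ ≤ Real.exp (-(π * x / 8) + K + 2 * B ^ 2 + -(1 / 8) * r ^ 2) := Real.exp_le_exp.2 hexp_le
      _ = g r := by simp only [hg]; rw [← Real.exp_add]
  -- the integral bound
  have hint : ‖∫ r : ℝ, Complex.exp (-(r : ℂ) ^ 2 / 4) * deBruijnH 0 (rodgersTaoZ x κ + σ * r)‖ ≤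
      Real.exp (-(π * x / 8) + K + 2 * B ^ 2) * 6 := by
    refine (norm_integral_le_of_norm_le hg_int (Filter.Eventually.of_forall hpt)).trans ?_
    rw [hg, integral_const_mul, integral_gaussian]
    gcongr
    calc Real.sqrt (π / (1 / 8)) ≤ Real.sqrt (6 ^ 2) :=
          Real.sqrt_le_sqrt (by nlinarith [Real.pi_le_four])
      _ = 6 := Real.sqrt_sq (by norm_num)
  have hconst : ‖(((4 * Real.pi : ℝ) : ℂ) ^ (1 / 2 : ℂ))⁻¹‖ ≤ 1 := by
    rw [norm_inv, Complex.norm_cpow_eq_rpow_re_of_pos (by positivity)]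
    apply inv_le_one_of_one_le₀
    apply Real.one_le_rpow (by linarith [Real.pi_gt_three])
    simp
  have h6 : (6 : ℝ) ≤ Real.exp 2 := by
    have h := Real.exp_one_gt_d9
    have : Real.exp 2 = Real.exp 1 * Real.exp 1 := by rw [← Real.exp_add]; norm_num
    nlinarith
  have hfin : -(π * x / 8) + K + 2 * B ^ 2 + 2 ≤
      -(π * x / 8) + (A₀ * (2 + C₁) * (7 + C₁) + 2 * S ^ 2 * (2 + 2 * A₀ * (2 + C₁)) ^ 2 + 8) *
        L₀ ^ 2 := by
    have := rt_exponent_final hA₀ hC₁0 hS1 hL₀half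
    rw [hK, hB, hP]; linarith
  rw [h15, norm_mul]
  calc ‖(((4 * Real.pi : ℝ) : ℂ) ^ (1 / 2 : ℂ))⁻¹‖ *
        ‖∫ r : ℝ, Complex.exp (-(r : ℂ) ^ 2 / 4) * deBruijnH 0 (rodgersTaoZ x κ + σ * r)‖
      ≤ 1 * (Real.exp (-(π * x / 8) + K + 2 * B ^ 2) * 6) := by gcongr
    _ ≤ Real.exp (-(π * x / 8) + K + 2 * B ^ 2) * Real.exp 2 := by rw [one_mul]; gcongr
    _ = Real.exp (-(π * x / 8) + K + 2 * B ^ 2 + 2) := by rw [← Real.exp_add]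
    _ ≤ _ := Real.exp_le_exp.2 hfin


/-- **DISCHARGE of `rodgersTao_H_bound`** (Lemma 2.1 eq. (7), FMP Lemma 4 p. 8), CONTENT: (13)
(`rodgersTao_H0_upper_holds`) averaged by (15). [cite: RodgersTaoFMP2020, Lemma 2.1 eq. (7) (FMP Lemma 4 p. 8)] -/
theorem rodgersTao_H_bound_holds : rodgersTao_H_bound :=
  rodgersTao_H_bound_of_H0_upper rodgersTao_H0_upper_holds

/-! ## Eq. (22): the contour shift -/


/-- real part of the phase `tw² − b e^{4w} + ζw` on the line `w = x + iy`. [folklore] -/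
private theorem rt_phase_re (t b : ℝ) (ζ : ℂ) (x y : ℝ) :
    (((t : ℂ) * (x + y * I) ^ 2 - (b : ℂ) * Complex.exp (4 * (x + y * I)) + ζ * (x + y * I))).re =
      t * (x ^ 2 - y ^ 2) - b * (Real.exp (4 * x) * Real.cos (4 * y)) + (ζ.re * x - ζ.im * y) := by
  have h4 : (4 : ℂ) * (x + y * I) = ((4 * x : ℝ) : ℂ) + ((4 * y : ℝ) : ℂ) * I := by push_cast; ring
  rw [h4]
  simp only [sq, sub_re, add_re, mul_re, mul_im, add_im, Complex.exp_re, Complex.exp_im,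
    Complex.ofReal_re, Complex.ofReal_im, Complex.I_re, Complex.I_im]
  ring

/-- norm of the integrand of `I_t` on the line `im w = y`, `0 ≤ 4y ≤ π/2`: the `e^{4w}` term only
helps (`b > 0`, `cos 4y ≥ 0`). [folklore] -/
private theorem rt_norm_integrand_le {t b : ℝ} (hb : 0 < b) (ζ : ℂ) (x : ℝ) {y : ℝ} (hy0 : 0 ≤ y)
    (hy : y ≤ π / 8) :
    ‖Complex.exp (((t : ℂ) * (x + y * I) ^ 2 - (b : ℂ) * Complex.exp (4 * (x + y * I)) + ζ * (x + y * I)))‖ ≤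
      Real.exp (t * x ^ 2 + ζ.re * x + (-t * y ^ 2 - ζ.im * y)) := by
  rw [Complex.norm_exp, rt_phase_re]
  apply Real.exp_le_exp.2
  have hcos : 0 ≤ Real.cos (4 * y) :=
    Real.cos_nonneg_of_mem_Icc ⟨by linarith [Real.pi_pos], by linarith⟩
  have : 0 ≤ b * (Real.exp (4 * x) * Real.cos (4 * y)) := by positivity
  linarith

/-- the integrand of `I_t` is entire. [folklore] -/
private theorem rt_differentiable_integrand (t b : ℝ) (ζ : ℂ) :
    Differentiable ℂ fun w ↦ Complex.exp (((t : ℂ) * w ^ 2 - (b : ℂ) * Complex.exp (4 * w) + ζ * w)) := by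
  fun_prop

/-- integrability of the integrand of `I_t` along the line `im w = y` (`t < 0`: Gaussian domination,
Mathlib's `integrable_cexp_quadratic'`). [folklore] -/
private theorem rt_integrable_integrand {t b : ℝ} (ht : t < 0) (hb : 0 < b) (ζ : ℂ) {y : ℝ}
    (hy0 : 0 ≤ y) (hy : y ≤ π / 8) :
    Integrable fun x : ℝ ↦ Complex.exp (((t : ℂ) * (x + y * I) ^ 2 - (b : ℂ) * Complex.exp (4 * (x + y * I)) + ζ * (x + y * I))) := by
  have hg : Integrable fun x : ℝ ↦
      Complex.exp ((t : ℂ) * (x : ℂ) ^ 2 + (ζ.re : ℂ) * x + ((-t * y ^ 2 - ζ.im * y : ℝ) : ℂ)) :=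
    integrable_cexp_quadratic' (by simpa using ht) _ _
  refine hg.norm.mono' ?_ (Filter.Eventually.of_forall fun x ↦ ?_)
  · exact ((rt_differentiable_integrand t b ζ).continuous.comp (by fun_prop)).aestronglyMeasurable
  · refine (rt_norm_integrand_le hb ζ x hy0 hy).trans (le_of_eq ?_)
    rw [Complex.norm_exp]
    congr 1
    simp only [sq, add_re, mul_re, mul_im, Complex.ofReal_re, Complex.ofReal_im]
    ring

/-- uniform decay of the integrand of `I_t` on the vertical cross-sections of the strip
`0 ≤ im w ≤ β` (`t < 0`). [folklore] -/
private theorem rt_decay_integrand {t b : ℝ} (ht : t < 0) (hb : 0 < b) (ζ : ℂ) {β : ℝ}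
    (hβ0 : 0 ≤ β) (hβ : β ≤ π / 8) :
    ∀ ε : ℝ, 0 < ε → ∃ T₀ : ℝ, ∀ T : ℝ, T₀ ≤ |T| → ∀ y ∈ Icc 0 β,
      ‖Complex.exp (((t : ℂ) * (T + y * I) ^ 2 - (b : ℂ) * Complex.exp (4 * (T + y * I)) + ζ * (T + y * I)))‖ ≤ ε := by
  intro ε hε
  set a : ℝ := |ζ.re| with ha
  set D : ℝ := -t * β ^ 2 + |ζ.im| * β with hD
  have hD0 : 0 ≤ D := by rw [hD]; nlinarith [abs_nonneg ζ.im, sq_nonneg β]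
  refine ⟨1 + (a + D + |Real.log ε|) / (-t), fun T hT y hy ↦ ?_⟩
  have hnt : 0 < -t := by linarith
  have hT1 : 1 ≤ |T| := by
    have : 0 ≤ (a + D + |Real.log ε|) / (-t) := by positivity
    linarith
  refine (rt_norm_integrand_le hb ζ T hy.1 (hy.2.trans hβ)).trans ?_
  rw [← Real.exp_log hε]
  apply Real.exp_le_exp.2
  -- `t T² + Re ζ T ≤ |T| (t T₀ + a) ≤ t T₀ + a`, and `-t y² - Im ζ y ≤ D`
  have h1 : ζ.re * T ≤ a * |T| := by
    rw [ha]; calc ζ.re * T ≤ |ζ.re * T| := le_abs_self _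
      _ = |ζ.re| * |T| := abs_mul _ _
  have h2 : -t * y ^ 2 - ζ.im * y ≤ D := by
    rw [hD]
    have : y ^ 2 ≤ β ^ 2 := pow_le_pow_left₀ hy.1 hy.2 2
    have : -(ζ.im * y) ≤ |ζ.im| * β := by
      calc -(ζ.im * y) ≤ |ζ.im * y| := neg_le_abs _
        _ = |ζ.im| * y := by rw [abs_mul, abs_of_nonneg hy.1]
        _ ≤ |ζ.im| * β := by gcongr; exact hy.2
    nlinarith
  have hT2 : T ^ 2 = |T| ^ 2 := (sq_abs T).symm
  set T₀ : ℝ := 1 + (a + D + |Real.log ε|) / (-t) with hT₀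
  have hkey : t * T₀ + a = t - (a + D + |Real.log ε|) + a := by
    have htne : t ≠ 0 := ht.ne
    have e : t * ((a + D + |Real.log ε|) / (-t)) = -(a + D + |Real.log ε|) := by
      rw [div_neg, mul_neg, mul_div_cancel₀ _ htne]
    rw [hT₀, mul_add, mul_one, e]; ring
  have h3 : t * |T| ≤ t * T₀ := by nlinarith
  have h4 : t * T₀ + a ≤ 0 := by rw [hkey]; linarith [abs_nonneg (Real.log ε)]
  have h5 : t * T ^ 2 + a * |T| = |T| * (t * |T| + a) := by rw [hT2]; ring
  have h6 : |T| * (t * |T| + a) ≤ |T| * (t * T₀ + a) := by gcongr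
  have h7 : |T| * (t * T₀ + a) ≤ 1 * (t * T₀ + a) := by nlinarith
  have h8 : -|Real.log ε| ≤ Real.log ε := neg_abs_le _
  nlinarith

/-- the algebra of the shift: `φ(x + w₀) = (t w₀² + ζ w₀) + (t x² − b e^{4w₀} e^{4x} + (ζ + 2tw₀) x)`
(FMP p. 12, the computation behind (22)). [folklore] -/
private theorem rt_phase_add (t b : ℝ) (ζ w₀ : ℂ) (x : ℂ) :
    ((t : ℂ) * (x + w₀) ^ 2 - (b : ℂ) * Complex.exp (4 * (x + w₀)) + ζ * (x + w₀)) =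
      (t * w₀ ^ 2 + ζ * w₀) + (t * x ^ 2 - b * Complex.exp (4 * w₀) * Complex.exp (4 * x) +
        (ζ + 2 * t * w₀) * x) := by
  rw [show (4 : ℂ) * (x + w₀) = 4 * x + 4 * w₀ by ring, Complex.exp_add]
  ring

/-- **DISCHARGE of `rodgersTao_I_shift`** (eq. (22), FMP p. 12: «we see from shifting the contour
in (19) to the horizontal line `{w + w₀ : w ∈ ℝ}` that we have the identity
`I_t(b, ζ) = exp(tw₀² + ζw₀) I_t(b e^{4w₀}, ζ + 2tw₀)` whenever `b > 0`»), CONTENT: Cauchy's theorem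
for the strip `0 ≤ im w ≤ Im w₀` (`Literature.Analysis.Complex.integral_horizontal_eq_of_differentiableOn`)
and translation invariance of Lebesgue measure. [cite: RodgersTaoFMP2020, §2 eq. (22) (FMP p. 12)] -/
theorem rodgersTao_I_shift_holds : rodgersTao_I_shift := by
  intro t ht b hb ζ w₀ hw₀
  obtain ⟨hβ0, hβ⟩ := (mem_rodgersTaoStrip).1 hw₀
  set β : ℝ := w₀.im with hβdef
  set α : ℝ := w₀.re with hαdef
  set f : ℂ → ℂ := fun w ↦ Complex.exp (((t : ℂ) * w ^ 2 - (b : ℂ) * Complex.exp (4 * w) + ζ * w)) with hf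
  -- `I_t(b, ζ) = ∫ f`
  have hI : rodgersTaoI t b ζ = ∫ x : ℝ, f ((x : ℂ) + (0 : ℝ) * I) := by
    rw [rodgersTaoI]
    refine integral_congr_ae (Filter.Eventually.of_forall fun x ↦ ?_)
    simp [hf]
  -- step 1: horizontal shift
  have h1 : ∫ x : ℝ, f ((x : ℂ) + (0 : ℝ) * I) = ∫ x : ℝ, f ((x : ℂ) + β * I) :=
    Literature.Analysis.Complex.integral_horizontal_eq_of_differentiableOn hβ0 univ isOpen_univ
      (subset_univ _) (rt_differentiable_integrand t b ζ).differentiableOn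
      (rt_integrable_integrand ht hb ζ le_rfl (by linarith [Real.pi_pos]))
      (rt_integrable_integrand ht hb ζ hβ0 hβ.le)
      (rt_decay_integrand ht hb ζ hβ0 hβ.le)
  -- step 2: real shift
  have h2 : ∫ x : ℝ, f ((x : ℂ) + β * I) = ∫ x : ℝ, f (((x + α : ℝ) : ℂ) + β * I) :=
    (integral_add_right_eq_self (μ := volume) (fun x : ℝ ↦ f ((x : ℂ) + β * I)) α).symm
  -- step 3: the integrand after the shift
  have h3 : ∀ x : ℝ, f (((x + α : ℝ) : ℂ) + β * I) =
      Complex.exp (t * w₀ ^ 2 + ζ * w₀) *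
        Complex.exp (t * (x : ℂ) ^ 2 - b * Complex.exp (4 * w₀) * Complex.exp (4 * x) +
          (ζ + 2 * t * w₀) * x) := by
    intro x
    have hw : (((x + α : ℝ) : ℂ) + β * I) = (x : ℂ) + w₀ := by
      rw [hαdef, hβdef]; push_cast; rw [add_assoc, Complex.re_add_im]
    simp only [hf]
    rw [hw, rt_phase_add, Complex.exp_add]
  rw [hI, h1, h2, integral_congr_ae (Filter.Eventually.of_forall h3), integral_const_mul, rodgersTaoI]


/-! ## Eq. (9) at `t = 0` -/

section LogDerivZero

open LSeries
open scoped LSeries.notation ArithmeticFunction.vonMangoldt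


/-- `‖ζ'/ζ(s)‖ ≤ M · 2^{−σ}` for `σ ≥ 2` («`ζ'/ζ(s) = −Σ Λ(n) n^{−s}` … one can easily establish the
bound `ζ'/ζ(s) ≪ 1/|s|` in the regime `C' log₊ x ≤ y`», FMP p. 10), with `M = 4 Σ Λ(n)/n²`. [folklore] -/
private theorem rt_exists_norm_logDeriv_zeta_le :
    ∃ M : ℝ, 0 ≤ M ∧ ∀ s : ℂ, 2 ≤ s.re →
      ‖deriv riemannZeta s / riemannZeta s‖ ≤ M * (2 : ℝ) ^ (-s.re) := by
  set M₂ : ℝ := ∑' n : ℕ, ‖term ↗Λ (2 : ℂ) n‖ with hM₂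
  have hsum2 : Summable fun n : ℕ ↦ ‖term ↗Λ (2 : ℂ) n‖ :=
    summable_norm_iff.mpr (ArithmeticFunction.LSeriesSummable_vonMangoldt (s := 2) (by simp))
  have hM₂0 : 0 ≤ M₂ := tsum_nonneg fun _ ↦ norm_nonneg _
  refine ⟨4 * M₂, by positivity, fun s hs ↦ ?_⟩
  have hs1 : 1 < s.re := by linarith
  have hL : L ↗Λ s = -deriv riemannZeta s / riemannZeta s :=
    ArithmeticFunction.LSeries_vonMangoldt_eq_deriv_riemannZeta_div hs1
  have hnorm : ‖deriv riemannZeta s / riemannZeta s‖ = ‖L ↗Λ s‖ := by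
    rw [hL, neg_div, norm_neg]
  rw [hnorm]
  have hsum : Summable fun n : ℕ ↦ ‖term ↗Λ s n‖ :=
    summable_norm_iff.mpr (ArithmeticFunction.LSeriesSummable_vonMangoldt hs1)
  -- termwise: ‖term Λ s n‖ ≤ 2^{2-σ} ‖term Λ 2 n‖
  have hterm : ∀ n : ℕ, ‖term ↗Λ s n‖ ≤ (2 : ℝ) ^ (2 - s.re) * ‖term ↗Λ (2 : ℂ) n‖ := by
    intro n
    rw [norm_term_eq, norm_term_eq]
    rcases Nat.lt_or_ge n 2 with hn | hn
    · interval_cases n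
      · simp
      · simp [ArithmeticFunction.vonMangoldt_apply_one]
    · have hn0 : n ≠ 0 := by omega
      simp only [hn0, if_false]
      have hn2 : (2 : ℝ) ≤ n := by exact_mod_cast hn
      have hnpos : (0 : ℝ) < n := by linarith
      have hΛ : 0 ≤ ‖((Λ n : ℝ) : ℂ)‖ := norm_nonneg _
      -- n^{-σ} = n^{-2} n^{-(σ-2)} ≤ n^{-2} 2^{-(σ-2)}
      have h1 : (n : ℝ) ^ s.re = (n : ℝ) ^ (2 : ℂ).re * (n : ℝ) ^ (s.re - 2) := by
        rw [← Real.rpow_add hnpos]; norm_num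
      have h2 : (2 : ℝ) ^ (s.re - 2) ≤ (n : ℝ) ^ (s.re - 2) :=
        Real.rpow_le_rpow (by norm_num) hn2 (by linarith)
      have h3 : (2 : ℝ) ^ (2 - s.re) * (2 : ℝ) ^ (s.re - 2) = 1 := by
        rw [← Real.rpow_add two_pos]; norm_num
      have h2pos : 0 < (2 : ℝ) ^ (s.re - 2) := by positivity
      have h22pos : 0 < (2 : ℝ) ^ (2 - s.re) := by positivity
      rw [h1, div_mul_eq_div_div]
      rw [show (2 : ℝ) ^ (2 - s.re) * (‖((Λ n : ℝ) : ℂ)‖ / (n : ℝ) ^ (2 : ℂ).re) =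
        (‖((Λ n : ℝ) : ℂ)‖ / (n : ℝ) ^ (2 : ℂ).re) * (2 : ℝ) ^ (2 - s.re) by ring]
      have hq : 0 ≤ ‖((Λ n : ℝ) : ℂ)‖ / (n : ℝ) ^ (2 : ℂ).re := by positivity
      rw [div_le_iff₀ (by positivity)]
      calc ‖((Λ n : ℝ) : ℂ)‖ / (n : ℝ) ^ (2 : ℂ).re
          = ‖((Λ n : ℝ) : ℂ)‖ / (n : ℝ) ^ (2 : ℂ).re * ((2 : ℝ) ^ (2 - s.re) * (2 : ℝ) ^ (s.re - 2)) := by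
            rw [h3, mul_one]
        _ ≤ ‖((Λ n : ℝ) : ℂ)‖ / (n : ℝ) ^ (2 : ℂ).re * ((2 : ℝ) ^ (2 - s.re) * (n : ℝ) ^ (s.re - 2)) := by
            gcongr
        _ = _ := by ring
  calc ‖L ↗Λ s‖ = ‖∑' n, term ↗Λ s n‖ := rfl
    _ ≤ ∑' n, ‖term ↗Λ s n‖ := norm_tsum_le_tsum_norm hsum
    _ ≤ ∑' n, (2 : ℝ) ^ (2 - s.re) * ‖term ↗Λ (2 : ℂ) n‖ :=
        hsum.tsum_le_tsum hterm (hsum2.mul_left _)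
    _ = (2 : ℝ) ^ (2 - s.re) * M₂ := by rw [tsum_mul_left]
    _ = 4 * M₂ * (2 : ℝ) ^ (-s.re) := by
        rw [show (2 : ℝ) - s.re = 2 + -s.re by ring, Real.rpow_add two_pos]; norm_num; ring

/-- `ψ(w) = log w + O(1/Im w)` for `Im w ≥ 2`: «`(Γ'/Γ)(s/2) = log(s/2) + O(1/|s|)`» (FMP p. 10), from
the tree's complex Stirling formula for `ψ` (`GammaStirling.norm_digamma_sub_stirling_le_of_im_pos`). [folklore] -/
private theorem rt_norm_digamma_sub_log_le_of_two_le_im {w : ℂ} (hw : 2 ≤ w.im) :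
    ‖Complex.digamma w - Complex.log w‖ ≤ 1 / w.im := by
  have hv : 0 < w.im := by linarith
  have h := Literature.Analysis.SpecialFunctions.GammaStirling.norm_digamma_sub_stirling_le_of_im_pos hv
  have hwn : w.im ≤ ‖w‖ := by have := Complex.abs_im_le_norm w; rwa [abs_of_pos hv] at this
  have hw0 : 0 < ‖w‖ := by linarith
  have e : Complex.digamma w - Complex.log w =
      (Complex.digamma w - (Complex.log w - 1 / (2 * w) - 1 / (12 * w ^ 2))) -
        (1 / (2 * w) + 1 / (12 * w ^ 2)) := by ring
  rw [e]
  have h1 : ‖1 / (2 * w)‖ ≤ 1 / (2 * w.im) := by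
    rw [norm_div, norm_one, norm_mul, Complex.norm_ofNat]
    exact one_div_le_one_div_of_le (by positivity) (by nlinarith)
  have h2 : ‖1 / (12 * w ^ 2)‖ ≤ 1 / (24 * w.im) := by
    rw [norm_div, norm_one, norm_mul, Complex.norm_ofNat, norm_pow]
    apply one_div_le_one_div_of_le (by positivity)
    nlinarith [mul_le_mul hwn hwn hv.le hw0.le]
  have h3 : (π + 1) / (8 * π * w.im ^ 3) ≤ 1 / (8 * w.im) := by
    rw [div_le_div_iff₀ (by positivity) (by positivity)]
    have hπ := Real.pi_gt_three
    have : 4 ≤ w.im ^ 2 := by nlinarith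
    nlinarith [mul_pos Real.pi_pos hv]
  calc ‖(Complex.digamma w - (Complex.log w - 1 / (2 * w) - 1 / (12 * w ^ 2))) -
        (1 / (2 * w) + 1 / (12 * w ^ 2))‖
      ≤ ‖Complex.digamma w - (Complex.log w - 1 / (2 * w) - 1 / (12 * w ^ 2))‖ +
        ‖1 / (2 * w) + 1 / (12 * w ^ 2)‖ := norm_sub_le _ _
    _ ≤ (π + 1) / (8 * π * w.im ^ 3) + (‖1 / (2 * w)‖ + ‖1 / (12 * w ^ 2)‖) := by
        gcongr; exact norm_add_le _ _
    _ ≤ 1 / (8 * w.im) + (1 / (2 * w.im) + 1 / (24 * w.im)) := by gcongr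
    _ ≤ 1 / w.im := by
        rw [div_add_div _ _ (by positivity) (by positivity), div_add_div _ _ (by positivity) (by positivity),
          div_le_div_iff₀ (by positivity) hv]
        nlinarith [pow_pos hv 2, pow_pos hv 3]

/-- crude bound `‖ψ(w) − log w‖ ≤ 2‖w‖ + 9 + 1/Im w` for `Re w ≥ 1`, `0 < Im w` (small-`x` regime; the
tree's `norm_digamma_le`). [folklore] -/
private theorem rt_norm_digamma_sub_log_le_crude {w : ℂ} (hw : 1 ≤ w.re) (hv : 0 < w.im) :
    ‖Complex.digamma w - Complex.log w‖ ≤ 2 * ‖w‖ + 9 + 1 / w.im := by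
  have hw0 : 0 < w.re := by linarith
  have hwn : 1 ≤ ‖w‖ := hw.trans (Complex.re_le_norm w)
  have hwim : |w.im| ≤ ‖w‖ := Complex.abs_im_le_norm w
  have h := Literature.Analysis.SpecialFunctions.Complex.norm_digamma_le hw0 hv.ne'
  rw [abs_of_pos hv] at h
  have hlog : |Real.log ‖w‖| ≤ ‖w‖ := by
    rw [abs_of_nonneg (Real.log_nonneg hwn)]
    have := Real.log_le_sub_one_of_pos (by linarith : 0 < ‖w‖); linarith
  have t2 : 1 / (2 * ‖w‖ ^ 2) ≤ 1 / 2 := by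
    apply one_div_le_one_div_of_le (by norm_num); nlinarith
  have t3 : π / (4 * w.im) ≤ 1 / w.im := by
    rw [div_le_div_iff₀ (by positivity) hv]; nlinarith [Real.pi_le_four]
  have t4 : w.im / ‖w‖ ^ 2 ≤ 1 := by
    rw [div_le_one (by positivity)]
    have : w.im ≤ ‖w‖ := (le_abs_self _).trans hwim
    nlinarith
  have hψ : ‖Complex.digamma w‖ ≤ ‖w‖ + 1 / 2 + 1 / w.im + 1 + 2 := by
    linarith [Real.pi_le_four]
  have hlogw : ‖Complex.log w‖ ≤ ‖w‖ + 4 := by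
    have h1 := Complex.norm_le_abs_re_add_abs_im (Complex.log w)
    rw [Complex.log_re, Complex.log_im] at h1
    have h2 : |Complex.arg w| ≤ π := Complex.abs_arg_le_pi w
    linarith [Real.pi_le_four]
  calc ‖Complex.digamma w - Complex.log w‖ ≤ ‖Complex.digamma w‖ + ‖Complex.log w‖ := norm_sub_le _ _
    _ ≤ 2 * ‖w‖ + 9 + 1 / w.im := by linarith

set_option maxHeartbeats 400000 in
/-- Lipschitz bound for `log` along a horizontal line in the right half-plane:
`‖log u₁ − log u₂‖ ≤ ‖u₁ − u₂‖ / v` when `Im u₁ = Im u₂ = v > 0`, `Re uᵢ > 0` (mean value inequality,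
`|d log u/du| = 1/|u| ≤ 1/v`). [folklore] -/
private theorem rt_norm_log_sub_log_le {u₁ u₂ : ℂ} {v : ℝ} (hv : 0 < v) (h1 : u₁.im = v)
    (h2 : u₂.im = v) (hr1 : 0 < u₁.re) (hr2 : 0 < u₂.re) :
    ‖Complex.log u₁ - Complex.log u₂‖ ≤ 1 / v * ‖u₁ - u₂‖ := by
  set S : Set ℂ := {u : ℂ | 0 < u.re ∧ u.im = v} with hS
  have hconv : Convex ℝ S := by
    have e : S = {u : ℂ | 0 < u.re} ∩ ({u : ℂ | v ≤ u.im} ∩ {u : ℂ | u.im ≤ v}) := by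
      ext u; simp only [hS, mem_setOf_eq, mem_inter_iff]; constructor
      · rintro ⟨h, h'⟩; exact ⟨h, h'.ge, h'.le⟩
      · rintro ⟨h, h', h''⟩; exact ⟨h, le_antisymm h'' h'⟩
    rw [e]
    exact (convex_halfSpace_re_gt 0).inter ((convex_halfSpace_im_ge v).inter (convex_halfSpace_im_le v))
  have hslit : ∀ u ∈ S, u ∈ Complex.slitPlane := fun u hu ↦
    Complex.mem_slitPlane_iff.2 (Or.inl hu.1)
  have hdiff : ∀ u ∈ S, DifferentiableAt ℂ Complex.log u := fun u hu ↦
    (Complex.hasDerivAt_log (hslit u hu)).differentiableAt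
  have hbound : ∀ u ∈ S, ‖deriv Complex.log u‖ ≤ 1 / v := by
    intro u hu
    rw [(Complex.hasDerivAt_log (hslit u hu)).deriv, norm_inv]
    have : v ≤ ‖u‖ := by
      have := Complex.abs_im_le_norm u; rw [hu.2, abs_of_pos hv] at this; exact this
    rw [one_div]
    exact inv_anti₀ hv this
  exact hconv.norm_image_sub_le_of_norm_deriv_le hdiff hbound ⟨hr2, h2⟩ ⟨hr1, h1⟩

/-- `‖a + b + c + d‖ ≤ ‖a‖ + ‖b‖ + ‖c‖ + ‖d‖`. [folklore] -/
private theorem rt_norm_add₄ (a b c d : ℂ) : ‖a + b + c + d‖ ≤ ‖a‖ + ‖b‖ + ‖c‖ + ‖d‖ := by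
  have h1 := norm_add_le (a + b + c) d
  have h2 := norm_add_le (a + b) c
  have h3 := norm_add_le a b
  linarith

set_option maxHeartbeats 400000 in
/-- **DISCHARGE of `rodgersTao_logDeriv_H0_asymp`** (the `t = 0` case of Lemma 2.1 eq. (9), FMP
pp. 9–10), CONTENT, with `C' = 6` and `A = 66 + 2M + |C|` (`M` the constant of
`rt_exists_norm_logDeriv_zeta_le`): from `rodgersTao_logDeriv_H0_eq`,
`ψ(s/2) = log(s/2) + O(1/|s|)`, `ζ'/ζ(s) ≪ 2^{−σ} ≤ 1/x` for `y ≥ 6 log₊ x`, `1/s, 1/(s−1) = O(1/x)` and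
`log((1 + iz)/4) − log(iz/4) = O(1/x)`, exactly the `t = 0` paragraph of the source; for `x < 8` the
digamma term is bounded crudely (`O_C(log₊ x) = O_C(log₊ x / x)` there).
[cite: RodgersTaoFMP2020, Lemma 2.1 eq. (9) case t = 0 (FMP pp. 9–10)] -/
theorem rodgersTao_logDeriv_H0_asymp_holds : rodgersTao_logDeriv_H0_asymp := by
  obtain ⟨M, hM0, hM⟩ := rt_exists_norm_logDeriv_zeta_le
  refine ⟨6, by norm_num, fun C ↦ ⟨2 * (5 + M) + 56 + |C|, by positivity, fun x hx κ hκ ↦ ?_⟩⟩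
  show _ ≤ (2 * (5 + M) + 56 + |C|) * Real.log (2 + |x|) / x
  -- the data
  set L₀ : ℝ := Real.log (2 + |x|) with hL₀
  have hL₀x : L₀ = Real.log (2 + x) := by rw [hL₀, abs_of_pos hx]
  have hL₀half : 1 / 2 ≤ L₀ := by
    have : Real.log 2 ≤ L₀ := Real.log_le_log two_pos (by linarith [abs_nonneg x])
    have := Real.log_two_gt_d9; linarith
  have hκ6 : 6 ≤ κ := hκ.1
  have hκC : κ ≤ |C| := hκ.2.trans (le_abs_self C)
  set y : ℝ := κ * L₀ with hy
  have hy3 : 3 ≤ y := by rw [hy]; nlinarith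
  have hy6 : 6 * L₀ ≤ y := by rw [hy]; nlinarith
  have hyC : y ≤ |C| * L₀ := by rw [hy]; exact mul_le_mul_of_nonneg_right hκC (by linarith)
  -- currency: u = 1/x, v = L₀/x, u ≤ 2v
  set u : ℝ := 1 / x with hu
  have hu0 : 0 < u := by positivity
  set v : ℝ := L₀ / x with hv
  have hv0 : 0 < v := by positivity
  have huv : v = L₀ * u := by rw [hv, hu]; ring
  have hu2v : u ≤ 2 * v := by rw [huv]; nlinarith
  set z : ℂ := rodgersTaoZ x κ with hzdef
  have hz : z = (x : ℂ) - I * (y : ℂ) := by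
    rw [hzdef, hy]
    change (x : ℂ) - I * ((κ * Real.log (2 + |x|) : ℝ) : ℂ) = _
    rw [hL₀]
  have hsre : (1 / 2 + I * z / 2).re = (1 + y) / 2 := by rw [hz]; exact rt_s_re x y
  have hsim : (1 / 2 + I * z / 2).im = x / 2 := by rw [hz]; exact rt_s_im x y
  have hs1 : 1 < (1 / 2 + I * z / 2).re := by rw [hsre]; linarith
  rw [rodgersTao_logDeriv_H0_eq hs1]
  set s : ℂ := 1 / 2 + I * z / 2 with hs
  set w : ℂ := s / 2 with hw
  have hwre : w.re = (1 + y) / 4 := by rw [hw, Complex.div_ofNat_re, hsre]; ring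
  have hwim : w.im = x / 4 := by rw [hw, Complex.div_ofNat_im, hsim]; ring
  have hw1 : 1 ≤ w.re := by rw [hwre]; linarith
  have hwim0 : 0 < w.im := by rw [hwim]; linarith
  -- splitting the logarithm
  have hz0 : z ≠ 0 := by
    intro h
    have := congrArg Complex.re h
    rw [hz] at this
    simp at this
    linarith
  have h4π : (4 * (π : ℂ)) ≠ 0 := mul_ne_zero (by norm_num) (Complex.ofReal_ne_zero.2 Real.pi_ne_zero)
  have hzne : I * z / (4 * π) ≠ 0 := div_ne_zero (mul_ne_zero Complex.I_ne_zero hz0) h4π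
  have hlogsplit : Complex.log (I * z / (4 * π)) = Complex.log (w - 1 / 4) - (Real.log π : ℂ) := by
    have h := Complex.log_ofReal_mul Real.pi_pos hzne
    have e : (π : ℂ) * (I * z / (4 * π)) = w - 1 / 4 := by
      rw [hw, hs]; field_simp; ring
    rw [e] at h
    rw [h]; ring
  rw [hlogsplit]
  have hid : I / 2 * (1 / s + 1 / (s - 1) - (Real.log π : ℂ) / 2 + Complex.digamma w / 2 +
        deriv riemannZeta s / riemannZeta s) -
      I / 4 * (Complex.log (w - 1 / 4) - (Real.log π : ℂ)) =
      I / 2 * (1 / s + 1 / (s - 1)) + I / 2 * (deriv riemannZeta s / riemannZeta s) +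
        I / 4 * (Complex.digamma w - Complex.log w) +
        I / 4 * (Complex.log w - Complex.log (w - 1 / 4)) := by ring
  rw [hid]
  -- the four error terms, in the currency `u = 1/x`, `v = L₀/x`
  have hI2 : ‖(I / 2 : ℂ)‖ = 1 / 2 := by rw [norm_div, Complex.norm_I, Complex.norm_ofNat]
  have hI4 : ‖(I / 4 : ℂ)‖ = 1 / 4 := by rw [norm_div, Complex.norm_I, Complex.norm_ofNat]
  have hx2 : 0 < x / 2 := by linarith
  have h2x : 1 / (x / 2) = 2 * u := by rw [hu]; field_simp
  have h4x : 1 / (x / 4) = 4 * u := by rw [hu]; field_simp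
  have hsnorm : x / 2 ≤ ‖s‖ := by
    have := Complex.abs_im_le_norm s; rwa [hsim, abs_of_pos hx2] at this
  have hs1norm : x / 2 ≤ ‖s - 1‖ := by
    have := Complex.abs_im_le_norm (s - 1)
    rwa [Complex.sub_im, Complex.one_im, sub_zero, hsim, abs_of_pos hx2] at this
  have e1 : ‖I / 2 * (1 / s + 1 / (s - 1))‖ ≤ 2 * u := by
    rw [norm_mul, hI2]
    have h1 : ‖1 / s‖ ≤ 2 * u := by
      rw [norm_div, norm_one, ← h2x]; exact one_div_le_one_div_of_le hx2 hsnorm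
    have h2 : ‖1 / (s - 1)‖ ≤ 2 * u := by
      rw [norm_div, norm_one, ← h2x]; exact one_div_le_one_div_of_le hx2 hs1norm
    have := norm_add_le (1 / s) (1 / (s - 1))
    linarith
  have e2 : ‖I / 2 * (deriv riemannZeta s / riemannZeta s)‖ ≤ M * v := by
    rw [norm_mul, hI2]
    have h := hM s (by rw [hsre]; linarith)
    have h2 : (2 : ℝ) ^ (-s.re) ≤ u := by
      rw [Real.rpow_def_of_pos two_pos]
      have hlt : Real.log 2 * -s.re ≤ -L₀ := by
        rw [hsre]; have := Real.log_two_gt_d9; nlinarith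
      calc Real.exp (Real.log 2 * -s.re) ≤ Real.exp (-L₀) := Real.exp_le_exp.2 hlt
        _ = 1 / (2 + x) := by rw [hL₀x, Real.exp_neg, Real.exp_log (by linarith), one_div]
        _ ≤ u := by rw [hu]; exact one_div_le_one_div_of_le hx (by linarith)
    have h3 : M * (2 : ℝ) ^ (-s.re) ≤ M * u := mul_le_mul_of_nonneg_left h2 hM0
    have h4 : M * u ≤ M * (2 * v) := mul_le_mul_of_nonneg_left hu2v hM0
    linarith
  have e4 : ‖I / 4 * (Complex.log w - Complex.log (w - 1 / 4))‖ ≤ u := by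
    rw [norm_mul, hI4]
    have h := rt_norm_log_sub_log_le (u₁ := w) (u₂ := w - 1 / 4) (v := x / 4) (by linarith) hwim
      (by rw [Complex.sub_im, hwim]; simp) (by linarith)
      (by rw [Complex.sub_re, hwre]; norm_num; linarith)
    rw [sub_sub_cancel, h4x] at h
    have : ‖(1 / 4 : ℂ)‖ = 1 / 4 := by norm_num
    rw [this] at h
    linarith
  -- the digamma term, two regimes
  have e3 : ‖I / 4 * (Complex.digamma w - Complex.log w)‖ ≤ u + (56 + |C|) * v := by
    rw [norm_mul, hI4]
    have hCv : 0 ≤ (56 + |C|) * v := by positivity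
    rcases le_or_gt 8 x with hx8 | hx8
    · have h := rt_norm_digamma_sub_log_le_of_two_le_im (w := w) (by rw [hwim]; linarith)
      rw [hwim, h4x] at h
      linarith
    · have h := rt_norm_digamma_sub_log_le_crude hw1 hwim0
      rw [hwim, h4x] at h
      have hwn : ‖w‖ ≤ (1 + y) / 4 + 2 := by
        have := Complex.norm_le_abs_re_add_abs_im w
        rw [hwre, hwim, abs_of_pos (by linarith : 0 < (1 + y) / 4),
          abs_of_pos (by linarith : 0 < x / 4)] at this
        linarith
      -- `(1+y)/8 + 13/4 ≤ (56 + |C|) v`, using `x < 8`, `1 ≤ 2 L₀`, `y ≤ |C| L₀`, `L₀ ≤ 8 v`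
      have h8u : 1 ≤ 8 * u := by
        rw [hu, mul_one_div, le_div_iff₀ hx]; linarith
      have hL8v : L₀ ≤ 8 * v := by
        rw [huv]
        have := mul_le_mul_of_nonneg_left h8u (by linarith : (0 : ℝ) ≤ L₀)
        linarith
      have hC0 : 0 ≤ |C| := abs_nonneg C
      have hk1 : (1 + y) / 8 + 13 / 4 ≤ (7 + |C| / 8) * L₀ := by
        have e : (7 + |C| / 8) * L₀ = 7 * L₀ + |C| * L₀ / 8 := by ring
        rw [e]; linarith [hyC, hL₀half]
      have hk2 : (7 + |C| / 8) * L₀ ≤ (7 + |C| / 8) * (8 * v) :=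
        mul_le_mul_of_nonneg_left hL8v (by positivity)
      have hk3 : (7 + |C| / 8) * (8 * v) = (56 + |C|) * v := by ring
      have hn0 := norm_nonneg (Complex.digamma w - Complex.log w)
      linarith
  -- assemble
  have hA : 2 * u + M * v + (u + (56 + |C|) * v) + u ≤ (2 * (5 + M) + 56 + |C|) * v := by
    have h1 : 4 * u ≤ 8 * v := by linarith
    have h2 : 0 ≤ M * v := mul_nonneg hM0 hv0.le
    have e : (2 * (5 + M) + 56 + |C|) * v = 10 * v + 2 * (M * v) + (56 + |C|) * v := by ring
    rw [e]; linarith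
  have hgoal : (2 * (5 + M) + 56 + |C|) * Real.log (2 + |x|) / x = (2 * (5 + M) + 56 + |C|) * v := by
    rw [hv, hL₀]; ring
  rw [hgoal]
  refine (rt_norm_add₄ _ _ _ _).trans ?_
  linarith [e1, e2, e3, e4]


end LogDerivZero

/-! ## Eq. (18) = (32): `H_t` as the series `½ Σ Q_{t,n}` -/

/-- integrability of the integrand of `I_t(b, ζ)` on the real line (`t < 0`, `b > 0`). [folklore] -/
private theorem rt_integrable_integrand_real {t b : ℝ} (ht : t < 0) (hb : 0 < b) (ζ : ℂ) :
    Integrable fun s : ℝ ↦ Complex.exp ((t : ℂ) * (s : ℂ) ^ 2 - (b : ℂ) * Complex.exp (4 * (s : ℂ)) + ζ * s) := by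
  have h := rt_integrable_integrand ht hb ζ (y := 0) le_rfl (by positivity)
  refine h.congr (Filter.Eventually.of_forall fun s ↦ ?_)
  simp

/-- `e^{−v} ≤ 6 / v³` for `v > 0` (`v³/3! ≤ e^v`). [folklore] -/
private theorem rt_exp_neg_le_six_div_cube {v : ℝ} (hv : 0 < v) : Real.exp (-v) ≤ 6 / v ^ 3 := by
  have h := Real.pow_div_factorial_le_exp v hv.le 3
  have h3 : (Nat.factorial 3 : ℝ) = 6 := by norm_num [Nat.factorial]
  rw [h3] at h
  rw [Real.exp_neg, inv_eq_one_div, div_le_div_iff₀ (Real.exp_pos v) (by positivity)]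
  have := (div_le_iff₀ (by norm_num : (0:ℝ) < 6)).1 h
  linarith

/-- the summands of `Φ` are continuous. [folklore] -/
private theorem rt_continuous_deBruijnPhiSummand (n : ℕ) : Continuous fun u : ℝ ↦ deBruijnPhiSummand n u := by
  unfold deBruijnPhiSummand; fun_prop

/-- pointwise bound for the summands of `Φ`: `|φ_n(s)| ≤ (6/(n+1)²)(e^{−3s} + e^{−7s})` for all real `s`
(from `e^{−πm²e^{4s}} ≤ 6/(πm²e^{4s})³`; this is what makes the `n`-sum and the `s`-integral
exchangeable when `t < 0`, «Fubini's theorem (which can be justified when `t < 0`)», FMP p. 11). [folklore] -/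
private theorem rt_abs_deBruijnPhiSummand_le (n : ℕ) (s : ℝ) :
    |deBruijnPhiSummand n s| ≤ 6 / ((n : ℝ) + 1) ^ 2 * (Real.exp (-3 * s) + Real.exp (-7 * s)) := by
  set m : ℝ := (n : ℝ) + 1 with hm
  have hm1 : 1 ≤ m := by rw [hm]; linarith [n.cast_nonneg (α := ℝ)]
  have hm0 : 0 < m := by linarith
  set v : ℝ := π * m ^ 2 * Real.exp (4 * s) with hv
  have hv0 : 0 < v := by positivity
  have hev : Real.exp (-(π * m ^ 2 * Real.exp (4 * s))) ≤ 6 / v ^ 3 := rt_exp_neg_le_six_div_cube hv0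
  unfold deBruijnPhiSummand
  rw [← hm, abs_mul, abs_of_pos (Real.exp_pos _)]
  have hA : |2 * π ^ 2 * m ^ 4 * Real.exp (9 * s) - 3 * π * m ^ 2 * Real.exp (5 * s)| ≤
      2 * π ^ 2 * m ^ 4 * Real.exp (9 * s) + 3 * π * m ^ 2 * Real.exp (5 * s) := by
    have h1 : 0 ≤ 2 * π ^ 2 * m ^ 4 * Real.exp (9 * s) := by positivity
    have h2 : 0 ≤ 3 * π * m ^ 2 * Real.exp (5 * s) := by positivity
    exact (abs_sub _ _).trans (by rw [abs_of_nonneg h1, abs_of_nonneg h2])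
  have hv3 : v ^ 3 = π ^ 3 * m ^ 6 * Real.exp (12 * s) := by
    rw [hv]; rw [show (12 : ℝ) * s = ((3 : ℕ) : ℝ) * (4 * s) by norm_num; ring, Real.exp_nat_mul]; ring
  -- term 1: 2π² m⁴ e^{9s} · 6/v³ = 12 e^{-3s} /(π m²) ≤ 4 e^{-3s}/m²
  have e3 : Real.exp (9 * s) = Real.exp (12 * s) * Real.exp (-3 * s) := by
    rw [← Real.exp_add]; ring_nf
  have e7 : Real.exp (5 * s) = Real.exp (12 * s) * Real.exp (-7 * s) := by
    rw [← Real.exp_add]; ring_nf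
  have hπ3 : 3 ≤ π := Real.pi_gt_three.le
  have hexp12 : 0 < Real.exp (12 * s) := Real.exp_pos _
  have hm2 : 0 < m ^ 2 := pow_pos hm0 2
  have hm24 : m ^ 2 ≤ m ^ 4 := by
    have h1 : 1 ≤ m ^ 2 := one_le_pow₀ hm1
    nlinarith
  have c1 : 12 / (π * m ^ 2) ≤ 4 / m ^ 2 := by
    rw [div_le_div_iff₀ (by positivity) (by positivity)]; nlinarith
  have c2 : 18 / (π ^ 2 * m ^ 4) ≤ 2 / m ^ 2 := by
    rw [div_le_div_iff₀ (by positivity) (by positivity)]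
    have h9 : 9 ≤ π ^ 2 := by nlinarith
    nlinarith [mul_le_mul h9 hm24 hm2.le (by positivity)]
  have hx3 := Real.exp_pos (-3 * s)
  have hx7 := Real.exp_pos (-7 * s)
  have hq : 0 ≤ 2 / m ^ 2 := by positivity
  calc |2 * π ^ 2 * m ^ 4 * Real.exp (9 * s) - 3 * π * m ^ 2 * Real.exp (5 * s)| *
        Real.exp (-(π * m ^ 2 * Real.exp (4 * s)))
      ≤ (2 * π ^ 2 * m ^ 4 * Real.exp (9 * s) + 3 * π * m ^ 2 * Real.exp (5 * s)) * (6 / v ^ 3) :=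
        mul_le_mul hA hev (Real.exp_pos _).le (by positivity)
    _ = (12 / (π * m ^ 2)) * Real.exp (-3 * s) + (18 / (π ^ 2 * m ^ 4)) * Real.exp (-7 * s) := by
        rw [hv3, e3, e7]; field_simp; ring
    _ ≤ (4 / m ^ 2) * Real.exp (-3 * s) + (2 / m ^ 2) * Real.exp (-7 * s) :=
        add_le_add (mul_le_mul_of_nonneg_right c1 hx3.le) (mul_le_mul_of_nonneg_right c2 hx7.le)
    _ = 6 / m ^ 2 * (Real.exp (-3 * s) + Real.exp (-7 * s)) -
          (2 / m ^ 2 * Real.exp (-3 * s) + 2 * (2 / m ^ 2) * Real.exp (-7 * s)) := by ring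
    _ ≤ 6 / m ^ 2 * (Real.exp (-3 * s) + Real.exp (-7 * s)) := by
        have : 0 ≤ 2 / m ^ 2 * Real.exp (-3 * s) + 2 * (2 / m ^ 2) * Real.exp (-7 * s) := by positivity
        linarith

/-- integrability of a real Gaussian `exp(t s² + c s)`, `t < 0`. [folklore] -/
private theorem rt_integrable_exp_quadratic {t : ℝ} (ht : t < 0) (c : ℝ) :
    Integrable fun s : ℝ ↦ Real.exp (t * s ^ 2 + c * s) := by
  have hg : Integrable fun s : ℝ ↦ Complex.exp ((t : ℂ) * (s : ℂ) ^ 2 + (c : ℂ) * s + 0) :=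
    integrable_cexp_quadratic' (by simpa using ht) _ _
  refine hg.norm.congr (Filter.Eventually.of_forall fun s ↦ ?_)
  simp only [Complex.norm_exp, add_zero]
  congr 1
  simp only [sq, add_re, mul_re, mul_im, Complex.ofReal_re, Complex.ofReal_im]
  ring

/-- the `n`-th term of the series (18) as an integrand: `e^{ts²} φ_n(s) e^{izs} =
2π²m⁴ e^{ts² − πm²e^{4s} + (9+iz)s} − 3πm² e^{ts² − πm²e^{4s} + (5+iz)s}`, `m = n + 1` (FMP p. 11). [folklore] -/
private theorem rt_summand_mul_exp_eq (t : ℝ) (n : ℕ) (z : ℂ) (s : ℝ) :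
    ((Real.exp (t * s ^ 2) * deBruijnPhiSummand n s : ℝ) : ℂ) * Complex.exp (I * z * s) =
      2 * π ^ 2 * ((n : ℂ) + 1) ^ 4 *
          Complex.exp ((t : ℂ) * (s : ℂ) ^ 2 - (π * ((n : ℝ) + 1) ^ 2 : ℝ) * Complex.exp (4 * (s : ℂ)) +
            (9 + I * z) * s) -
        3 * π * ((n : ℂ) + 1) ^ 2 *
          Complex.exp ((t : ℂ) * (s : ℂ) ^ 2 - (π * ((n : ℝ) + 1) ^ 2 : ℝ) * Complex.exp (4 * (s : ℂ)) +
            (5 + I * z) * s) := by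
  have e9 : Complex.exp ((t : ℂ) * (s : ℂ) ^ 2 - (π * ((n : ℝ) + 1) ^ 2 : ℝ) * Complex.exp (4 * (s : ℂ)) +
      (9 + I * z) * s) = Complex.exp (t * s ^ 2) * Complex.exp (9 * s) *
        Complex.exp (-((π * ((n : ℝ) + 1) ^ 2 : ℝ) * Complex.exp (4 * (s : ℂ)))) * Complex.exp (I * z * s) := by
    rw [← Complex.exp_add, ← Complex.exp_add, ← Complex.exp_add]; congr 1; ring
  have e5 : Complex.exp ((t : ℂ) * (s : ℂ) ^ 2 - (π * ((n : ℝ) + 1) ^ 2 : ℝ) * Complex.exp (4 * (s : ℂ)) +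
      (5 + I * z) * s) = Complex.exp (t * s ^ 2) * Complex.exp (5 * s) *
        Complex.exp (-((π * ((n : ℝ) + 1) ^ 2 : ℝ) * Complex.exp (4 * (s : ℂ)))) * Complex.exp (I * z * s) := by
    rw [← Complex.exp_add, ← Complex.exp_add, ← Complex.exp_add]; congr 1; ring
  rw [e9, e5, deBruijnPhiSummand]
  push_cast
  ring

/-- norm of the `n`-th term at `z = x − iy`: `≤ (6/(n+1)²)(e^{ts²+(y−3)s} + e^{ts²+(y−7)s})`. [folklore] -/
private theorem rt_norm_summand_mul_exp_le (t : ℝ) (n : ℕ) (x y s : ℝ) :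
    ‖((Real.exp (t * s ^ 2) * deBruijnPhiSummand n s : ℝ) : ℂ) * Complex.exp (I * ((x : ℂ) - I * y) * s)‖ ≤
      6 / ((n : ℝ) + 1) ^ 2 * (Real.exp (t * s ^ 2 + (y - 3) * s) + Real.exp (t * s ^ 2 + (y - 7) * s)) := by
  rw [norm_mul, Complex.norm_real, Complex.norm_exp, Real.norm_eq_abs, abs_mul, abs_of_pos (Real.exp_pos _)]
  have hre : (I * ((x : ℂ) - I * y) * s).re = y * s := by
    simp [Complex.mul_re, Complex.mul_im]
  rw [hre]
  have h := rt_abs_deBruijnPhiSummand_le n s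
  have e1 : Real.exp (t * s ^ 2 + (y - 3) * s) = Real.exp (t * s ^ 2) * Real.exp (-3 * s) * Real.exp (y * s) := by
    rw [← Real.exp_add, ← Real.exp_add]; ring_nf
  have e2 : Real.exp (t * s ^ 2 + (y - 7) * s) = Real.exp (t * s ^ 2) * Real.exp (-7 * s) * Real.exp (y * s) := by
    rw [← Real.exp_add, ← Real.exp_add]; ring_nf
  rw [e1, e2]
  have h1 := Real.exp_pos (t * s ^ 2); have h2 := Real.exp_pos (y * s)
  calc Real.exp (t * s ^ 2) * |deBruijnPhiSummand n s| * Real.exp (y * s)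
      ≤ Real.exp (t * s ^ 2) * (6 / ((n : ℝ) + 1) ^ 2 * (Real.exp (-3 * s) + Real.exp (-7 * s))) *
          Real.exp (y * s) := by gcongr
    _ = _ := by ring

/-- **DISCHARGE of `rodgersTao_H_hasSum_Q`** (eq. (18) = (32), FMP pp. 11, 17: «From (3) and Fubini's
theorem (which can be justified when `t < 0`) we conclude that
`H_t(z) = ½ Σ_{n=1}^∞ 2π²n⁴ I_t(πn², 9 + y + ix) − 3πn² I_t(πn², 5 + y + ix)`»), CONTENT:
`2H_t(z) = ∫_ℝ e^{ts²}Φ(s)e^{izs} ds` (the tree's `trigIntegral_deBruijnKernel`, with `Φ` even,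
`deBruijnPhi_neg_holds`), `Φ = Σ φ_n` (`summable_deBruijnPhi_holds`), and the exchange of sum and
integral by `MeasureTheory.hasSum_integral_of_summable_integral_norm` with the domination
`rt_norm_summand_mul_exp_le` (Gaussian in `s`, `O(1/(n+1)²)` in `n`).
[cite: RodgersTaoFMP2020, §2 eq. (18) and (32) (FMP pp. 11 and 17)] -/
theorem rodgersTao_H_hasSum_Q_holds : rodgersTao_H_hasSum_Q := by
  intro t ht x y
  set z : ℂ := (x : ℂ) - I * y with hz
  set F : ℕ → ℝ → ℂ := fun n s ↦
    ((Real.exp (t * s ^ 2) * deBruijnPhiSummand n s : ℝ) : ℂ) * Complex.exp (I * z * s) with hF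
  -- dominating function and integrability
  set g : ℝ → ℝ := fun s ↦ Real.exp (t * s ^ 2 + (y - 3) * s) + Real.exp (t * s ^ 2 + (y - 7) * s) with hg
  have hgi : Integrable g := (rt_integrable_exp_quadratic ht _).add (rt_integrable_exp_quadratic ht _)
  have hbound : ∀ n s, ‖F n s‖ ≤ 6 / ((n : ℝ) + 1) ^ 2 * g s := fun n s ↦ by
    simp only [hF, hg, hz]; exact rt_norm_summand_mul_exp_le t n x y s
  have hFmeas : ∀ n, AEStronglyMeasurable (F n) := fun n ↦ by
    have : Continuous (F n) := by
      simp only [hF]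
      exact (Complex.continuous_ofReal.comp ((by fun_prop : Continuous fun s : ℝ ↦ Real.exp (t * s ^ 2)).mul
        (rt_continuous_deBruijnPhiSummand n))).mul (by fun_prop)
    exact this.aestronglyMeasurable
  have hFint : ∀ n, Integrable (F n) := fun n ↦
    (hgi.const_mul (6 / ((n : ℝ) + 1) ^ 2)).mono' (hFmeas n) (Filter.Eventually.of_forall (hbound n))
  set G : ℝ := ∫ s, g s with hG
  have hG0 : 0 ≤ G := integral_nonneg fun s ↦ by simp only [hg]; positivity
  have hFsum : Summable fun n ↦ ∫ s, ‖F n s‖ := by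
    have hcmp : ∀ n, ∫ s, ‖F n s‖ ≤ 6 * G * (1 / ((n : ℝ) + 1) ^ 2) := fun n ↦ by
      calc ∫ s, ‖F n s‖ ≤ ∫ s, 6 / ((n : ℝ) + 1) ^ 2 * g s :=
            integral_mono (hFint n).norm (hgi.const_mul _) (hbound n)
        _ = 6 * G * (1 / ((n : ℝ) + 1) ^ 2) := by rw [integral_const_mul, hG]; ring
    have hs : Summable fun n : ℕ ↦ 6 * G * (1 / ((n : ℝ) + 1) ^ 2) := by
      have h1 : Summable fun n : ℕ ↦ 1 / ((n : ℝ) + 1) ^ 2 := by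
        have := (summable_nat_add_iff 1).mpr (Real.summable_one_div_nat_pow.mpr one_lt_two)
        simpa [Nat.cast_add, Nat.cast_one] using this
      exact h1.mul_left _
    exact Summable.of_nonneg_of_le (fun n ↦ integral_nonneg fun _ ↦ norm_nonneg _) hcmp hs
  -- the interchange
  have hHS := hasSum_integral_of_summable_integral_norm hFint hFsum
  -- the sum of the integrands is the kernel
  have hpt : ∀ s : ℝ, ∑' n, F n s = deBruijnKernel t s * Complex.exp (I * z * s) := by
    intro s
    have h1 : HasSum (fun n ↦ deBruijnPhiSummand n s) (deBruijnPhi s) := (summable_deBruijnPhi_holds s).hasSum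
    have h2 : HasSum (fun n ↦ ((deBruijnPhiSummand n s : ℝ) : ℂ)) ((deBruijnPhi s : ℝ) : ℂ) :=
      Complex.hasSum_ofReal.mpr h1
    have h3 := (h2.mul_left ((Real.exp (t * s ^ 2) : ℝ) : ℂ)).mul_right (Complex.exp (I * z * s))
    have hfun : (fun n ↦ F n s) =
        fun n ↦ ((Real.exp (t * s ^ 2) : ℝ) : ℂ) * ((deBruijnPhiSummand n s : ℝ) : ℂ) *
          Complex.exp (I * z * s) := by
      funext n; simp only [hF]; push_cast; ring
    have hval : deBruijnKernel t s * Complex.exp (I * z * s) =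
        ((Real.exp (t * s ^ 2) : ℝ) : ℂ) * ((deBruijnPhi s : ℝ) : ℂ) * Complex.exp (I * z * s) := by
      have hΦ : deBruijnPhi |s| = deBruijnPhi s := by
        rcases le_or_gt 0 s with hs | hs
        · rw [abs_of_nonneg hs]
        · rw [abs_of_neg hs, deBruijnPhi_neg_holds]
      rw [deBruijnKernel, Newman.evenPhi, hΦ]; push_cast; ring
    rw [hfun, hval]
    exact h3.tsum_eq
  have hint : ∫ s, ∑' n, F n s = 2 * deBruijnH t z := by
    rw [integral_congr_ae (Filter.Eventually.of_forall hpt)]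
    exact trigIntegral_deBruijnKernel t z
  -- each term integrates to `Q_{t,n+1}`
  have hQ : ∀ n, ∫ s, F n s = rodgersTaoQ t (n + 1) x y := by
    intro n
    have hb : 0 < π * ((n : ℝ) + 1) ^ 2 := by positivity
    have hI9 := rt_integrable_integrand_real ht hb (9 + I * z)
    have hI5 := rt_integrable_integrand_real ht hb (5 + I * z)
    have hpt' : ∀ s : ℝ, F n s = 2 * π ^ 2 * ((n : ℂ) + 1) ^ 4 *
          Complex.exp ((t : ℂ) * (s : ℂ) ^ 2 - (π * ((n : ℝ) + 1) ^ 2 : ℝ) * Complex.exp (4 * (s : ℂ)) +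
            (9 + I * z) * s) -
        3 * π * ((n : ℂ) + 1) ^ 2 *
          Complex.exp ((t : ℂ) * (s : ℂ) ^ 2 - (π * ((n : ℝ) + 1) ^ 2 : ℝ) * Complex.exp (4 * (s : ℂ)) +
            (5 + I * z) * s) := fun s ↦ by simp only [hF]; exact rt_summand_mul_exp_eq t n z s
    have hζ9 : (9 : ℂ) + I * z = 9 + y + x * I := by rw [hz]; ring_nf; rw [Complex.I_sq]; ring
    have hζ5 : (5 : ℂ) + I * z = 5 + y + x * I := by rw [hz]; ring_nf; rw [Complex.I_sq]; ring
    rw [integral_congr_ae (Filter.Eventually.of_forall hpt'), integral_sub (hI9.const_mul _) (hI5.const_mul _),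
      integral_const_mul, integral_const_mul, hζ9, hζ5, rodgersTaoQ, rodgersTaoI, rodgersTaoI]
    push_cast
    rfl
  -- conclude
  have hfun : (fun n ↦ ∫ s, F n s) = fun n ↦ rodgersTaoQ t (n + 1) x y := funext hQ
  rw [hfun, hint] at hHS
  exact hHS


/-! ## Lemma 2.3 (= FMP Lemma 6): the saddle point — uniqueness, existence, and (i) -/


/-- the map `G(w) = 4b e^{4w} − 2tw` of the proof of Lemma 2.3 has complex derivative
`16 b e^{4w} − 2t`. [folklore] -/
private theorem rt_hasDerivAt_G (t b : ℝ) (w : ℂ) :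
    HasDerivAt (fun w : ℂ ↦ 4 * (b : ℂ) * Complex.exp (4 * w) - 2 * t * w)
      (16 * (b : ℂ) * Complex.exp (4 * w) - 2 * t) w := by
  have h2 := ((((hasDerivAt_id' w).const_mul (4 : ℂ)).cexp).const_mul (4 * (b : ℂ))).sub
    ((hasDerivAt_id' w).const_mul (2 * (t : ℂ)))
  exact h2.congr_deriv (by ring)

/-- **Uniqueness in Lemma 2.3** (Rodgers–Tao 2020, Lemma 2.3 = FMP Lemma 6, p. 12: «there exists a
unique `w₀` in the strip (21) such that (23) holds»), RH-FREE CONTENT, in the generality `t ≤ 0`,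
`b > 0`, any `ζ`: the saddle-point equation `4b e^{4w₀} = ζ + 2tw₀` has at most one solution with
`0 ≤ Im w₀ < π/8`. Proof (replacing the source's argument-principle count): on the convex strip the
holomorphic map `G(w) = 4b e^{4w} − 2tw` has `Re G' = 16 b e^{4 Re w} cos(4 Im w) − 2t > 0`, hence is
injective (Noshiro–Warschawski). [cite: RodgersTaoFMP2020, Lemma 2.3 (FMP Lemma 6 p. 12)] -/
theorem rodgersTao_saddleEq_unique {t : ℝ} (ht : t ≤ 0) {b : ℝ} (hb : 0 < b) (ζ : ℂ) {w₁ w₂ : ℂ}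
    (h₁ : w₁ ∈ rodgersTaoStrip) (h₂ : w₂ ∈ rodgersTaoStrip) (e₁ : rodgersTaoSaddleEq t b ζ w₁)
    (e₂ : rodgersTaoSaddleEq t b ζ w₂) : w₁ = w₂ := by
  by_contra hne
  set d : ℂ := w₂ - w₁ with hd
  have hd0 : d ≠ 0 := sub_ne_zero.2 (Ne.symm hne)
  set G : ℂ → ℂ := fun w ↦ 4 * (b : ℂ) * Complex.exp (4 * w) - 2 * t * w with hG
  have hG12 : G w₁ = G w₂ := by
    simp only [hG]
    rw [rodgersTaoSaddleEq] at e₁ e₂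
    rw [e₁, e₂]; ring
  -- the real function ψ(s) = Re(conj d · G(w₁ + s d)) is strictly increasing on [0,1]
  set γ : ℝ → ℂ := fun s ↦ w₁ + (s : ℂ) * d with hγ
  set ψ : ℝ → ℝ := fun s ↦ ((starRingEnd ℂ) d * G (γ s)).re with hψ
  have hγd : ∀ s : ℝ, HasDerivAt γ d s := fun s ↦ by
    have := ((Complex.ofRealCLM.hasDerivAt (x := s)).mul_const d).const_add w₁
    simpa [hγ] using this
  have hψd : ∀ s : ℝ, HasDerivAt ψ
      (((starRingEnd ℂ) d * ((16 * (b : ℂ) * Complex.exp (4 * γ s) - 2 * t) * d))).re s := by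
    intro s
    have hGγ : HasDerivAt (fun s : ℝ ↦ G (γ s)) ((16 * (b : ℂ) * Complex.exp (4 * γ s) - 2 * t) * d) s :=
      (rt_hasDerivAt_G t b (γ s)).comp s (hγd s)
    have h2 := hGγ.const_mul ((starRingEnd ℂ) d)
    have h3 := Complex.reCLM.hasFDerivAt.comp_hasDerivAt s h2
    exact h3
  -- positivity of the derivative: Re(conj d · G' · d) = |d|² Re G'
  have hpos : ∀ s ∈ Icc (0 : ℝ) 1,
      0 < (((starRingEnd ℂ) d * ((16 * (b : ℂ) * Complex.exp (4 * γ s) - 2 * t) * d))).re := by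
    intro s hs
    have him : 0 ≤ (γ s).im ∧ (γ s).im < π / 8 := by
      have e : (γ s).im = (1 - s) * w₁.im + s * w₂.im := by
        simp [hγ, hd, Complex.mul_im]; ring
      rw [e]
      rcases h₁ with ⟨a1, b1⟩; rcases h₂ with ⟨a2, b2⟩
      constructor
      · nlinarith [hs.1, hs.2]
      · rcases eq_or_lt_of_le hs.1 with h0 | h0
        · rw [← h0]; simpa using b1
        · nlinarith [mul_pos h0 (sub_pos.2 b2), mul_nonneg (sub_nonneg.2 hs.2) (sub_pos.2 b1).le]
    have e : (((starRingEnd ℂ) d * ((16 * (b : ℂ) * Complex.exp (4 * γ s) - 2 * t) * d))).re =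
        Complex.normSq d * (16 * b * (Real.exp (4 * (γ s).re) * Real.cos (4 * (γ s).im)) - 2 * t) := by
      rw [show (starRingEnd ℂ) d * ((16 * (b : ℂ) * Complex.exp (4 * γ s) - 2 * t) * d) =
        ((Complex.normSq d : ℝ) : ℂ) * (16 * (b : ℂ) * Complex.exp (4 * γ s) - 2 * t) by
          rw [Complex.normSq_eq_conj_mul_self]; ring, Complex.re_ofReal_mul]
      congr 1
      have h4re : ((4 : ℂ) * γ s).re = 4 * (γ s).re := by simp
      have h4im : ((4 : ℂ) * γ s).im = 4 * (γ s).im := by simp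
      rw [Complex.sub_re, Complex.mul_re, Complex.exp_re, Complex.exp_im, h4re, h4im]
      simp
    rw [e]
    have hcos : 0 < Real.cos (4 * (γ s).im) :=
      Real.cos_pos_of_mem_Ioo ⟨by linarith [Real.pi_pos, him.1], by linarith [him.2]⟩
    have hnsq : 0 < Complex.normSq d := Complex.normSq_pos.2 hd0
    have : 0 < 16 * b * (Real.exp (4 * (γ s).re) * Real.cos (4 * (γ s).im)) - 2 * t := by
      have := Real.exp_pos (4 * (γ s).re); nlinarith [mul_pos this hcos]
    positivity
  have hmono : StrictMonoOn ψ (Icc (0 : ℝ) 1) := by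
    refine strictMonoOn_of_deriv_pos (convex_Icc 0 1)
      (fun s hs ↦ (hψd s).continuousAt.continuousWithinAt) ?_
    intro s hs
    rw [interior_Icc] at hs
    rw [(hψd s).deriv]
    exact hpos s ⟨hs.1.le, hs.2.le⟩
  have hlt := hmono ⟨le_rfl, zero_le_one⟩ ⟨zero_le_one, le_rfl⟩ zero_lt_one
  have hγ0 : γ 0 = w₁ := by simp [hγ]
  have hγ1 : γ 1 = w₂ := by simp [hγ, hd]
  simp only [hψ, hγ0, hγ1, hG12, lt_self_iff_false] at hlt



/-- `log(2 + x) ≤ 2√(2 + x)`, hence `2|C| log(2+x) ≤ x` once `x ≥ 16C² + 4` (the «`C''` large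
depending on `C`» of eq. (20)). [folklore] -/
private theorem rt_two_mul_log_le_self {C x : ℝ} (hx : 16 * C ^ 2 + 4 ≤ x) :
    2 * |C| * Real.log (2 + |x|) ≤ x := by
  have hx0 : 0 < x := by nlinarith [sq_nonneg C]
  rw [abs_of_pos hx0]
  have hs : 0 < Real.sqrt (2 + x) := Real.sqrt_pos.2 (by linarith)
  have hsq : Real.sqrt (2 + x) ^ 2 = 2 + x := Real.sq_sqrt (by linarith)
  have hlog : Real.log (2 + x) ≤ 2 * Real.sqrt (2 + x) := by
    have h1 := Real.log_le_sub_one_of_pos hs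
    have h2 : Real.log (2 + x) = 2 * Real.log (Real.sqrt (2 + x)) := by
      rw [Real.log_sqrt (by linarith)]; ring
    rw [h2]; linarith
  -- 4|C|√(2+x) ≤ x  ⟸  16 C² (2 + x) ≤ x²
  have hC := abs_nonneg C
  have key : 4 * |C| * Real.sqrt (2 + x) ≤ x := by
    have h16 : (4 * |C| * Real.sqrt (2 + x)) ^ 2 ≤ x ^ 2 := by
      rw [mul_pow, mul_pow, hsq, sq_abs]
      nlinarith [sq_nonneg C]
    exact (pow_le_pow_iff_left₀ (by positivity) hx0.le two_ne_zero).1 h16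
  calc 2 * |C| * Real.log (2 + x) ≤ 2 * |C| * (2 * Real.sqrt (2 + x)) :=
        mul_le_mul_of_nonneg_left hlog (by positivity)
    _ = 4 * |C| * Real.sqrt (2 + x) := by ring
    _ ≤ x := key

/-- **Lemma 2.3 (i) of Rodgers–Tao 2020** (= FMP Lemma 6 (i), p. 12: «`w₀` obeys `Re(4be^{4w₀}) ≥ 1`»),
RH-FREE CONTENT, in the following form with a free threshold `M` (the printed `M = 1`; `M = 4`, that
is `Re(b e^{4w₀}) ≥ 1`, is what Lemma 2.4 is applied with on p. 17): for every `T₀` and `M` there is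
`C'₀` and, for `C' ≥ C'₀` and every `C`, a `C''₀` such that for `C'' ≥ C''₀`, `−T₀ ≤ t ≤ 0`,
`b ≥ 1`, `ζ = y + ix ∈ Ω` (20) and any solution `w₀` of (23) in the strip (21),
`Re(4be^{4w₀}) = y + 2t Re w₀ ≥ M`. Proof as printed in substance (`Re w₀ ≤ ½ log x` from taking
norms in (23), then `y ≥ C' log₊ x` dominates `2|t| Re w₀ ≤ T₀ log₊ x`); constants
`C'₀ = |T₀| + max M 0 + 1`, `C''₀ = 16C² + 2|T₀| + 4`.
[cite: RodgersTaoFMP2020, Lemma 2.3 (i) (FMP Lemma 6 p. 12)] -/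
theorem rodgersTao_saddleEq_re_ge (T₀ M : ℝ) :
    ∃ C'₀ : ℝ, 0 < C'₀ ∧ ∀ C' : ℝ, C'₀ ≤ C' → ∀ C : ℝ, ∃ C''₀ : ℝ, 0 < C''₀ ∧ ∀ C'' : ℝ, C''₀ ≤ C'' →
      ∀ t ∈ Icc (-T₀) 0, ∀ b : ℝ, 1 ≤ b → ∀ ζ ∈ rodgersTaoOmega C C' C'',
        ∀ w₀ ∈ rodgersTaoStrip, rodgersTaoSaddleEq t b ζ w₀ →
          M ≤ (4 * (b : ℂ) * Complex.exp (4 * w₀)).re := by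
  refine ⟨|T₀| + max M 0 + 1, by positivity, fun C' hC' C ↦
    ⟨16 * C ^ 2 + 2 * |T₀| + 4, by positivity, fun C'' hC'' t ht b hb ζ hζ w₀ hw₀ hE ↦ ?_⟩⟩
  obtain ⟨hx, hy1, hy2⟩ := hζ
  change C' * Real.log (2 + |ζ.im|) ≤ ζ.re at hy1
  change ζ.re ≤ 2 * C * Real.log (2 + |ζ.im|) at hy2
  set x : ℝ := ζ.im with hxdef
  set y : ℝ := ζ.re with hydef
  set L : ℝ := Real.log (2 + |x|) with hL
  set α : ℝ := w₀.re with hα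
  have hx1 : 16 * C ^ 2 + 4 ≤ x := by linarith [abs_nonneg T₀]
  have hx4 : 4 ≤ x := by nlinarith [sq_nonneg C]
  have hx0 : 0 < x := by linarith
  have htT : |t| ≤ |T₀| := by
    rw [abs_of_nonpos ht.2]; have := ht.1; have := le_abs_self T₀; linarith
  have hxT : |t| ≤ x / 2 := by nlinarith [sq_nonneg C]
  have hL1 : 1 ≤ L := by
    rw [hL, abs_of_pos hx0]
    rw [← Real.log_exp 1]
    refine Real.log_le_log (Real.exp_pos 1) ?_
    have := Real.exp_one_lt_d9; norm_num at this; linarith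
  have hL0 : 0 < L := by linarith
  have hM : max M 0 + 1 ≤ C' - |T₀| := by linarith
  -- the real part of (23)
  have hre : (4 * (b : ℂ) * Complex.exp (4 * w₀)).re = y + 2 * t * α := by
    rw [rodgersTaoSaddleEq] at hE
    rw [hE]; simp [hydef, hα]
  rw [hre]
  have hy0 : 0 ≤ y :=
    le_trans (mul_nonneg (by linarith [abs_nonneg T₀, le_max_right M 0]) hL0.le) hy1
  rcases le_or_gt α 0 with hα0 | hα0
  · -- α ≤ 0: y + 2tα ≥ y ≥ C' L ≥ C' ≥ M
    have h1 : 0 ≤ 2 * t * α := by nlinarith [ht.2]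
    have h2 : M ≤ C' * L := by
      have : max M 0 + 1 ≤ C' := by linarith [abs_nonneg T₀]
      nlinarith [le_max_left M 0, le_max_right M 0]
    linarith
  · -- α > 0: first `e^{2α} ≤ x` by taking norms in (23)
    have hyx : |y| ≤ x := by
      rw [abs_of_nonneg hy0]
      exact hy2.trans ((mul_le_mul_of_nonneg_right (by linarith [le_abs_self C]) hL0.le) |>.trans
        (rt_two_mul_log_le_self hx1))
    have hnorm : 4 * b * Real.exp (4 * α) ≤ |y| + x + 2 * |t| * α + |t| := by
      have h1 : ‖4 * (b : ℂ) * Complex.exp (4 * w₀)‖ = 4 * b * Real.exp (4 * α) := by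
        rw [norm_mul, norm_mul, Complex.norm_exp, Complex.norm_real, Real.norm_of_nonneg (by linarith)]
        simp [hα]
      have h2 : ‖ζ + 2 * (t : ℂ) * w₀‖ ≤ |y| + |x| + 2 * |t| * (|α| + |w₀.im|) := by
        refine (norm_add_le _ _).trans (add_le_add (Complex.norm_le_abs_re_add_abs_im ζ) ?_)
        rw [norm_mul, norm_mul, Complex.norm_real, Real.norm_eq_abs]
        simp only [Complex.norm_ofNat]
        exact mul_le_mul_of_nonneg_left (Complex.norm_le_abs_re_add_abs_im w₀) (by positivity)
      rw [rodgersTaoSaddleEq] at hE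
      rw [← h1, hE]
      refine h2.trans ?_
      rw [abs_of_pos hx0, abs_of_pos hα0, abs_of_nonneg hw₀.1]
      have hβ : w₀.im ≤ 1 / 2 := by have := hw₀.2; linarith [Real.pi_lt_four]
      nlinarith [abs_nonneg t]
    have hexp : Real.exp (2 * α) ≤ x := by
      by_contra h
      rw [not_le] at h
      have h1 : 1 + 2 * α ≤ Real.exp (2 * α) := by linarith [Real.add_one_le_exp (2 * α)]
      have e4 : Real.exp (4 * α) = Real.exp (2 * α) * Real.exp (2 * α) := by
        rw [← Real.exp_add]; ring_nf
      have hpos : 0 < 1 + 2 * α := by linarith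
      have h3 : x * (1 + 2 * α) < Real.exp (4 * α) := by
        rw [e4]
        calc x * (1 + 2 * α) < Real.exp (2 * α) * (1 + 2 * α) := by gcongr
          _ ≤ Real.exp (2 * α) * Real.exp (2 * α) := by gcongr
      have h4 : 2 * |t| * α ≤ 2 * (x / 2) * α := by gcongr
      have h5 : Real.exp (4 * α) ≤ b * Real.exp (4 * α) := le_mul_of_one_le_left (Real.exp_pos _).le hb
      nlinarith [abs_nonneg t, mul_pos hx0 hα0]
    have hα2 : 2 * α ≤ L := by
      have := (Real.le_log_iff_exp_le hx0).2 hexp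
      rw [hL, abs_of_pos hx0]
      exact this.trans (Real.log_le_log hx0 (by linarith))
    -- conclude: y + 2tα ≥ C'L − |t| L ≥ (C' − |T₀|) L ≥ (max M 0 + 1) L ≥ M
    have h1 : 2 * t * α ≥ -(|t| * L) := by
      have : 2 * t * α = -(|t| * (2 * α)) := by rw [abs_of_nonpos ht.2]; ring
      rw [this]; exact neg_le_neg (mul_le_mul_of_nonneg_left hα2 (abs_nonneg t))
    have h2 : (max M 0 + 1) * L ≤ C' * L - |t| * L := by nlinarith
    nlinarith [le_max_left M 0, le_max_right M 0]



/-- `sin u ≤ cos u` for `0 ≤ u ≤ π/4`. [folklore] -/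
private theorem rt_sin_le_cos {u : ℝ} (h0 : 0 ≤ u) (h1 : u ≤ π / 4) : Real.sin u ≤ Real.cos u := by
  have hs : Real.sin u ≤ Real.sin (π / 4) :=
    Real.sin_le_sin_of_le_of_le_pi_div_two (by linarith [Real.pi_pos]) (by linarith [Real.pi_pos]) h1
  have hc : Real.cos (π / 4) ≤ Real.cos u :=
    Real.cos_le_cos_of_nonneg_of_le_pi h0 (by linarith [Real.pi_pos]) h1
  rw [Real.sin_pi_div_four] at hs; rw [Real.cos_pi_div_four] at hc
  linarith

set_option maxHeartbeats 400000 in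
/-- **Existence in Lemma 2.3 of Rodgers–Tao 2020** (= FMP Lemma 6, p. 12: «if `b ≥ 1` and `ζ ∈ Ω`,
then there exists a unique `w₀` in the strip (21) such that (23) holds»), RH-FREE CONTENT — the
existence half (uniqueness: `rodgersTao_saddleEq_unique`), for `−T₀ ≤ t ≤ 0`, `b ≥ 1`, `ζ ∈ Ω` with
`C' ≥ |T₀| + 1`, `C'' ≥ 64C² + 4|T₀| + 8`. Proof (replacing the source's Rouché count by an
explicit intermediate-value argument): writing `w₀ = α + iβ`, the imaginary part of (23),
`4be^{4α} sin 4β = x + 2tβ` (eq. (25)), is solved by `α(β) = ¼ log((x+2tβ)/(4b sin 4β))`, and the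
real part `4be^{4α} cos 4β = y + 2tα` (eq. (24)) becomes `f(β) := (x+2tβ) cot 4β − 2tα(β) − y = 0`,
where `f` is continuous on `(0, π/8]`, `f(π/8) = 2|t|α(π/8) − y < 0` because `y ≥ C' log₊ x >
(|t|/2) log x`, and `f(β₁) > 0` at `β₁ = min(π/16, x/(64b))`.
[cite: RodgersTaoFMP2020, Lemma 2.3 (FMP Lemma 6 p. 12)] -/
theorem rodgersTao_saddleEq_exists (T₀ : ℝ) :
    ∃ C'₀ : ℝ, 0 < C'₀ ∧ ∀ C' : ℝ, C'₀ ≤ C' → ∀ C : ℝ, ∃ C''₀ : ℝ, 0 < C''₀ ∧ ∀ C'' : ℝ, C''₀ ≤ C'' →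
      ∀ t ∈ Icc (-T₀) 0, ∀ b : ℝ, 1 ≤ b → ∀ ζ ∈ rodgersTaoOmega C C' C'',
        ∃ w₀ ∈ rodgersTaoStrip, rodgersTaoSaddleEq t b ζ w₀ := by
  refine ⟨|T₀| + 1, by positivity, fun C' hC' C ↦
    ⟨64 * C ^ 2 + 4 * |T₀| + 8, by positivity, fun C'' hC'' t ht b hb ζ hζ ↦ ?_⟩⟩
  obtain ⟨hx, hy1, hy2⟩ := hζ
  change C' * Real.log (2 + |ζ.im|) ≤ ζ.re at hy1
  change ζ.re ≤ 2 * C * Real.log (2 + |ζ.im|) at hy2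
  set x : ℝ := ζ.im with hxdef
  set y : ℝ := ζ.re with hydef
  set L : ℝ := Real.log (2 + |x|) with hL
  have hx1 : 16 * (2 * C) ^ 2 + 4 ≤ x := by linarith [abs_nonneg T₀]
  have hx8 : 8 ≤ x := by nlinarith [sq_nonneg C, abs_nonneg T₀]
  have hx0 : 0 < x := by linarith
  have htT : |t| ≤ |T₀| := by
    rw [abs_of_nonpos ht.2]; have := ht.1; have := le_abs_self T₀; linarith
  have hxT : |t| ≤ x / 4 := by nlinarith [sq_nonneg C]
  have hL0 : 0 < L := by rw [hL, abs_of_pos hx0]; exact Real.log_pos (by linarith)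
  have hlogx : Real.log x ≤ L := by rw [hL, abs_of_pos hx0]; exact Real.log_le_log hx0 (by linarith)
  have hyx : y ≤ x / 2 := by
    have h := rt_two_mul_log_le_self hx1
    rw [abs_mul, show |(2 : ℝ)| = 2 by norm_num] at h
    have : y ≤ 2 * |C| * L := hy2.trans (mul_le_mul_of_nonneg_right (by linarith [le_abs_self C]) hL0.le)
    linarith
  have hy0 : 0 < y := lt_of_lt_of_le (mul_pos (by linarith [abs_nonneg T₀]) hL0) hy1
  have hb0 : 0 < b := by linarith
  -- the functions of β
  set S : ℝ → ℝ := fun β ↦ x + 2 * t * β with hS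
  set αf : ℝ → ℝ := fun β ↦ Real.log (S β / (4 * b * Real.sin (4 * β))) / 4 with hαf
  set f : ℝ → ℝ := fun β ↦ S β * Real.cos (4 * β) / Real.sin (4 * β) - 2 * t * αf β - y with hf
  -- positivity facts on (0, π/8]
  have hSpos : ∀ β ∈ Icc (0 : ℝ) (π / 8), 3 * x / 4 ≤ S β := fun β hβ ↦ by
    simp only [hS]
    have : 2 * |t| * β ≤ 2 * (x / 4) * (π / 8) :=
      mul_le_mul (mul_le_mul_of_nonneg_left hxT (by norm_num)) hβ.2 hβ.1 (by positivity)
    have h2 : 2 * t * β = -(2 * |t| * β) := by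
      rw [abs_of_nonpos ht.2]; ring
    nlinarith [Real.pi_lt_four]
  have hsinpos : ∀ β : ℝ, 0 < β → β ≤ π / 8 → 0 < Real.sin (4 * β) := fun β h0 h1 ↦
    Real.sin_pos_of_pos_of_lt_pi (by linarith) (by linarith [Real.pi_pos])
  -- the left end point β₁
  set β₁ : ℝ := min (π / 16) (x / (64 * b)) with hβ₁
  have hβ₁pos : 0 < β₁ := lt_min (by positivity) (by positivity)
  have hβ₁le : β₁ ≤ π / 16 := min_le_left _ _
  have hβ₁x : β₁ ≤ x / (64 * b) := min_le_right _ _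
  have hβ₁8 : β₁ ≤ π / 8 := by linarith [Real.pi_pos]
  -- continuity of f on [β₁, π/8]
  have hcont : ContinuousOn f (Icc β₁ (π / 8)) := by
    have hsin_ne : ∀ β ∈ Icc β₁ (π / 8), Real.sin (4 * β) ≠ 0 := fun β hβ ↦
      (hsinpos β (by linarith [hβ.1]) hβ.2).ne'
    have harg_ne : ∀ β ∈ Icc β₁ (π / 8), S β / (4 * b * Real.sin (4 * β)) ≠ 0 := fun β hβ ↦ by
      have h1 : 0 < S β := by linarith [hSpos β ⟨by linarith [hβ.1], hβ.2⟩]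
      have h2 := hsinpos β (by linarith [hβ.1]) hβ.2
      positivity
    have hS_cont : Continuous S := by simp only [hS]; fun_prop
    have hsin_cont : Continuous fun β : ℝ ↦ Real.sin (4 * β) := by fun_prop
    have hα_cont : ContinuousOn αf (Icc β₁ (π / 8)) := by
      simp only [hαf]
      refine ContinuousOn.div_const (ContinuousOn.log ?_ harg_ne) 4
      exact hS_cont.continuousOn.div (by fun_prop) fun β hβ ↦
        mul_ne_zero (by positivity) (hsin_ne β hβ)
    simp only [hf]
    refine ((ContinuousOn.div (by fun_prop) hsin_cont.continuousOn hsin_ne).sub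
      (hα_cont.const_smul (2 * t) |>.congr fun β _ ↦ by simp [smul_eq_mul])).sub continuousOn_const
  -- key identity: 4 b e^{4 α(β)} = S β / sin 4β
  have hkey : ∀ β ∈ Icc β₁ (π / 8), 4 * b * Real.exp (4 * αf β) = S β / Real.sin (4 * β) := by
    intro β hβ
    have h1 : 0 < S β := by linarith [hSpos β ⟨by linarith [hβ.1], hβ.2⟩]
    have h2 := hsinpos β (by linarith [hβ.1]) hβ.2
    simp only [hαf]
    rw [show 4 * (Real.log (S β / (4 * b * Real.sin (4 * β))) / 4) =
      Real.log (S β / (4 * b * Real.sin (4 * β))) by ring, Real.exp_log (by positivity)]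
    field_simp
  -- f(π/8) < 0
  have hright : f (π / 8) < 0 := by
    have hs1 : Real.sin (4 * (π / 8)) = 1 := by
      rw [show 4 * (π / 8) = π / 2 by ring, Real.sin_pi_div_two]
    have hc0 : Real.cos (4 * (π / 8)) = 0 := by
      rw [show 4 * (π / 8) = π / 2 by ring, Real.cos_pi_div_two]
    have hval : f (π / 8) = -(2 * t * αf (π / 8)) - y := by
      simp only [hf]; rw [hc0, hs1]; ring
    rw [hval]
    -- 2|t| α(π/8) ≤ (|t|/2) log x < y
    have hS1 := hSpos (π / 8) ⟨by positivity, le_rfl⟩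
    have hαle : αf (π / 8) ≤ L / 4 := by
      simp only [hαf]; rw [hs1, mul_one]
      have h1 : S (π / 8) / (4 * b) ≤ x := by
        rw [div_le_iff₀ (by positivity)]
        have : S (π / 8) ≤ x := by
          simp only [hS]; nlinarith [ht.2, Real.pi_pos]
        nlinarith
      have hS1' : 0 < S (π / 8) := by linarith
      have h2 : 0 < S (π / 8) / (4 * b) := by positivity
      linarith [Real.log_le_log h2 h1]
    rcases le_or_gt (αf (π / 8)) 0 with hα0 | hα0
    · nlinarith [ht.2]
    · have h1 : -(2 * t * αf (π / 8)) ≤ 2 * |t| * (L / 4) := by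
        rw [abs_of_nonpos ht.2]; nlinarith [ht.2]
      have h2 : 2 * |t| * (L / 4) < y := by
        have : |t| * L / 2 ≤ |T₀| * L / 2 := by gcongr
        nlinarith
      linarith
  -- f(β₁) > 0
  have hleft : 0 < f β₁ := by
    have h4β : 4 * β₁ ≤ π / 4 := by linarith
    have hs := hsinpos β₁ hβ₁pos hβ₁8
    have hcs : Real.sin (4 * β₁) ≤ Real.cos (4 * β₁) := rt_sin_le_cos (by linarith) h4β
    have hS1 := hSpos β₁ ⟨hβ₁pos.le, hβ₁8⟩
    -- α(β₁) ≥ 0 since sin 4β₁ ≤ 4β₁ ≤ x/(16 b) ≤ S β₁/(4b)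
    have hsinle : Real.sin (4 * β₁) ≤ 4 * β₁ := Real.sin_le (by linarith)
    have harg : 1 ≤ S β₁ / (4 * b * Real.sin (4 * β₁)) := by
      have hb16 : 16 * b * β₁ ≤ x / 4 := by
        have := (le_div_iff₀ (by positivity : (0 : ℝ) < 64 * b)).1 hβ₁x
        linarith
      have h3 : 4 * b * Real.sin (4 * β₁) ≤ 16 * b * β₁ := by
        have := mul_le_mul_of_nonneg_left hsinle (by positivity : (0 : ℝ) ≤ 4 * b)
        linarith
      rw [le_div_iff₀ (by positivity), one_mul]
      linarith
    have hα0 : 0 ≤ αf β₁ := by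
      simp only [hαf]; exact div_nonneg (Real.log_nonneg harg) (by norm_num)
    have hSβ : 0 ≤ S β₁ := by linarith
    have h0 := mul_le_mul_of_nonneg_left hcs hSβ
    have h1 : S β₁ ≤ S β₁ * Real.cos (4 * β₁) / Real.sin (4 * β₁) := by
      rw [le_div_iff₀ hs]; linarith
    have h2 : t * αf β₁ ≤ 0 := mul_nonpos_iff.2 (Or.inr ⟨ht.2, hα0⟩)
    have h3 : f β₁ = S β₁ * Real.cos (4 * β₁) / Real.sin (4 * β₁) - 2 * t * αf β₁ - y := rfl
    rw [h3]
    linarith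
  -- intermediate value theorem on [β₁, π/8]
  obtain ⟨β, hβ, hfβ⟩ : ∃ β ∈ Icc β₁ (π / 8), f β = 0 :=
    intermediate_value_Icc' hβ₁8 hcont ⟨hright.le, hleft.le⟩
  have hβlt : β < π / 8 := by
    rcases eq_or_lt_of_le hβ.2 with h | h
    · rw [h] at hfβ; linarith
    · exact h
  have hβpos : 0 < β := lt_of_lt_of_le hβ₁pos hβ.1
  -- the saddle point
  refine ⟨⟨αf β, β⟩, ⟨hβpos.le, hβlt⟩, ?_⟩
  have hk := hkey β hβ
  have hs := hsinpos β hβpos hβlt.le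
  rw [rodgersTaoSaddleEq]
  apply Complex.ext
  · -- real parts: 4b e^{4α} cos 4β = y + 2tα
    simp only [Complex.mul_re, Complex.exp_re, Complex.exp_im, Complex.add_re, Complex.ofReal_re,
      Complex.ofReal_im, Complex.re_ofNat, Complex.im_ofNat, Complex.mul_im]
    simp only [mul_zero, sub_zero, zero_mul, add_zero]
    have : f β = 0 := hfβ
    simp only [hf] at this
    have e1 : 4 * b * (Real.exp (4 * αf β) * Real.cos (4 * β)) =
        S β * Real.cos (4 * β) / Real.sin (4 * β) := by
      rw [← mul_assoc, hk]; ring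
    rw [← hydef]
    simp only [hS] at e1 this ⊢
    linarith
  · -- imaginary parts: 4b e^{4α} sin 4β = x + 2tβ
    simp only [Complex.mul_im, Complex.exp_re, Complex.exp_im, Complex.add_im, Complex.ofReal_re,
      Complex.ofReal_im, Complex.re_ofNat, Complex.im_ofNat, Complex.mul_re]
    simp only [mul_zero, sub_zero, zero_mul, add_zero]
    have e1 : 4 * b * (Real.exp (4 * αf β) * Real.sin (4 * β)) = S β := by
      rw [← mul_assoc, hk]; field_simp
    rw [← hxdef]
    simp only [hS] at e1 ⊢
    linarith


/-- **Lemma 2.3, existence-and-uniqueness clause** (FMP Lemma 6 p. 12: «there exists a unique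
`w₀ = w₀(b, ζ)` in the strip (21) such that (23) holds»), RH-FREE CONTENT, for `−T₀ ≤ t ≤ 0`,
`b ≥ 1`, `ζ ∈ Ω` with `C' ≥ |T₀| + 1` and `C'' ≥ 64C² + 4|T₀| + 8`: the `∃!` conjunct of the named
fact `rodgersTao_saddlePoint` (whose parts (ii)–(iii) remain to be proved).
[cite: RodgersTaoFMP2020, Lemma 2.3 (FMP Lemma 6 p. 12)] -/
theorem rodgersTao_saddleEq_existsUnique (T₀ : ℝ) :
    ∃ C'₀ : ℝ, 0 < C'₀ ∧ ∀ C' : ℝ, C'₀ ≤ C' → ∀ C : ℝ, ∃ C''₀ : ℝ, 0 < C''₀ ∧ ∀ C'' : ℝ, C''₀ ≤ C'' →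
      ∀ t ∈ Icc (-T₀) 0, ∀ b : ℝ, 1 ≤ b → ∀ ζ ∈ rodgersTaoOmega C C' C'',
        ∃! w₀ : ℂ, w₀ ∈ rodgersTaoStrip ∧ rodgersTaoSaddleEq t b ζ w₀ := by
  obtain ⟨C'₀, hC'₀, h⟩ := rodgersTao_saddleEq_exists T₀
  refine ⟨C'₀, hC'₀, fun C' hC' C ↦ ?_⟩
  obtain ⟨C''₀, hC''₀, h'⟩ := h C' hC' C
  refine ⟨C''₀, hC''₀, fun C'' hC'' t ht b hb ζ hζ ↦ ?_⟩
  obtain ⟨w₀, hw₀, hE⟩ := h' C'' hC'' t ht b hb ζ hζ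
  exact ⟨w₀, ⟨hw₀, hE⟩, fun w ⟨hw, hEw⟩ ↦
    rodgersTao_saddleEq_unique ht.2 (by linarith) ζ hw hw₀ hEw hE⟩

/-- **Eq. (31) from Lemma 2.4** (FMP p. 16: «From the above two lemmas and (22), we have the
asymptotic (31)»), RH-FREE: the named fact `rodgersTao_I_asymp` (eq. (31)) follows from the named
fact `rodgersTao_I_stationary` (Lemma 2.4 = FMP Lemma 7) by the contour shift (22)
(`rodgersTao_I_shift_holds`) at the saddle point, where (23) turns `ζ + 2tw₀` into `4be^{4w₀}`, and
Lemma 2.3 (i) in the strengthened form `Re(b e^{4w₀}) ≥ 1` (`rodgersTao_saddleEq_re_ge` with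
`M = 4`), which is exactly the hypothesis `Re b ≥ 1` of Lemma 2.4 (closing the constant gap noted
in the docstring of `rodgersTao_I_asymp`). [cite: RodgersTaoFMP2020, §2 eq. (31) (FMP p. 16)] -/
theorem rodgersTao_I_asymp_of_I_stationary (h : rodgersTao_I_stationary) : rodgersTao_I_asymp := by
  intro T₀
  obtain ⟨A, hA, hst⟩ := h T₀
  obtain ⟨C'₀, hC'₀, hre⟩ := rodgersTao_saddleEq_re_ge T₀ 4
  refine ⟨C'₀, hC'₀, fun C' hC' C ↦ ?_⟩
  obtain ⟨C''₀, hC''₀, hre'⟩ := hre C' hC' C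
  refine ⟨C''₀, A, hC''₀, hA, fun C'' hC'' t ht b hb ζ hζ w₀ hw₀ hE ↦ ?_⟩
  have h4 : (4 : ℝ) ≤ (4 * (b : ℂ) * Complex.exp (4 * w₀)).re :=
    hre' C'' hC'' t ⟨ht.1, ht.2.le⟩ b hb ζ hζ w₀ hw₀ hE
  set b' : ℂ := (b : ℂ) * Complex.exp (4 * w₀) with hb'
  have hb'1 : 1 ≤ b'.re := by
    have e : (4 * (b : ℂ) * Complex.exp (4 * w₀)) = 4 * b' := by rw [hb']; ring
    rw [e] at h4
    have : (4 * b').re = 4 * b'.re := by simp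
    linarith
  have hshift := rodgersTao_I_shift_holds t ht.2 b (by linarith) ζ w₀ hw₀
  have hE' : ζ + 2 * t * w₀ = 4 * b' := by
    rw [rodgersTaoSaddleEq] at hE; rw [← hE, hb']; ring
  rw [hE', ← hb'] at hshift
  have hL := hst t ht b' hb'1
  have hexp : Complex.exp (t * w₀ ^ 2 - b * Complex.exp (4 * w₀) + ζ * w₀) =
      Complex.exp (t * w₀ ^ 2 + ζ * w₀) * Complex.exp (-b') := by
    rw [← Complex.exp_add, hb']; congr 1; ring
  rw [hshift, hexp]
  calc ‖Complex.exp (t * w₀ ^ 2 + ζ * w₀) * rodgersTaoI t b' (4 * b') -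
        (Real.sqrt (π / 8) : ℂ) * (Complex.exp (t * w₀ ^ 2 + ζ * w₀) * Complex.exp (-b')) *
          b' ^ (-(1 / 2 : ℂ))‖
      = ‖Complex.exp (t * w₀ ^ 2 + ζ * w₀)‖ *
          ‖rodgersTaoI t b' (4 * b') - (Real.sqrt (π / 8) : ℂ) * Complex.exp (-b') * b' ^ (-(1 / 2 : ℂ))‖ := by
        rw [← norm_mul]; congr 1; ring
    _ ≤ ‖Complex.exp (t * w₀ ^ 2 + ζ * w₀)‖ * (A * ‖Complex.exp (-b')‖ / ‖b'‖ ^ (3 / 2 : ℝ)) :=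
        mul_le_mul_of_nonneg_left hL (norm_nonneg _)
    _ = A * ‖Complex.exp (t * w₀ ^ 2 + ζ * w₀) * Complex.exp (-b')‖ / ‖b'‖ ^ (3 / 2 : ℝ) := by
        rw [norm_mul (Complex.exp (t * w₀ ^ 2 + ζ * w₀)) (Complex.exp (-b'))]; ring

/-! ## Lemma 2.3 (iii): the crude bound for huge `b` -/


/-- `log(2 + b) ≤ 4 (2+b)^{1/4}` in the form `log(2+b) ≤ 4 √(√(2+b))` (`b ≥ 0`). [folklore] -/
private theorem rt_log_le_four_mul_sqrt_sqrt {b : ℝ} (hb : 0 ≤ b) :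
    Real.log (2 + b) ≤ 4 * Real.sqrt (Real.sqrt (2 + b)) := by
  have h2 : 0 < 2 + b := by linarith
  have hs : 0 < Real.sqrt (2 + b) := Real.sqrt_pos.2 h2
  have hss : 0 < Real.sqrt (Real.sqrt (2 + b)) := Real.sqrt_pos.2 hs
  have e : Real.log (2 + b) = 4 * Real.log (Real.sqrt (Real.sqrt (2 + b))) := by
    rw [Real.log_sqrt hs.le, Real.log_sqrt h2.le]; ring
  rw [e]
  linarith [Real.log_le_sub_one_of_pos hss]

/-- taking norms in (23): `4b e^{4 Re w₀} ≤ |Re ζ| + |Im ζ| + 2|t|(|Re w₀| + |Im w₀|)` (the source's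
«squaring (24), (25) and summing», eq. (4b) of the proof, FMP p. 13). [folklore] -/
private theorem rt_saddle_norm_le {t b : ℝ} (hb : 0 ≤ b) {ζ w₀ : ℂ} (hE : rodgersTaoSaddleEq t b ζ w₀) :
    4 * b * Real.exp (4 * w₀.re) ≤ |ζ.re| + |ζ.im| + 2 * |t| * (|w₀.re| + |w₀.im|) := by
  have h1 : ‖4 * (b : ℂ) * Complex.exp (4 * w₀)‖ = 4 * b * Real.exp (4 * w₀.re) := by
    rw [norm_mul, norm_mul, Complex.norm_exp, Complex.norm_real, Real.norm_of_nonneg hb]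
    simp
  have h2 : ‖ζ + 2 * (t : ℂ) * w₀‖ ≤ |ζ.re| + |ζ.im| + 2 * |t| * (|w₀.re| + |w₀.im|) := by
    refine (norm_add_le _ _).trans (add_le_add (Complex.norm_le_abs_re_add_abs_im ζ) ?_)
    rw [norm_mul, norm_mul, Complex.norm_real, Real.norm_eq_abs]
    simp only [Complex.norm_ofNat]
    exact mul_le_mul_of_nonneg_left (Complex.norm_le_abs_re_add_abs_im w₀) (by positivity)
  rw [rodgersTaoSaddleEq] at hE
  rw [← h1, hE]; exact h2

/-- `2√b ≤ 4b/√(2+b)` for `b ≥ 1`. [folklore] -/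
private theorem rt_two_sqrt_le {b : ℝ} (hb : 1 ≤ b) :
    2 * Real.sqrt b ≤ 4 * b * (1 / Real.sqrt (2 + b)) := by
  have hsb : 0 < Real.sqrt b := Real.sqrt_pos.2 (by linarith)
  have hsb2 : Real.sqrt b ^ 2 = b := Real.sq_sqrt (by linarith)
  have hs2 : 0 < Real.sqrt (2 + b) := Real.sqrt_pos.2 (by linarith)
  have h3 : Real.sqrt (2 + b) ≤ 2 * Real.sqrt b := by
    have : Real.sqrt (2 + b) ^ 2 ≤ (2 * Real.sqrt b) ^ 2 := by
      rw [Real.sq_sqrt (by linarith), mul_pow, hsb2]; linarith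
    exact (pow_le_pow_iff_left₀ (Real.sqrt_nonneg _) (by positivity) two_ne_zero).1 this
  rw [mul_one_div, le_div_iff₀ hs2]
  have := mul_le_mul_of_nonneg_left h3 (by positivity : (0 : ℝ) ≤ 2 * Real.sqrt b)
  nlinarith

/-- `T₀ (2+b)^{1/4} ≤ √b` once `b ≥ 600 T₀⁴ + 8`. [folklore] -/
private theorem rt_sqrt_sqrt_le {T₀ b : ℝ} (hT : 0 < T₀) (hb : 600 * T₀ ^ 4 + 8 ≤ b) :
    T₀ * Real.sqrt (Real.sqrt (2 + b)) ≤ Real.sqrt b := by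
  have hb0 : 0 < b := by nlinarith [pow_pos hT 4]
  have hsb : 0 < Real.sqrt b := Real.sqrt_pos.2 hb0
  have h1 : T₀ ^ 4 * (2 + b) ≤ b ^ 2 := by nlinarith [pow_pos hT 4]
  have hs4 : Real.sqrt (Real.sqrt (2 + b)) ^ 4 = 2 + b := by
    rw [show (4 : ℕ) = 2 * 2 from rfl, pow_mul, Real.sq_sqrt (Real.sqrt_nonneg _),
      Real.sq_sqrt (by linarith)]
  have h2 : (T₀ * Real.sqrt (Real.sqrt (2 + b))) ^ 4 = T₀ ^ 4 * (2 + b) := by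
    rw [mul_pow, hs4]
  have h3 : Real.sqrt b ^ 4 = b ^ 2 := by
    have : Real.sqrt b ^ 4 = (Real.sqrt b ^ 2) ^ 2 := by ring
    rw [this, Real.sq_sqrt hb0.le]
  have h4 : (T₀ * Real.sqrt (Real.sqrt (2 + b))) ^ 4 ≤ Real.sqrt b ^ 4 := by rw [h2, h3]; exact h1
  exact (pow_le_pow_iff_left₀ (by positivity) hsb.le (by norm_num)).1 h4

/-- `3x ≤ √b` once `b > x e^{√x/T₀}` and `√x ≥ 24 T₀²`, `x > 0` («`1/|t|` and `x` are `O(b^{1/10})`»,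
FMP p. 14). [folklore] -/
private theorem rt_three_mul_le_sqrt {T₀ x b : ℝ} (hT : 0 < T₀) (hx0 : 0 < x)
    (hx : (24 * T₀ ^ 2) ^ 2 ≤ x) (hbx : x * Real.exp (Real.sqrt x / T₀) < b) :
    3 * x ≤ Real.sqrt b := by
  have hsx : 0 < Real.sqrt x := Real.sqrt_pos.2 hx0
  have hsx2 : Real.sqrt x ^ 2 = x := Real.sq_sqrt hx0.le
  have hb0 : 0 < b := by
    have : 1 ≤ Real.exp (Real.sqrt x / T₀) := Real.one_le_exp (by positivity)
    nlinarith
  have hsb : 0 < Real.sqrt b := Real.sqrt_pos.2 hb0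
  have hsb2 : Real.sqrt b ^ 2 = b := Real.sq_sqrt hb0.le
  have h1 : Real.sqrt x * Real.exp (Real.sqrt x / (2 * T₀)) ≤ Real.sqrt b := by
    have e : (Real.sqrt x * Real.exp (Real.sqrt x / (2 * T₀))) ^ 2 = x * Real.exp (Real.sqrt x / T₀) := by
      rw [mul_pow, hsx2, sq (Real.exp _), ← Real.exp_add]; congr 1; field_simp; ring
    have : (Real.sqrt x * Real.exp (Real.sqrt x / (2 * T₀))) ^ 2 ≤ Real.sqrt b ^ 2 := by
      rw [e, hsb2]; exact hbx.le
    exact (pow_le_pow_iff_left₀ (by positivity) hsb.le two_ne_zero).1 this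
  have h2 : (Real.sqrt x / (2 * T₀)) ^ 2 / 2 ≤ Real.exp (Real.sqrt x / (2 * T₀)) := by
    have := Real.quadratic_le_exp_of_nonneg (x := Real.sqrt x / (2 * T₀)) (by positivity)
    have : 0 ≤ Real.sqrt x / (2 * T₀) := by positivity
    linarith
  have h3 : (Real.sqrt x / (2 * T₀)) ^ 2 / 2 = x / (8 * T₀ ^ 2) := by
    rw [div_pow, hsx2]; field_simp; ring
  have h4 : 24 * T₀ ^ 2 ≤ Real.sqrt x := by
    have : (24 * T₀ ^ 2) ^ 2 ≤ Real.sqrt x ^ 2 := by rw [hsx2]; exact hx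
    exact (pow_le_pow_iff_left₀ (by positivity) hsx.le two_ne_zero).1 this
  have h5 : Real.sqrt x * (x / (8 * T₀ ^ 2)) ≤ Real.sqrt x * Real.exp (Real.sqrt x / (2 * T₀)) :=
    mul_le_mul_of_nonneg_left (h3 ▸ h2) hsx.le
  have h6 : 3 * x ≤ Real.sqrt x * (x / (8 * T₀ ^ 2)) := by
    rw [← mul_div_assoc, le_div_iff₀ (by positivity)]
    nlinarith [mul_le_mul_of_nonneg_right h4 hx0.le]
  linarith

set_option maxHeartbeats 400000 in
/-- **Lemma 2.3 (iii) of Rodgers–Tao 2020** (= FMP Lemma 6 (iii), p. 12, «crude bound for huge `b`»: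
if `ζ = y + ix ∈ Ω` and `b > x exp(√x/|t|)` then `Re w₀` is negative, in fact `−Re w₀ ≥ ⅛ log₊ b`),
RH-FREE CONTENT, for `−T₀ ≤ t < 0`, `b ≥ 1`, `ζ ∈ Ω` (`C' ≥ 1`, `C'' ≥ C''₀(C, T₀)`) and any
solution `w₀` of (23) in the strip (21); `log₊ b = log(2 + |b|)`. Proof as printed in substance:
taking norms in (23) gives `4be^{4α} ≤ 3(x + |t||α|)`; `α ≥ 0` is absurd for `b > x e^{√x/|t|}`,
and `0 < −α < ⅛ log(2+b)` would give `2√b < 4be^{4α} ≤ 3x + (3T₀/8) log(2+b)`, absurd for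
`√b > √x e^{√x/(2T₀)} ≥ 3x` and `b ≥ C''`. [cite: RodgersTaoFMP2020, Lemma 2.3 (iii) (FMP Lemma 6 p. 12)] -/
theorem rodgersTao_saddleEq_re_neg_of_huge (T₀ : ℝ) {C' : ℝ} (hC' : 1 ≤ C') (C : ℝ) :
    ∃ C''₀ : ℝ, 0 < C''₀ ∧ ∀ C'' : ℝ, C''₀ ≤ C'' →
      ∀ t ∈ Ico (-T₀) 0, ∀ b : ℝ, 1 ≤ b → ∀ ζ ∈ rodgersTaoOmega C C' C'',
        ∀ w₀ ∈ rodgersTaoStrip, rodgersTaoSaddleEq t b ζ w₀ →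
          ζ.im * Real.exp (Real.sqrt ζ.im / |t|) < b → Real.log (2 + |b|) / 8 ≤ -w₀.re := by
  refine ⟨16 * C ^ 2 + 600 * T₀ ^ 4 + 40 * |T₀| + 8, by positivity,
    fun C'' hC'' t ht b hb ζ hζ w₀ hw₀ hE hbig ↦ ?_⟩
  obtain ⟨hx, hy1, hy2⟩ := hζ
  change C' * Real.log (2 + |ζ.im|) ≤ ζ.re at hy1
  change ζ.re ≤ 2 * C * Real.log (2 + |ζ.im|) at hy2
  set x : ℝ := ζ.im with hxdef
  set y : ℝ := ζ.re with hydef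
  set L : ℝ := Real.log (2 + |x|) with hL
  set α : ℝ := w₀.re with hα
  have hx1 : 16 * C ^ 2 + 4 ≤ x := by nlinarith [sq_nonneg T₀, abs_nonneg T₀, sq_nonneg (T₀ ^ 2)]
  have hx8 : 8 ≤ x := by nlinarith [sq_nonneg C, sq_nonneg (T₀ ^ 2), abs_nonneg T₀]
  have hx0 : 0 < x := by linarith
  have hT0 : 0 < -t := by linarith [ht.2]
  have htabs : |t| = -t := abs_of_neg ht.2
  have hT₀pos : 0 < T₀ := by linarith [ht.1, ht.2]
  have htT : |t| ≤ T₀ := by rw [htabs]; linarith [ht.1]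
  have hxT : 40 * |t| ≤ x := by nlinarith [sq_nonneg C, sq_nonneg (T₀ ^ 2), abs_of_pos hT₀pos]
  have hL0 : 0 < L := by rw [hL, abs_of_pos hx0]; exact Real.log_pos (by linarith)
  have hy0 : 0 ≤ y := le_trans (mul_nonneg (by linarith) hL0.le) hy1
  -- |y| ≤ x
  have hyx : |y| ≤ x := by
    rw [abs_of_nonneg hy0]
    refine hy2.trans ((mul_le_mul_of_nonneg_right (by linarith [le_abs_self C] : 2 * C ≤ 2 * |C|)
      hL0.le).trans ?_)
    -- 2|C| L ≤ x from log(2+x) ≤ 2√(2+x) and x ≥ 16C²+4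
    have hs : 0 < Real.sqrt (2 + x) := Real.sqrt_pos.2 (by linarith)
    have hsq : Real.sqrt (2 + x) ^ 2 = 2 + x := Real.sq_sqrt (by linarith)
    have hlog : L ≤ 2 * Real.sqrt (2 + x) := by
      rw [hL, abs_of_pos hx0]
      have h1 := Real.log_le_sub_one_of_pos hs
      have h2 : Real.log (2 + x) = 2 * Real.log (Real.sqrt (2 + x)) := by
        rw [Real.log_sqrt (by linarith)]; ring
      rw [h2]; linarith
    have key : 4 * |C| * Real.sqrt (2 + x) ≤ x := by
      have h16 : (4 * |C| * Real.sqrt (2 + x)) ^ 2 ≤ x ^ 2 := by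
        rw [mul_pow, mul_pow, hsq, sq_abs]; nlinarith [sq_nonneg C]
      exact (pow_le_pow_iff_left₀ (by positivity) hx0.le two_ne_zero).1 h16
    nlinarith [abs_nonneg C]
  -- the norm inequality: 4 b e^{4α} ≤ 3x + 2|t||α|  (using |β| ≤ π/8 and 2|t| ≤ x)
  have hnorm : 4 * b * Real.exp (4 * α) ≤ 3 * x + 2 * |t| * |α| := by
    have h := rt_saddle_norm_le (by linarith) hE
    rw [← hxdef, ← hydef, ← hα, abs_of_pos hx0, abs_of_nonneg hw₀.1] at h
    have hβ : w₀.im ≤ 1 := by have := hw₀.2; linarith [Real.pi_lt_four]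
    nlinarith [abs_nonneg t, abs_nonneg α]
  -- b is huge: b > x e^{√x/|t|} ≥ x e^{√x/T₀}, in particular √b ≥ 3x and b ≥ x
  have hexpT : Real.exp (Real.sqrt x / T₀) ≤ Real.exp (Real.sqrt x / |t|) :=
    Real.exp_le_exp.2 (div_le_div_of_nonneg_left (Real.sqrt_nonneg x) (by rwa [htabs]) htT)
  have hbx : x * Real.exp (Real.sqrt x / T₀) < b :=
    lt_of_le_of_lt (mul_le_mul_of_nonneg_left hexpT hx0.le) hbig
  have hb_ge_x : x ≤ b := by
    have : 1 ≤ Real.exp (Real.sqrt x / T₀) := Real.one_le_exp (by positivity)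
    nlinarith
  have hsb2 : Real.sqrt b ^ 2 = b := Real.sq_sqrt (by linarith)
  -- √b ≥ 3x (b huge)
  have hsqrt_b : 3 * x ≤ Real.sqrt b :=
    rt_three_mul_le_sqrt hT₀pos hx0 (by nlinarith [sq_nonneg C, abs_nonneg T₀, sq_nonneg (T₀ ^ 2)]) hbx
  -- Step 1: α < 0
  have hb9 : 9 * x ^ 2 ≤ b := by
    have : (3 * x) ^ 2 ≤ Real.sqrt b ^ 2 := pow_le_pow_left₀ (by positivity) hsqrt_b 2
    rw [hsb2] at this; linarith
  have hαneg : α < 0 := by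
    by_contra h
    rw [not_lt] at h
    have h1 : 1 + 4 * α ≤ Real.exp (4 * α) := by linarith [Real.add_one_le_exp (4 * α)]
    have h2 : 4 * b * (1 + 4 * α) ≤ 4 * b * Real.exp (4 * α) :=
      mul_le_mul_of_nonneg_left h1 (by linarith)
    rw [abs_of_nonneg h] at hnorm
    have h3 : 2 * |t| * α ≤ 16 * b * α := mul_le_mul_of_nonneg_right (by linarith) h
    have h4 : 4 * b ≤ 3 * x := by linarith
    have h5 : 8 * x ≤ x ^ 2 := by rw [sq]; exact mul_le_mul_of_nonneg_right hx8 hx0.le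
    linarith
  -- Step 2: −α ≥ (1/8) log(2+b)
  rw [abs_of_pos (by linarith : (0 : ℝ) < b)]
  by_contra hcon
  rw [not_le] at hcon
  have hαabs : |α| = -α := abs_of_neg hαneg
  -- lower bound: 4 b e^{4α} > 4b / √(2+b) ≥ 2 √b
  have hlow : 2 * Real.sqrt b < 4 * b * Real.exp (4 * α) := by
    have h1 : Real.exp (-(Real.log (2 + b) / 2)) < Real.exp (4 * α) := Real.exp_lt_exp.2 (by linarith)
    have h2 : Real.exp (-(Real.log (2 + b) / 2)) = 1 / Real.sqrt (2 + b) := by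
      rw [Real.exp_neg, ← Real.log_sqrt (by linarith), Real.exp_log (Real.sqrt_pos.2 (by linarith))]
      rw [inv_eq_one_div]
    rw [h2] at h1
    calc 2 * Real.sqrt b ≤ 4 * b * (1 / Real.sqrt (2 + b)) := rt_two_sqrt_le hb
      _ < 4 * b * Real.exp (4 * α) := mul_lt_mul_of_pos_left h1 (by linarith)
  -- upper bound: 4 b e^{4α} ≤ 3x + 2|t||α| < 3x + (T₀/4) log(2+b) ≤ 3x + T₀ √√(2+b)
  have hup : 4 * b * Real.exp (4 * α) < 3 * x + T₀ * Real.sqrt (Real.sqrt (2 + b)) := by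
    have h1 : 2 * |t| * |α| ≤ 2 * T₀ * (Real.log (2 + b) / 8) := by
      rw [hαabs]; exact mul_le_mul (by linarith) hcon.le (by linarith) (by positivity)
    have h2 := rt_log_le_four_mul_sqrt_sqrt (by linarith : (0 : ℝ) ≤ b)
    have h3 : 2 * T₀ * (Real.log (2 + b) / 8) ≤ T₀ * Real.sqrt (Real.sqrt (2 + b)) := by
      nlinarith
    have h4 : 2 * |t| * |α| < 2 * |t| * (Real.log (2 + b) / 8) := by
      rw [hαabs]; exact mul_lt_mul_of_pos_left hcon (by rw [htabs]; linarith)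
    have h5 : 2 * |t| * (Real.log (2 + b) / 8) ≤ 2 * T₀ * (Real.log (2 + b) / 8) := by
      have : 0 ≤ Real.log (2 + b) := Real.log_nonneg (by linarith)
      gcongr
    linarith
  -- T₀ (2+b)^{1/4} ≤ √b for b ≥ 600 T₀⁴ + 8
  have hroot : T₀ * Real.sqrt (Real.sqrt (2 + b)) ≤ Real.sqrt b :=
    rt_sqrt_sqrt_le hT₀pos (by nlinarith [sq_nonneg C, abs_nonneg T₀])
  linarith


/-! ## Lemma 2.3 (ii): the expansion of the saddle point, and the discharge of Lemma 2.3 -/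


/-- `|log(u/x)| ≤ 2K/x` when `|u − x| ≤ K ≤ x/2`, `x > 0`. [folklore] -/
private theorem rt_abs_log_div_le {u x K : ℝ} (hx : 0 < x) (hK : |u - x| ≤ K) (hKx : K ≤ x / 2) :
    |Real.log (u / x)| ≤ 2 * K / x := by
  have hux := abs_le.1 hK
  have hK0 : 0 ≤ K := (abs_nonneg _).trans hK
  have hu : x / 2 ≤ u := by linarith
  have hu0 : 0 < u := by linarith
  have hq : 0 < u / x := by positivity
  rw [abs_le]
  constructor
  · have h1 := Real.one_sub_inv_le_log_of_pos hq
    rw [inv_div] at h1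
    have h2 : -(2 * K / x) ≤ 1 - x / u := by
      have e : 1 - x / u = (u - x) / u := by field_simp
      rw [e, le_div_iff₀ hu0]
      have h3 := mul_le_mul_of_nonneg_right hux.1 hx.le
      have h4 : K * x ≤ 2 * K * u := by nlinarith
      have h5 : -(2 * K / x) * u = -(2 * K * u) / x := by ring
      rw [h5, div_le_iff₀ hx]
      nlinarith
    linarith
  · have h1 := Real.log_le_sub_one_of_pos hq
    have h2 : u / x - 1 ≤ 2 * K / x := by
      rw [div_sub_one hx.ne', div_le_div_iff_of_pos_right hx]; linarith
    linarith

/-- for `0 < θ ≤ π/2`: `|θ − sin θ| ≤ (2 sin θ)³ / 6` (the «Taylor expansion of the arc cosine»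
of FMP p. 14, via Jordan's inequality and `sin θ > θ − θ³/6`). [folklore] -/
private theorem rt_abs_sub_sin_le {θ : ℝ} (h0 : 0 < θ) (h1 : θ ≤ π / 2) :
    |θ - Real.sin θ| ≤ (2 * Real.sin θ) ^ 3 / 6 := by
  have hs := Real.sin_le h0.le
  have hj := Real.mul_le_sin h0.le h1
  have hθ : θ ≤ 2 * Real.sin θ := by
    have hπ : θ / 2 ≤ 2 / π * θ := by
      rw [div_mul_eq_mul_div, le_div_iff₀ Real.pi_pos]
      nlinarith [Real.pi_lt_four, h0]
    linarith
  have hc := Real.sin_gt_sub_cube h0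
  rw [abs_of_nonneg (by linarith)]
  have : θ ^ 3 ≤ (2 * Real.sin θ) ^ 3 := pow_le_pow_left₀ h0.le hθ 3
  linarith

/-- real and imaginary parts of (23) for real `b`: eqs. (24)–(25) (FMP p. 12). [folklore] -/
private theorem rt_saddle_re_im {t b : ℝ} {ζ w₀ : ℂ} (hE : rodgersTaoSaddleEq t b ζ w₀) :
    4 * b * Real.exp (4 * w₀.re) * Real.cos (4 * w₀.im) = ζ.re + 2 * t * w₀.re ∧
      4 * b * Real.exp (4 * w₀.re) * Real.sin (4 * w₀.im) = ζ.im + 2 * t * w₀.im := by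
  rw [rodgersTaoSaddleEq] at hE
  have hre := congrArg Complex.re hE
  have him := congrArg Complex.im hE
  have h4re : ((4 : ℂ) * w₀).re = 4 * w₀.re := by simp
  have h4im : ((4 : ℂ) * w₀).im = 4 * w₀.im := by simp
  simp only [Complex.mul_re, Complex.mul_im, Complex.exp_re, Complex.exp_im, h4re, h4im,
    Complex.add_re, Complex.add_im, Complex.ofReal_re, Complex.ofReal_im, Complex.re_ofNat,
    Complex.im_ofNat, mul_zero, sub_zero, zero_mul, add_zero] at hre him
  constructor <;> linarith

/-- the bound `|2tα| ≤ 51 s`, `s = √x` (FMP p. 13: «`α ≤ O(log₊ x)`» and «`α ≥ −O(x^{1/2}/t)`,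
thus `tα ≪ x^{1/2}`»). [folklore] -/
private theorem rt_two_t_alpha_le {T₀ t s b α : ℝ} (ht : t ∈ Ico (-T₀) 0) (hb : 1 ≤ b)
    (hbx : b ≤ s ^ 2 * Real.exp (100 * s / |t|)) (hs : 0 < s)
    (hsT : 2 * T₀ ≤ s) (hTL : T₀ * Real.log (s ^ 2) ≤ s)
    (hulo : s ^ 2 / 2 ≤ 4 * b * Real.exp (4 * α)) (huhi : 0 < α → 4 * b * Real.exp (4 * α) ≤ 2 * s ^ 2) :
    |2 * t * α| ≤ 51 * s := by
  have hT₀ : 0 < T₀ := by linarith [ht.1, ht.2]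
  have htabs : |t| = -t := abs_of_neg ht.2
  have htT : |t| ≤ T₀ := by rw [htabs]; linarith [ht.1]
  have ht0 : 0 < |t| := by rw [htabs]; linarith [ht.2]
  have hx0 : 0 < s ^ 2 := by positivity
  rcases le_or_gt α 0 with hα | hα
  · have h2 : Real.exp (-(100 * s / |t|)) / 8 ≤ Real.exp (4 * α) := by
      rw [div_le_iff₀ (by norm_num)]
      have h3 : b * Real.exp (-(100 * s / |t|)) ≤ s ^ 2 := by
        have := mul_le_mul_of_nonneg_right hbx (Real.exp_pos (-(100 * s / |t|))).le
        rwa [mul_assoc, ← Real.exp_add, add_neg_cancel, Real.exp_zero, mul_one] at this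
      have h4 : Real.exp (-(100 * s / |t|)) ≤ b * Real.exp (-(100 * s / |t|)) :=
        le_mul_of_one_le_left (Real.exp_pos _).le hb
      nlinarith [Real.exp_pos (4 * α)]
    have h3 : -(100 * s / |t|) - Real.log 8 ≤ 4 * α := by
      have := Real.log_le_log (by positivity) h2
      rw [Real.log_exp, Real.log_div (Real.exp_pos _).ne' (by norm_num), Real.log_exp] at this
      linarith
    have hlog8 : Real.log 8 ≤ 4 := by
      rw [Real.log_le_iff_le_exp (by norm_num)]
      have := Real.quadratic_le_exp_of_nonneg (by norm_num : (0 : ℝ) ≤ 4)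
      linarith
    rw [abs_of_nonneg (by nlinarith [ht.2] : 0 ≤ 2 * t * α)]
    have h4 : -α ≤ 25 * s / |t| + 1 := by
      have : 100 * s / |t| = 4 * (25 * s / |t|) := by ring
      linarith
    have h5 : 2 * t * α = 2 * |t| * (-α) := by rw [htabs]; ring
    rw [h5]
    calc 2 * |t| * -α ≤ 2 * |t| * (25 * s / |t| + 1) :=
          mul_le_mul_of_nonneg_left h4 (by positivity)
      _ = 50 * s + 2 * |t| := by field_simp; ring
      _ ≤ 51 * s := by linarith
  · have h3 : Real.exp (2 * α) ≤ s ^ 2 := by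
      have h1 : Real.exp (4 * α) ≤ s ^ 2 := by
        have := huhi hα
        have h4 : Real.exp (4 * α) ≤ b * Real.exp (4 * α) := le_mul_of_one_le_left (Real.exp_pos _).le hb
        linarith
      exact (Real.exp_le_exp.2 (by linarith)).trans h1
    have h4 : 2 * α ≤ Real.log (s ^ 2) := (Real.le_log_iff_exp_le hx0).2 h3
    rw [abs_of_nonpos (by nlinarith [ht.2] : 2 * t * α ≤ 0)]
    have h5 : -(2 * t * α) = |t| * (2 * α) := by rw [htabs]; ring
    rw [h5]
    calc |t| * (2 * α) ≤ T₀ * Real.log (s ^ 2) := mul_le_mul htT h4 (by linarith) hT₀.le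
      _ ≤ s := hTL
      _ ≤ 51 * s := by linarith

/-- `|u − x| ≤ 1352 + T₀` (`x = s²`) from `u² = R² + S²`, `0 ≤ R ≤ 52 s`, `x − T₀ ≤ S ≤ x`, `S ≤ u`
(FMP p. 13: «`(4be^{4α})² = x² + O(x)`, so on taking square roots `4be^{4α} = x + O(1)`»). [folklore] -/
private theorem rt_u_sub_x_le {T₀ s u R S : ℝ} (hu0 : 0 < u) (husq : u ^ 2 = R ^ 2 + S ^ 2)
    (hR0 : 0 ≤ R) (hR1 : R ≤ 52 * s) (hS0 : s ^ 2 - T₀ ≤ S) (hS1 : S ≤ s ^ 2) (hST : 0 ≤ S)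
    (huS : S ≤ u) : |u - s ^ 2| ≤ 1352 + T₀ := by
  rw [abs_le]; constructor
  · linarith
  · have hR2 : R ^ 2 ≤ 2704 * s ^ 2 := by nlinarith
    have h2 : u ^ 2 ≤ (s ^ 2 + 1352) ^ 2 := by rw [husq]; nlinarith
    have := (pow_le_pow_iff_left₀ hu0.le (by positivity) two_ne_zero).1 h2
    linarith

/-- `|T| ≤ 53/s` for `s² T = R − (t/2) log(u/s²)` (the size of the main term of `cos 4β`). [folklore] -/
private theorem rt_T_le {T₀ t s u R T K₁ : ℝ} (hs : 0 < s) (hs1 : 1 ≤ s) (ht : t ∈ Icc (-T₀) 0)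
    (e : s ^ 2 * T = R - t / 2 * Real.log (u / s ^ 2)) (hR0 : 0 ≤ R) (hR1 : R ≤ 52 * s)
    (hlog2 : |Real.log (u / s ^ 2)| ≤ 2 * K₁ / s ^ 2) (hK : T₀ * K₁ ≤ s) :
    |T| ≤ 53 / s := by
  have hx0 : 0 < s ^ 2 := by positivity
  have h1 : |s ^ 2 * T| ≤ R + T₀ * K₁ / s ^ 2 := by
    rw [e]
    refine (abs_sub _ _).trans ?_
    rw [abs_of_nonneg hR0, abs_mul, abs_div, abs_of_nonpos ht.2, abs_two]
    have : -t / 2 * |Real.log (u / s ^ 2)| ≤ T₀ / 2 * (2 * K₁ / s ^ 2) :=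
      mul_le_mul (by linarith [ht.1]) hlog2 (abs_nonneg _) (by linarith [ht.1, ht.2])
    have e2 : T₀ / 2 * (2 * K₁ / s ^ 2) = T₀ * K₁ / s ^ 2 := by field_simp
    linarith
  have h2 : T₀ * K₁ / s ^ 2 ≤ s := by
    rw [div_le_iff₀ hx0]; nlinarith
  rw [abs_mul, abs_of_pos hx0] at h1
  rw [le_div_iff₀ hs]
  nlinarith [abs_nonneg T]

/-- `|cos 4β − T| ≤ 108 K₁/s³`, where `cos 4β = R/u` and `R = s²T + (t/2) log(u/s²)`. [folklore] -/
private theorem rt_cos_sub_T_le {T₀ t s u R T K₁ : ℝ} (hs : 0 < s) (ht : t ∈ Icc (-T₀) 0)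
    (hu2 : s ^ 2 / 2 ≤ u) (e : R = s ^ 2 * T + t / 2 * Real.log (u / s ^ 2)) (hux : |u - s ^ 2| ≤ K₁)
    (hTabs : |T| ≤ 53 / s) (hlog2 : |Real.log (u / s ^ 2)| ≤ 2 * K₁ / s ^ 2)
    (hsT : 2 * T₀ ≤ s) (hK₁ : 0 ≤ K₁) :
    |R / u - T| ≤ 108 * K₁ / s ^ 3 := by
  have hx0 : 0 < s ^ 2 := by positivity
  have hu0 : 0 < u := by linarith
  have e1 : R / u - T = ((s ^ 2 - u) * T + t / 2 * Real.log (u / s ^ 2)) / u := by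
    rw [e]; field_simp; ring
  rw [e1, abs_div, abs_of_pos hu0, div_le_iff₀ hu0]
  refine (abs_add_le _ _).trans ?_
  rw [abs_mul, abs_mul, abs_div, abs_of_nonpos ht.2, abs_two]
  have h1 : |s ^ 2 - u| * |T| ≤ K₁ * (53 / s) := by
    rw [abs_sub_comm]; exact mul_le_mul hux hTabs (abs_nonneg _) hK₁
  have h2 : -t / 2 * |Real.log (u / s ^ 2)| ≤ T₀ / 2 * (2 * K₁ / s ^ 2) :=
    mul_le_mul (by linarith [ht.1]) hlog2 (abs_nonneg _) (by linarith [ht.1, ht.2])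
  have h3 : T₀ / 2 * (2 * K₁ / s ^ 2) ≤ K₁ / s / 2 := by
    rw [show T₀ / 2 * (2 * K₁ / s ^ 2) = T₀ * K₁ / s ^ 2 by field_simp, div_le_iff₀ hx0]
    have e3 : K₁ / s / 2 * s ^ 2 = K₁ * s / 2 := by field_simp
    rw [e3]; nlinarith
  set q : ℝ := K₁ / s with hq
  have e4 : K₁ * (53 / s) = 53 * q := by simp only [hq]; ring
  have e5 : 108 * K₁ / s ^ 3 * (s ^ 2 / 2) = 54 * q := by simp only [hq]; field_simp; ring
  calc |s ^ 2 - u| * |T| + -t / 2 * |Real.log (u / s ^ 2)|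
      ≤ 53 * q + q / 2 := by rw [← e4]; exact add_le_add h1 (h2.trans h3)
    _ ≤ 108 * K₁ / s ^ 3 * (s ^ 2 / 2) := by
        rw [e5]; have : 0 ≤ q := by positivity
        linarith
    _ ≤ 108 * K₁ / s ^ 3 * u := by gcongr

/-- The real-variable core of Lemma 2.3 (ii) (FMP pp. 13–14), in the variable `s = √x`: from
(24)–(25) with `u = 4be^{4α}`, `0 ≤ 4β < π/2`, `−T₀ ≤ t < 0`, `1 ≤ b ≤ x e^{100√x/|t|}`,
`0 ≤ y ≤ √x`, `T₀ log x ≤ √x` and `x` large: `|α − ¼ log(x/4b)| ≤ (1352 + T₀)/x` and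
`|4β − (π/2 − y/x − t log(x/4b)/(2x))| ≤ (108 (1352+T₀) + 2·104³)/x^{3/2}`. [folklore] -/
private theorem rt_expansion_real {T₀ t s y b α β : ℝ} (ht : t ∈ Ico (-T₀) 0) (hb : 1 ≤ b)
    (hbx : b ≤ s ^ 2 * Real.exp (100 * s / |t|)) (hyx : y ≤ s) (hs : 0 < s)
    (hTL : T₀ * Real.log (s ^ 2) ≤ s) (hβ0 : 0 ≤ β) (hβ1 : β < π / 8)
    (hx : 4 * T₀ ^ 2 + 2 * (1352 + T₀) + (T₀ * (1353 + T₀)) ^ 2 + 43264 ≤ s ^ 2)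
    (h24 : 4 * b * Real.exp (4 * α) * Real.cos (4 * β) = y + 2 * t * α)
    (h25 : 4 * b * Real.exp (4 * α) * Real.sin (4 * β) = s ^ 2 + 2 * t * β) :
    |α - Real.log (s ^ 2 / (4 * b)) / 4| ≤ (1352 + T₀) / s ^ 2 ∧
      |4 * β - (π / 2 - y / s ^ 2 - t * Real.log (s ^ 2 / (4 * b)) / (2 * s ^ 2))| ≤
        (108 * (1352 + T₀) + 2 * 104 ^ 3) / s ^ 3 := by
  have hT₀ : 0 < T₀ := by linarith [ht.1, ht.2]
  have ht' : t ∈ Icc (-T₀) 0 := ⟨ht.1, ht.2.le⟩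
  have hsq1 := sq_nonneg T₀
  have hsq2 := sq_nonneg (T₀ * (1353 + T₀))
  have hx0 : 0 < s ^ 2 := by positivity
  have hsq_le : ∀ {a : ℝ}, 0 ≤ a → a ^ 2 ≤ s ^ 2 → a ≤ s := fun ha h ↦
    (pow_le_pow_iff_left₀ ha hs.le two_ne_zero).1 h
  have hs1 : 1 ≤ s := hsq_le zero_le_one (by linarith)
  have hs208 : 208 ≤ s := hsq_le (by norm_num) (by norm_num; linarith)
  have hsT : 2 * T₀ ≤ s := hsq_le (by positivity) (by linarith)
  set K₁ : ℝ := 1352 + T₀ with hK₁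
  have hK₁0 : 0 ≤ K₁ := by positivity
  have hK₁x : K₁ ≤ s ^ 2 / 2 := by linarith
  have hsK : T₀ * (K₁ + 1) ≤ s := hsq_le (by positivity) (by rw [hK₁]; linarith)
  set u : ℝ := 4 * b * Real.exp (4 * α) with hu
  have hu0 : 0 < u := by positivity
  set S : ℝ := s ^ 2 + 2 * t * β with hS
  set R : ℝ := y + 2 * t * α with hR
  have htβ : t * β ≤ 0 := mul_nonpos_iff.2 (Or.inr ⟨ht.2.le, hβ0⟩)
  have htβ' : -T₀ * β ≤ t * β := mul_le_mul_of_nonneg_right ht.1 hβ0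
  have hβT : T₀ * β ≤ T₀ * (1 / 2) := mul_le_mul_of_nonneg_left (by linarith [Real.pi_lt_four]) hT₀.le
  have hS1 : S ≤ s ^ 2 := by simp only [hS]; linarith
  have hS0 : s ^ 2 - T₀ ≤ S := by simp only [hS]; linarith
  have hST : 0 ≤ S := by linarith
  have h4β1 : 4 * β < π / 2 := by linarith
  have hcos0 : 0 < Real.cos (4 * β) := Real.cos_pos_of_mem_Ioo ⟨by linarith [Real.pi_pos], h4β1⟩
  have huS : S ≤ u := by
    have : u * Real.sin (4 * β) ≤ u * 1 := mul_le_mul_of_nonneg_left (Real.sin_le_one _) hu0.le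
    simp only [hS]; linarith
  have hR0 : 0 ≤ R := by rw [← h24]; positivity
  have husq : u ^ 2 = R ^ 2 + S ^ 2 := by
    have hcs := Real.cos_sq_add_sin_sq (4 * β)
    rw [← h24, ← h25]
    calc u ^ 2 = u ^ 2 * (Real.cos (4 * β) ^ 2 + Real.sin (4 * β) ^ 2) := by rw [hcs, mul_one]
      _ = _ := by ring
  -- |2tα| ≤ 51 s and 0 ≤ R ≤ 52 s
  have hulo : s ^ 2 / 2 ≤ u := by linarith
  have huhi : 0 < α → u ≤ 2 * s ^ 2 := fun hα ↦ by
    have htα : t * α ≤ 0 := mul_nonpos_iff.2 (Or.inr ⟨ht.2.le, hα.le⟩)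
    have h1 : R ≤ y := by simp only [hR]; linarith
    have h2 : u ≤ R + S := by
      have : u ^ 2 ≤ (R + S) ^ 2 := by
        have hRS : 0 ≤ R * S := mul_nonneg hR0 hST
        rw [husq]; linarith [show (R + S) ^ 2 = R ^ 2 + S ^ 2 + 2 * (R * S) by ring]
      exact (pow_le_pow_iff_left₀ hu0.le (by linarith) two_ne_zero).1 this
    have h3 : y ≤ s ^ 2 := hyx.trans (le_self_pow₀ hs1 two_ne_zero)
    linarith
  have h2tα := rt_two_t_alpha_le ht hb hbx hs hsT hTL hulo huhi
  have hR1 : R ≤ 52 * s := by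
    have := (abs_le.1 h2tα).2; simp only [hR]; linarith
  -- |u − x| ≤ K₁
  have hux : |u - s ^ 2| ≤ K₁ := rt_u_sub_x_le hu0 husq hR0 hR1 hS0 hS1 hST huS
  have hux2 : s ^ 2 / 2 ≤ u := by linarith [(abs_le.1 hux).1]
  -- 4α = log(u/4b)
  have h4α : 4 * α = Real.log (u / (4 * b)) := by
    simp only [hu]
    rw [show 4 * b * Real.exp (4 * α) / (4 * b) = Real.exp (4 * α) by field_simp, Real.log_exp]
  have hlogux : Real.log (u / (4 * b)) - Real.log (s ^ 2 / (4 * b)) = Real.log (u / s ^ 2) := by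
    rw [Real.log_div hu0.ne' (by positivity), Real.log_div hx0.ne' (by positivity),
      Real.log_div hu0.ne' hx0.ne']; ring
  have hlog2 := rt_abs_log_div_le hx0 hux hK₁x
  have hαmain : |α - Real.log (s ^ 2 / (4 * b)) / 4| ≤ K₁ / s ^ 2 := by
    have e : α - Real.log (s ^ 2 / (4 * b)) / 4 = Real.log (u / s ^ 2) / 4 := by
      rw [← hlogux, ← h4α]; ring
    rw [e, abs_div, abs_of_pos (by norm_num : (0 : ℝ) < 4)]
    have : 0 ≤ K₁ / s ^ 2 := by positivity
    calc |Real.log (u / s ^ 2)| / 4 ≤ (2 * K₁ / s ^ 2) / 4 := by gcongr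
      _ = K₁ / s ^ 2 / 2 := by ring
      _ ≤ K₁ / s ^ 2 := by linarith
  refine ⟨hαmain, ?_⟩
  -- θ := π/2 − 4β
  set θ : ℝ := π / 2 - 4 * β with hθ
  have hθ0 : 0 < θ := by simp only [hθ]; linarith
  have hθ1 : θ ≤ π / 2 := by simp only [hθ]; linarith
  have hsinθ : Real.sin θ = R / u := by
    simp only [hθ]; rw [Real.sin_pi_div_two_sub, ← h24]; field_simp
  have hc : R / u ≤ 104 / s := by
    rw [div_le_div_iff₀ hu0 hs]
    calc R * s ≤ 52 * s * s := mul_le_mul_of_nonneg_right hR1 hs.le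
      _ = 104 * (s ^ 2 / 2) := by ring
      _ ≤ 104 * u := by linarith
  have hθc : |θ - R / u| ≤ 2 * 104 ^ 3 / s ^ 3 := by
    have h1 := rt_abs_sub_sin_le hθ0 hθ1
    rw [hsinθ] at h1
    refine h1.trans ?_
    have h2 : (2 * (R / u)) ^ 3 ≤ (2 * (104 / s)) ^ 3 :=
      pow_le_pow_left₀ (by positivity) (by linarith) 3
    have h3 : (2 * (104 / s)) ^ 3 = 8 * 104 ^ 3 / s ^ 3 := by
      rw [mul_pow, div_pow]; ring
    rw [h3] at h2
    have : 0 ≤ 104 ^ 3 / s ^ 3 := by positivity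
    have hr : 8 * 104 ^ 3 / s ^ 3 = 8 * (104 ^ 3 / s ^ 3) := by ring
    have hr2 : 2 * 104 ^ 3 / s ^ 3 = 2 * (104 ^ 3 / s ^ 3) := by ring
    rw [hr] at h2
    rw [hr2]
    linarith
  -- T and the two estimates
  set T : ℝ := y / s ^ 2 + t * Real.log (s ^ 2 / (4 * b)) / (2 * s ^ 2) with hT
  have hRT : R = s ^ 2 * T + t / 2 * Real.log (u / s ^ 2) := by
    simp only [hT, hR]; rw [← hlogux, ← h4α]; field_simp; ring
  have hxT : s ^ 2 * T = R - t / 2 * Real.log (u / s ^ 2) := by rw [hRT]; ring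
  have hTK : T₀ * K₁ ≤ s := by
    have := mul_le_mul_of_nonneg_left (by linarith : K₁ ≤ K₁ + 1) hT₀.le; linarith
  have hTabs := rt_T_le hs hs1 ht' hxT hR0 hR1 hlog2 hTK
  have hcT := rt_cos_sub_T_le hs ht' hux2 hRT hux hTabs hlog2 hsT hK₁0
  -- assemble
  have e : 4 * β - (π / 2 - y / s ^ 2 - t * Real.log (s ^ 2 / (4 * b)) / (2 * s ^ 2)) = T - θ := by
    simp only [hT, hθ]; ring
  rw [e]
  have htri : |T - θ| ≤ |R / u - T| + |θ - R / u| := by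
    calc |T - θ| ≤ |T - R / u| + |R / u - θ| := abs_sub_le _ _ _
      _ = |R / u - T| + |θ - R / u| := by rw [abs_sub_comm T, abs_sub_comm (R / u) θ]
  refine htri.trans ?_
  rw [show (108 * (1352 + T₀) + 2 * 104 ^ 3) / s ^ 3 = 108 * K₁ / s ^ 3 + 2 * 104 ^ 3 / s ^ 3 by
    rw [hK₁]; ring]
  exact add_le_add hcT hθc

/-- `2M log(2+x) ≤ √x` once `x ≥ 8192 M⁴ + 4` (`M ≥ 0`; the «`C''` large depending on `C`»
that makes `y ≪ x^{1/2}`, FMP p. 13). [folklore] -/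
private theorem rt_log_le_sqrt {M x : ℝ} (hM : 0 ≤ M) (hx : 8192 * M ^ 4 + 4 ≤ x) :
    2 * M * Real.log (2 + |x|) ≤ Real.sqrt x := by
  have hx0 : 0 < x := by nlinarith [pow_nonneg hM 4]
  rw [abs_of_pos hx0]
  have hsx : 0 < Real.sqrt x := Real.sqrt_pos.2 hx0
  -- log(2+x) ≤ 4 (2+x)^{1/4}
  have h2 : 0 < 2 + x := by linarith
  have hs1 : 0 < Real.sqrt (2 + x) := Real.sqrt_pos.2 h2
  have hss : 0 < Real.sqrt (Real.sqrt (2 + x)) := Real.sqrt_pos.2 hs1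
  have hlog : Real.log (2 + x) ≤ 4 * Real.sqrt (Real.sqrt (2 + x)) := by
    have e : Real.log (2 + x) = 4 * Real.log (Real.sqrt (Real.sqrt (2 + x))) := by
      rw [Real.log_sqrt hs1.le, Real.log_sqrt h2.le]; ring
    rw [e]; linarith [Real.log_le_sub_one_of_pos hss]
  -- (8M (2+x)^{1/4})⁴ = 4096 M⁴ (2+x) ≤ x² = (√x)⁴
  have hs4 : Real.sqrt (Real.sqrt (2 + x)) ^ 4 = 2 + x := by
    rw [show (4 : ℕ) = 2 * 2 from rfl, pow_mul, Real.sq_sqrt hs1.le, Real.sq_sqrt h2.le]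
  have hx4 : Real.sqrt x ^ 4 = x ^ 2 := by
    have : Real.sqrt x ^ 4 = (Real.sqrt x ^ 2) ^ 2 := by ring
    rw [this, Real.sq_sqrt hx0.le]
  have key : 8 * M * Real.sqrt (Real.sqrt (2 + x)) ≤ Real.sqrt x := by
    have h1 : (8 * M * Real.sqrt (Real.sqrt (2 + x))) ^ 4 ≤ Real.sqrt x ^ 4 := by
      rw [mul_pow, hs4, hx4]; nlinarith [pow_nonneg hM 4]
    exact (pow_le_pow_iff_left₀ (by positivity) hsx.le (by norm_num)).1 h1
  calc 2 * M * Real.log (2 + x) ≤ 2 * M * (4 * Real.sqrt (Real.sqrt (2 + x))) :=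
        mul_le_mul_of_nonneg_left hlog (by positivity)
    _ = 8 * M * Real.sqrt (Real.sqrt (2 + x)) := by ring
    _ ≤ Real.sqrt x := key

/-- **Lemma 2.3 (ii) of Rodgers–Tao 2020** (= FMP Lemma 6 (ii), p. 12: «precise asymptotic for small
and medium `b`: if `ζ = y + ix` and `b ≤ x exp(100 x^{1/2}/|t|)` then
`w₀ = ¼ log(x/4b) + O^ℝ(1/x) + i(π/8 − y/(4x) − t log(x/4b)/(8x) + O^ℝ_C(log²₊ x / x^{3/2}))`»),
RH-FREE CONTENT, for `−T₀ ≤ t < 0`, `b ≥ 1`, `ζ ∈ Ω` (`C' ≥ 0`, `C'' ≥ C''₀(C, T₀)`) and any solution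
`w₀` of (23) in the strip (21); `A₁` depends on `T₀` only, `A₂` on `T₀` (the printed `O_C` is
absorbed by `C''₀`). Proof as printed (FMP pp. 13–14): (25) gives `4be^{4α} ≥ x − O(1)`; taking
norms, `(4be^{4α})² = (y+2tα)² + (x+2tβ)² = x² + O(x)` using `|tα| ≪ √x`, so `4be^{4α} = x + O(1)`
and `α = ¼ log(x/4b) + O(1/x)`; then `cos 4β = y/x + t log(x/4b)/(2x) + O(x^{-3/2})` and the
expansion of `arccos` near `0` (here: `|θ − sin θ| ≤ (2 sin θ)³/6`).
[cite: RodgersTaoFMP2020, Lemma 2.3 (ii) (FMP Lemma 6 p. 12)] -/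
theorem rodgersTao_saddleEq_expansion (T₀ : ℝ) :
    ∃ A₁ : ℝ, 0 < A₁ ∧ ∀ C' : ℝ, 0 ≤ C' → ∀ C : ℝ, ∃ C''₀ A₂ : ℝ, 0 < C''₀ ∧ 0 < A₂ ∧
      ∀ C'' : ℝ, C''₀ ≤ C'' → ∀ t ∈ Ico (-T₀) 0, ∀ b : ℝ, 1 ≤ b → ∀ ζ ∈ rodgersTaoOmega C C' C'',
        ∀ w₀ ∈ rodgersTaoStrip, rodgersTaoSaddleEq t b ζ w₀ →
          b ≤ ζ.im * Real.exp (100 * Real.sqrt ζ.im / |t|) →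
            |w₀.re - Real.log (ζ.im / (4 * b)) / 4| ≤ A₁ / ζ.im ∧
            |w₀.im - (π / 8 - ζ.re / (4 * ζ.im) - t * Real.log (ζ.im / (4 * b)) / (8 * ζ.im))| ≤
              A₂ * Real.log (2 + |ζ.im|) ^ 2 / ζ.im ^ (3 / 2 : ℝ) := by
  set M : ℝ := 108 * (1353 + |T₀|) + 2 * 104 ^ 3 with hM
  refine ⟨1353 + |T₀|, by positivity, fun C' hC' C ↦
    ⟨8192 * C ^ 4 + 512 * T₀ ^ 4 + 4 * T₀ ^ 2 + 2 * (1353 + |T₀|) + (|T₀| * (1353 + |T₀|)) ^ 2 +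
      43264 + 10, M / 4, by positivity, by positivity,
      fun C'' hC'' t ht b hb ζ hζ w₀ hw₀ hE hbig ↦ ?_⟩⟩
  obtain ⟨hx, hy1, hy2⟩ := hζ
  change C' * Real.log (2 + |ζ.im|) ≤ ζ.re at hy1
  change ζ.re ≤ 2 * C * Real.log (2 + |ζ.im|) at hy2
  set x : ℝ := ζ.im with hxdef
  set y : ℝ := ζ.re with hydef
  set L : ℝ := Real.log (2 + |x|) with hL
  have hT₀ : 0 < T₀ := by linarith [ht.1, ht.2]
  have haT : |T₀| = T₀ := abs_of_pos hT₀
  rw [haT] at hC''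
  have hsqC : 0 ≤ C ^ 4 := by positivity
  have hsq1 := pow_nonneg hT₀.le 4
  have hsq2 := sq_nonneg T₀
  have hsq3 := sq_nonneg (T₀ * (1353 + T₀))
  have hx0 : 0 < x := by linarith
  have hx1 : 1 ≤ x := by linarith
  set s : ℝ := Real.sqrt x with hsdef
  have hs : 0 < s := Real.sqrt_pos.2 hx0
  have hsx2 : s ^ 2 = x := Real.sq_sqrt hx0.le
  have hL0 : 0 < L := by rw [hL, abs_of_pos hx0]; exact Real.log_pos (by linarith)
  have hL1 : 1 ≤ L := by
    rw [hL, abs_of_pos hx0, ← Real.log_exp 1]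
    refine Real.log_le_log (Real.exp_pos 1) ?_
    have := Real.exp_one_lt_d9; norm_num at this; linarith
  -- y ≤ √x and T₀ log x ≤ √x
  have hyx : y ≤ s := by
    have h1 : y ≤ 2 * |C| * L :=
      hy2.trans (mul_le_mul_of_nonneg_right (by linarith [le_abs_self C]) hL0.le)
    have hC4 : |C| ^ 4 = C ^ 4 := by
      rw [show (4 : ℕ) = 2 * 2 from rfl, pow_mul, pow_mul, sq_abs]
    exact h1.trans (rt_log_le_sqrt (abs_nonneg C) (by rw [hC4]; linarith))
  have hTL : T₀ * Real.log (s ^ 2) ≤ s := by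
    rw [hsx2]
    have h1 : T₀ * Real.log x ≤ 2 * (T₀ / 2) * L := by
      rw [hL, abs_of_pos hx0]
      have : Real.log x ≤ Real.log (2 + x) := Real.log_le_log hx0 (by linarith)
      nlinarith
    refine h1.trans (rt_log_le_sqrt (by positivity) ?_)
    nlinarith
  -- the equations (24)–(25)
  obtain ⟨h24, h25⟩ := rt_saddle_re_im hE
  rw [← hydef] at h24
  rw [← hxdef, ← hsx2] at h25
  have hbx : b ≤ s ^ 2 * Real.exp (100 * s / |t|) := by rw [hsx2]; exact hbig
  have hxs : 4 * T₀ ^ 2 + 2 * (1352 + T₀) + (T₀ * (1353 + T₀)) ^ 2 + 43264 ≤ s ^ 2 := by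
    rw [hsx2]; linarith
  obtain ⟨hα, hβ⟩ := rt_expansion_real ht hb hbx hyx hs hTL hw₀.1 hw₀.2 hxs h24 h25
  rw [hsx2] at hα hβ
  constructor
  · exact hα.trans ((div_le_div_iff_of_pos_right hx0).2 (by linarith [le_abs_self T₀]))
  · -- |β − …| = ¼ |4β − …| ≤ M/(4 s³) ≤ (M/4) L²/x^{3/2}
    have e : w₀.im - (π / 8 - y / (4 * x) - t * Real.log (x / (4 * b)) / (8 * x)) =
        (4 * w₀.im - (π / 2 - y / x - t * Real.log (x / (4 * b)) / (2 * x))) / 4 := by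
      field_simp; ring
    rw [e, abs_div, abs_of_pos (by norm_num : (0 : ℝ) < 4)]
    have hs3 : x ^ (3 / 2 : ℝ) = s ^ 3 := by
      rw [show (3 / 2 : ℝ) = 1 + 1 / 2 by norm_num, Real.rpow_add hx0, Real.rpow_one,
        ← Real.sqrt_eq_rpow x, ← hsdef, pow_succ, hsx2]
    rw [hs3]
    have hM1 : 108 * (1352 + T₀) + 2 * 104 ^ 3 ≤ M := by rw [hM, haT]; linarith
    have hs3pos : 0 < s ^ 3 := by positivity
    calc |4 * w₀.im - (π / 2 - y / x - t * Real.log (x / (4 * b)) / (2 * x))| / 4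
        ≤ (108 * (1352 + T₀) + 2 * 104 ^ 3) / s ^ 3 / 4 := by gcongr
      _ ≤ M / s ^ 3 / 4 := by gcongr
      _ = M / 4 * 1 / s ^ 3 := by ring
      _ ≤ M / 4 * L ^ 2 / s ^ 3 := by
          gcongr
          nlinarith


/-- **DISCHARGE of `rodgersTao_saddlePoint`** (Rodgers–Tao 2020, Lemma 2.3 = FMP Lemma 6, p. 12),
CONTENT: assembled from `rodgersTao_saddleEq_existsUnique` (existence and uniqueness of the saddle
point in the strip), `rodgersTao_saddleEq_re_ge` (part (i)), `rodgersTao_saddleEq_expansion`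
(part (ii)) and `rodgersTao_saddleEq_re_neg_of_huge` (part (iii)), taking the larger thresholds.
[cite: RodgersTaoFMP2020, Lemma 2.3 (FMP Lemma 6 p. 12)] -/
theorem rodgersTao_saddlePoint_holds : rodgersTao_saddlePoint := by
  intro T₀
  obtain ⟨C₁, hC₁, hEU⟩ := rodgersTao_saddleEq_existsUnique T₀
  obtain ⟨C₂, hC₂, hRe⟩ := rodgersTao_saddleEq_re_ge T₀ 1
  obtain ⟨A₁, hA₁, hEx⟩ := rodgersTao_saddleEq_expansion T₀
  refine ⟨max C₁ (max C₂ 1), A₁, lt_max_of_lt_left hC₁, hA₁, fun C' hC' C ↦ ?_⟩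
  have hC'1 : C₁ ≤ C' := le_trans (le_max_left _ _) hC'
  have hC'2 : C₂ ≤ C' := le_trans ((le_max_left _ _).trans (le_max_right _ _)) hC'
  have hC'3 : 1 ≤ C' := le_trans ((le_max_right _ _).trans (le_max_right _ _)) hC'
  obtain ⟨D₁, hD₁, hEU'⟩ := hEU C' hC'1 C
  obtain ⟨D₂, hD₂, hRe'⟩ := hRe C' hC'2 C
  obtain ⟨D₃, A₂, hD₃, hA₂, hEx'⟩ := hEx C' (by linarith) C
  obtain ⟨D₄, hD₄, hHuge⟩ := rodgersTao_saddleEq_re_neg_of_huge T₀ hC'3 C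
  refine ⟨max D₁ (max D₂ (max D₃ D₄)), A₂, lt_max_of_lt_left hD₁, hA₂,
    fun C'' hC'' t ht b hb ζ hζ ↦ ⟨?_, fun w₀ hw₀ hE ↦ ⟨?_, ?_, ?_⟩⟩⟩
  · exact hEU' C'' (le_trans (le_max_left _ _) hC'') t ⟨ht.1, ht.2.le⟩ b hb ζ hζ
  · exact hRe' C'' (le_trans ((le_max_left _ _).trans (le_max_right _ _)) hC'') t ⟨ht.1, ht.2.le⟩
      b hb ζ hζ w₀ hw₀ hE
  · exact hEx' C'' (le_trans (((le_max_left _ _).trans (le_max_right _ _)).trans (le_max_right _ _))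
      hC'') t ht b hb ζ hζ w₀ hw₀ hE
  · exact hHuge C'' (le_trans (((le_max_right _ _).trans (le_max_right _ _)).trans (le_max_right _ _))
      hC'') t ht b hb ζ hζ w₀ hw₀ hE

/-! ## Eq. (8) from (36) and the last display of the proof of Lemma 2.1 -/


/-- numerics: `log(4π) ≤ 3` and `log π ≤ 2`. [folklore] -/
private theorem rt_log_four_pi_le : Real.log (4 * π) ≤ 3 ∧ Real.log π ≤ 2 := by
  have he := Real.exp_one_gt_d9
  have hπ := Real.pi_lt_d2
  have e3 : Real.exp 3 = Real.exp 1 ^ 3 := by rw [← Real.exp_nat_mul]; norm_num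
  have e2 : Real.exp 2 = Real.exp 1 ^ 2 := by rw [← Real.exp_nat_mul]; norm_num
  constructor
  · rw [Real.log_le_iff_le_exp (by positivity), e3]; nlinarith
  · rw [Real.log_le_iff_le_exp Real.pi_pos, e2]; nlinarith

/-- `|log(x/4π)| ≤ log(2+|x|) + 3` for `x ≥ 1`. [folklore] -/
private theorem rt_abs_log_div_four_pi_le {x : ℝ} (hx : 1 ≤ x) :
    |Real.log (x / (4 * π))| ≤ Real.log (2 + |x|) + 3 := by
  have hx0 : 0 < x := by linarith
  rw [Real.log_div hx0.ne' (by positivity), abs_of_pos hx0]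
  have h1 : 0 ≤ Real.log x := Real.log_nonneg hx
  have h2 : Real.log x ≤ Real.log (2 + x) := Real.log_le_log hx0 (by linarith)
  have h3 : 0 ≤ Real.log (4 * π) := Real.log_nonneg (by linarith [Real.pi_gt_three])
  have h4 := rt_log_four_pi_le.1
  rw [abs_le]; constructor <;> linarith

/-- `|log J_t(x) + πx/8| ≤ (1 + T₀)(log(2+|x|) + 3)²` for `x ≥ 1`, `|t| ≤ T₀` (the size of (35)). [folklore] -/
private theorem rt_log_J_bound {T₀ t x : ℝ} (hx : 1 ≤ x) (ht : |t| ≤ T₀) :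
    |Real.log (rodgersTaoJ t x) + π * x / 8| ≤ (1 + T₀) * (Real.log (2 + |x|) + 3) ^ 2 := by
  have hx0 : 0 < x := by linarith
  set L₃ : ℝ := Real.log (2 + |x|) + 3 with hL₃
  have hL₃1 : 3 ≤ L₃ := by
    have : 0 ≤ Real.log (2 + |x|) := Real.log_nonneg (by linarith [abs_nonneg x]); linarith
  have hlg := rt_abs_log_div_four_pi_le hx
  rw [← hL₃] at hlg
  have hT : 0 ≤ T₀ := (abs_nonneg t).trans ht
  -- log J = ½ log(π/(2x)) + (t/16 log²(x/4π) − tπ²/64 − πx/8)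
  have hJ : Real.log (rodgersTaoJ t x) = Real.log (π / (2 * x)) / 2 +
      (t / 16 * Real.log (x / (4 * π)) ^ 2 - t * π ^ 2 / 64 - π * x / 8) := by
    rw [rodgersTaoJ, Real.log_mul (Real.sqrt_pos.2 (by positivity)).ne' (Real.exp_pos _).ne',
      Real.log_sqrt (by positivity), Real.log_exp]
  -- |log(π/(2x))| ≤ log x + 2 ≤ L₃
  have h1 : |Real.log (π / (2 * x))| ≤ L₃ := by
    rw [Real.log_div Real.pi_pos.ne' (by positivity), Real.log_mul two_ne_zero hx0.ne']
    have hlπ := rt_log_four_pi_le.2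
    have hlπ0 : 0 ≤ Real.log π := Real.log_nonneg (by linarith [Real.pi_gt_three])
    have hl2 : Real.log 2 ≤ 1 := by
      have := Real.log_le_sub_one_of_pos (by norm_num : (0:ℝ) < 2); linarith
    have hl20 : 0 ≤ Real.log 2 := Real.log_nonneg (by norm_num)
    have hlx : 0 ≤ Real.log x := Real.log_nonneg hx
    have hlx2 : Real.log x ≤ Real.log (2 + |x|) := by
      rw [abs_of_pos hx0]; exact Real.log_le_log hx0 (by linarith)
    rw [abs_le]; constructor <;> linarith
  have h2 : |t / 16 * Real.log (x / (4 * π)) ^ 2| ≤ T₀ / 16 * L₃ ^ 2 := by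
    rw [abs_mul, abs_div, abs_of_pos (by norm_num : (0:ℝ) < 16), abs_pow]
    exact mul_le_mul (by linarith) (pow_le_pow_left₀ (abs_nonneg _) hlg 2) (by positivity)
      (by positivity)
  have h3 : |t * π ^ 2 / 64| ≤ T₀ := by
    rw [abs_div, abs_mul, abs_of_pos (by positivity : (0:ℝ) < π ^ 2), abs_of_pos (by norm_num : (0:ℝ) < 64)]
    have : π ^ 2 ≤ 16 := by nlinarith [Real.pi_lt_four, Real.pi_pos]
    rw [div_le_iff₀ (by norm_num)]
    nlinarith [abs_nonneg t]
  rw [hJ]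
  have e : Real.log (π / (2 * x)) / 2 + (t / 16 * Real.log (x / (4 * π)) ^ 2 - t * π ^ 2 / 64 -
      π * x / 8) + π * x / 8 = Real.log (π / (2 * x)) / 2 + t / 16 * Real.log (x / (4 * π)) ^ 2 -
      t * π ^ 2 / 64 := by ring
  rw [e]
  have hsum := (abs_sub (Real.log (π / (2 * x)) / 2 + t / 16 * Real.log (x / (4 * π)) ^ 2)
    (t * π ^ 2 / 64)).trans (add_le_add (abs_add_le _ _) le_rfl)
  rw [abs_div, abs_two] at hsum
  have hL9 : 9 ≤ L₃ ^ 2 := by nlinarith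
  nlinarith [hsum, h1, h2, h3, abs_nonneg (Real.log (π / (2 * x)))]

/-- **Eq. (8) for `t < 0` from eq. (36) and the last display of the proof of Lemma 2.1; eq. (8) for
`t = 0` from the `t = 0` two-sided bound** (FMP pp. 9, 18–19: «we conclude that
`H_t(x − iy) = (½ + O_C(log²₊x/x)) Q_{t,1}` … which gives (8)»), RH-FREE: the named fact
`rodgersTao_H_asymp` (eq. (8), typed for `x ≥ C''`) follows from the named facts
`rodgersTao_Q_one_asymp` (eq. (36)) and `rodgersTao_H_eq_half_Q_one` (p. 19) together with the
theorem `rodgersTao_H0_twoSided_holds` (the `t = 0` case): `|Q_{t,1}| ≍ (x/4π)^{(9+y)/4} J_t(x)`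
and `log((x/4π)^{(9+y)/4} J_t(x)) = −πx/8 + O_{C,T₀}(log²₊ x)`.
[cite: RodgersTaoFMP2020, Lemma 2.1 eq. (8) (FMP Lemma 4 p. 8 and pp. 18–19)] -/
theorem rodgersTao_H_asymp_of_Q_one (h36 : rodgersTao_Q_one_asymp)
    (h19 : rodgersTao_H_eq_half_Q_one) : rodgersTao_H_asymp := by
  intro T₀
  obtain ⟨A₀, hA₀, h0⟩ := rodgersTao_H0_twoSided_holds
  obtain ⟨C₁, hC₁, h36'⟩ := h36 T₀
  obtain ⟨C₂, hC₂, h19'⟩ := h19 T₀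
  refine ⟨max C₁ (max C₂ 6), lt_max_of_lt_left hC₁, fun C ↦ ?_⟩
  obtain ⟨D₁, A₁, hD₁, hA₁, h36''⟩ := h36' C
  obtain ⟨D₂, A₂, hD₂, hA₂, h19''⟩ := h19' C
  set A : ℝ := A₀ * (1 + |C|) ^ 2 + 16 * (1 + |T₀|) + (9 + |C|) + 10 with hA
  refine ⟨max D₁ (max D₂ (max ((A₁ / π ^ 2) ^ 2 + 1) (8192 * (A₂ + 1) ^ 4 + 4))), A,
    lt_max_of_lt_left hD₁, by positivity, fun t ht x hx κ hκ ↦ ?_⟩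
  have hx1 : D₁ ≤ x := le_trans (le_max_left _ _) hx
  have hx2 : D₂ ≤ x := le_trans ((le_max_left _ _).trans (le_max_right _ _)) hx
  have hx3 : (A₁ / π ^ 2) ^ 2 + 1 ≤ x :=
    le_trans (((le_max_left _ _).trans (le_max_right _ _)).trans (le_max_right _ _)) hx
  have hx4 : 8192 * (A₂ + 1) ^ 4 + 4 ≤ x :=
    le_trans (((le_max_right _ _).trans (le_max_right _ _)).trans (le_max_right _ _)) hx
  have hx1' : 1 ≤ x := by linarith only [hx3, sq_nonneg (A₁ / π ^ 2)]
  have hx0 : 0 < x := by linarith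
  have hκ1 : C₁ ≤ κ := le_trans (le_max_left _ _) hκ.1
  have hκ2 : C₂ ≤ κ := le_trans ((le_max_left _ _).trans (le_max_right _ _)) hκ.1
  have hκ6 : 6 ≤ κ := le_trans ((le_max_right _ _).trans (le_max_right _ _)) hκ.1
  have hκC : κ ≤ |C| := hκ.2.trans (le_abs_self C)
  have hκ0 : 0 ≤ κ := by linarith
  set L : ℝ := Real.log (2 + |x|) with hL
  have hL1 : 1 ≤ L := by
    rw [hL, abs_of_pos hx0, ← Real.log_exp 1]
    refine Real.log_le_log (Real.exp_pos 1) ?_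
    have := Real.exp_one_lt_d9; norm_num at this; linarith
  have hL0 : 0 < L := by linarith
  have hκL : κ * L ≤ |C| * L := mul_le_mul_of_nonneg_right hκC hL0.le
  have hT : |t| ≤ |T₀| := by rw [abs_of_nonpos ht.2]; have := ht.1; have := le_abs_self T₀; linarith
  change Real.exp (-(π * x / 8) - A * L ^ 2) ≤ ‖deBruijnH t ((x : ℂ) - I * ((κ * L : ℝ) : ℂ))‖ ∧
    ‖deBruijnH t ((x : ℂ) - I * ((κ * L : ℝ) : ℂ))‖ ≤ Real.exp (-(π * x / 8) + A * L ^ 2)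
  have hAL : A₀ * (1 + |C|) ^ 2 * L ^ 2 + 16 * (1 + |T₀|) * L ^ 2 + (9 + |C|) * L ^ 2 + 10 ≤
      A * L ^ 2 := by
    rw [hA]; have : 1 ≤ L ^ 2 := by nlinarith only [hL1]
    nlinarith only [this]
  have hL3 : L + 3 ≤ 4 * L := by linarith only [hL1]
  -- A₁/√x ≤ π² and A₂ L²/x ≤ 1/4 (thresholds)
  have hsx : A₁ / Real.sqrt x ≤ π ^ 2 := by
    have h1 : A₁ / π ^ 2 ≤ Real.sqrt x := Real.le_sqrt_of_sq_le (by linarith only [hx3])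
    rw [div_le_iff₀ (Real.sqrt_pos.2 hx0)]
    rw [div_le_iff₀ (by positivity)] at h1
    linarith only [h1]
  have hA₂L : A₂ * (L ^ 2 / x) ≤ 1 / 4 := by
    have h1 := rt_log_le_sqrt (by positivity : (0:ℝ) ≤ A₂ + 1) hx4
    have h2 : (2 * (A₂ + 1) * L) ^ 2 ≤ x := by
      have := pow_le_pow_left₀ (by positivity) h1 2
      rwa [Real.sq_sqrt hx0.le] at this
    rw [← mul_div_assoc, div_le_iff₀ hx0]
    have h3 : A₂ ≤ (A₂ + 1) ^ 2 := by nlinarith only [sq_nonneg A₂]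
    have h4 : A₂ * L ^ 2 ≤ (A₂ + 1) ^ 2 * L ^ 2 := mul_le_mul_of_nonneg_right h3 (sq_nonneg L)
    have h5 : (2 * (A₂ + 1) * L) ^ 2 = 4 * ((A₂ + 1) ^ 2 * L ^ 2) := by ring
    linarith only [h2, h4, h5]
  rcases eq_or_lt_of_le ht.2 with h0t | hneg
  · -- t = 0
    subst h0t
    have hy4 : 4 ≤ κ * L := by nlinarith only [hκ6, hL1]
    obtain ⟨hlo, hhi⟩ := h0 x (κ * L) hy4
    change Real.exp (-(π * |x| / 8) - A₀ * (1 + κ * L) * Real.log (2 + |(|x| + κ * L)|)) ≤ _ at hlo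
    change _ ≤ Real.exp (-(π * |x| / 8) + A₀ * (1 + κ * L) * Real.log (2 + |(|x| + κ * L)|)) at hhi
    rw [abs_of_pos hx0] at hlo hhi
    have hpos : 0 < x + κ * L := by positivity
    rw [abs_of_pos hpos] at hlo hhi
    -- A₀ (1 + κL) log(2 + x + κL) ≤ A₀ (1+|C|)² L²
    have h1 : 1 + κ * L ≤ (1 + |C|) * L := by linarith only [hL1, hκL]
    have h2 : Real.log (2 + (x + κ * L)) ≤ (1 + |C|) * L := by
      have h3 : 2 + (x + κ * L) ≤ (2 + x) * (1 + κ * L) := by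
        nlinarith only [mul_nonneg (mul_nonneg hκ0 hL0.le) hx0.le, mul_nonneg hκ0 hL0.le]
      have h4 : Real.log (2 + (x + κ * L)) ≤ Real.log ((2 + x) * (1 + κ * L)) :=
        Real.log_le_log (by positivity) h3
      rw [Real.log_mul (by positivity) (by positivity)] at h4
      have h5 : Real.log (1 + κ * L) ≤ κ * L := by
        have := Real.log_le_sub_one_of_pos (by positivity : 0 < 1 + κ * L); linarith
      have hLx : Real.log (2 + x) = L := by rw [hL, abs_of_pos hx0]
      rw [hLx] at h4
      linarith only [h4, h5, hκL]
    have h3 : A₀ * (1 + κ * L) * Real.log (2 + (x + κ * L)) ≤ A * L ^ 2 := by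
      calc A₀ * (1 + κ * L) * Real.log (2 + (x + κ * L))
          ≤ A₀ * ((1 + |C|) * L) * ((1 + |C|) * L) :=
            mul_le_mul (mul_le_mul_of_nonneg_left h1 hA₀.le) h2 (Real.log_nonneg (by linarith))
              (by positivity)
        _ = A₀ * (1 + |C|) ^ 2 * L ^ 2 := by ring
        _ ≤ A * L ^ 2 := by
            have : 0 ≤ 16 * (1 + |T₀|) * L ^ 2 + (9 + |C|) * L ^ 2 + 10 := by positivity
            linarith only [hAL, this]
    constructor
    · exact le_trans (Real.exp_le_exp.2 (by linarith only [h3])) hlo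
    · exact hhi.trans (Real.exp_le_exp.2 (by linarith only [h3]))
  · -- t < 0
    have ht' : t ∈ Ico (-T₀) 0 := ⟨ht.1, hneg⟩
    have h36x := h36'' t ht' x hx1 κ ⟨hκ1, hκ.2⟩
    have h19x := h19'' t ht' x hx2 κ ⟨hκ2, hκ.2⟩
    change |‖rodgersTaoQ t 1 x (κ * L)‖ / ((x / (4 * π)) ^ ((9 + κ * L) / 4) * rodgersTaoJ t x) -
      2 * π ^ 2| ≤ A₁ / Real.sqrt x at h36x
    change ‖deBruijnH t ((x : ℂ) - I * ((κ * L : ℝ) : ℂ)) - rodgersTaoQ t 1 x (κ * L) / 2‖ ≤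
      A₂ * (L ^ 2 / x) * ‖rodgersTaoQ t 1 x (κ * L)‖ at h19x
    set Q : ℂ := rodgersTaoQ t 1 x (κ * L) with hQ
    set P : ℝ := (x / (4 * π)) ^ ((9 + κ * L) / 4) with hP
    set J : ℝ := rodgersTaoJ t x with hJ
    set zL : ℂ := (x : ℂ) - I * ((κ * L : ℝ) : ℂ) with hzL
    have hP0 : 0 < P := Real.rpow_pos_of_pos (by positivity) _
    have hJ0 : 0 < J := rodgersTaoJ_pos t hx0
    have hPJ : 0 < P * J := mul_pos hP0 hJ0
    have hr := abs_le.1 (h36x.trans hsx)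
    have hQlo : π ^ 2 * (P * J) ≤ ‖Q‖ := by
      have := hr.1; rw [le_sub_iff_add_le, le_div_iff₀ hPJ] at this; linarith only [this]
    have hQhi : ‖Q‖ ≤ 3 * π ^ 2 * (P * J) := by
      have := hr.2; rw [sub_le_iff_le_add, div_le_iff₀ hPJ] at this; linarith only [this]
    -- ‖H‖ between ‖Q‖/4 and ‖Q‖
    have hQ2 : ‖Q / 2‖ = ‖Q‖ / 2 := by rw [norm_div]; simp
    have hD : ‖deBruijnH t zL - Q / 2‖ ≤ ‖Q‖ / 4 := by
      refine h19x.trans ?_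
      have := mul_le_mul_of_nonneg_right hA₂L (norm_nonneg Q); linarith only [this]
    have hHhi : ‖deBruijnH t zL‖ ≤ ‖Q‖ := by
      have h1 : ‖deBruijnH t zL‖ ≤ ‖Q / 2‖ + ‖deBruijnH t zL - Q / 2‖ := by
        have := norm_add_le (Q / 2) (deBruijnH t zL - Q / 2); rwa [add_sub_cancel] at this
      linarith only [h1, hQ2, hD, norm_nonneg Q]
    have hHlo : ‖Q‖ / 4 ≤ ‖deBruijnH t zL‖ := by
      have h1 : ‖Q / 2‖ ≤ ‖deBruijnH t zL‖ + ‖deBruijnH t zL - Q / 2‖ := by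
        have := norm_sub_le (deBruijnH t zL) (deBruijnH t zL - Q / 2)
        rwa [sub_sub_cancel] at this
      linarith only [h1, hQ2, hD]
    -- logarithms of P and J
    have hlogP : |Real.log P| ≤ (9 + |C|) * L ^ 2 := by
      rw [hP, Real.log_rpow (by positivity)]
      rw [abs_mul, abs_of_nonneg (by positivity : (0:ℝ) ≤ (9 + κ * L) / 4)]
      have h1 := rt_abs_log_div_four_pi_le hx1'
      rw [← hL] at h1
      have e1 : 9 * (L + 3) ≤ 36 * L ^ 2 := by nlinarith only [hL3, hL1]
      have e2 : κ * L * (L + 3) ≤ |C| * L * (4 * L) :=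
        mul_le_mul hκL hL3 (by linarith only [hL1]) (by positivity)
      have e3 : (9 + κ * L) / 4 * (L + 3) = (9 * (L + 3) + κ * L * (L + 3)) / 4 := by ring
      have e4 : |C| * L * (4 * L) = 4 * (|C| * L ^ 2) := by ring
      calc (9 + κ * L) / 4 * |Real.log (x / (4 * π))| ≤ (9 + κ * L) / 4 * (L + 3) :=
            mul_le_mul_of_nonneg_left h1 (by positivity)
        _ ≤ (9 + |C|) * L ^ 2 := by rw [e3]; rw [e4] at e2; linarith only [e1, e2]
    have hlogJ : |Real.log J + π * x / 8| ≤ 16 * (1 + |T₀|) * L ^ 2 := by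
      have h1 := rt_log_J_bound (T₀ := |T₀|) hx1' hT
      rw [← hL, ← hJ] at h1
      refine h1.trans ?_
      have h2 : (L + 3) ^ 2 ≤ 16 * L ^ 2 := by nlinarith only [hL3, hL1]
      calc (1 + |T₀|) * (L + 3) ^ 2 ≤ (1 + |T₀|) * (16 * L ^ 2) :=
            mul_le_mul_of_nonneg_left h2 (by positivity)
        _ = 16 * (1 + |T₀|) * L ^ 2 := by ring
    have hlog3 : Real.log (3 * π ^ 2) ≤ 4 := by
      rw [Real.log_le_iff_le_exp (by positivity)]
      have he := Real.exp_one_gt_d9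
      have e4 : Real.exp 4 = Real.exp 1 ^ 4 := by rw [← Real.exp_nat_mul]; norm_num
      have h2 : (2.7 : ℝ) ^ 4 ≤ Real.exp 1 ^ 4 := pow_le_pow_left₀ (by norm_num) (by linarith only [he]) 4
      have h3 : π ^ 2 ≤ 16 := by nlinarith only [Real.pi_lt_four, Real.pi_pos]
      rw [← e4] at h2
      norm_num at h2
      linarith only [h2, h3]
    have hlogq : 0 ≤ Real.log (π ^ 2 / 4) := Real.log_nonneg (by
      rw [le_div_iff₀ (by norm_num)]; nlinarith only [Real.pi_gt_three])
    have hP1 := abs_le.1 hlogP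
    have hJ1 := abs_le.1 hlogJ
    have hnn : 0 ≤ A₀ * (1 + |C|) ^ 2 * L ^ 2 := by positivity
    constructor
    · -- lower bound
      have h1 : Real.exp (-(π * x / 8) - A * L ^ 2) ≤ π ^ 2 / 4 * (P * J) := by
        rw [← Real.exp_log (by positivity : 0 < π ^ 2 / 4 * (P * J)),
          Real.log_mul (by positivity) hPJ.ne', Real.log_mul hP0.ne' hJ0.ne']
        exact Real.exp_le_exp.2 (by linarith only [hP1.1, hJ1.1, hlogq, hAL, hnn])
      linarith only [h1, hQlo, hHlo]
    · -- upper bound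
      have h1 : 3 * π ^ 2 * (P * J) ≤ Real.exp (-(π * x / 8) + A * L ^ 2) := by
        rw [← Real.exp_log (by positivity : 0 < 3 * π ^ 2 * (P * J)),
          Real.log_mul (by positivity) hPJ.ne', Real.log_mul hP0.ne' hJ0.ne']
        exact Real.exp_le_exp.2 (by linarith only [hP1.2, hJ1.2, hlog3, hAL, hnn])
      linarith only [h1, hQhi, hHhi]


/-- **DISCHARGE of `rodgersTao_I_asymp`** (Rodgers–Tao 2020, §2 eq. (31), FMP p. 16: «From the above
two lemmas and (22), we have the asymptotic (31)»), CONTENT: the reduction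
`rodgersTao_I_asymp_of_I_stationary` (eq. (22) at the saddle point + Lemma 2.3 (i) with `M = 4`)
applied to `rodgersTao_I_stationary_holds` (Lemma 2.4 = FMP Lemma 7, proved in
`RodgersTaoAsymptoticsIntegralProofs`). [cite: RodgersTaoFMP2020, §2 eq. (31) (FMP p. 16)] -/
theorem rodgersTao_I_asymp_holds : rodgersTao_I_asymp :=
  rodgersTao_I_asymp_of_I_stationary rodgersTao_I_stationary_holds

/-! ## Eq. (36): the main term `Q_{t,1}` -/

/-- The «routine but somewhat tedious calculation» of FMP p. 18 in real variables (`x = s²`,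
`b = π`): with `u = 4πe^{4α}`, `R = a + y + 2tα = u cos 4β`, `|u − x| ≤ K₁`, `|log(x/4π)| ≤ Λ`,
`|α − ¼ log(x/4π)| ≤ A₁/x`, the real part `E = t(α² − β²) − R/4 + (a + y)α − xβ` of the phase
`tw₀² − πe^{4w₀} + ζw₀` (`ζ = a + y + ix`, `w₀ = α + iβ`) satisfies
`|E − ((a+y)/4·ℓ + (t/16)ℓ² − tπ²/64 − πx/8) + ½ log(x/u)| ≤ K/x`, `ℓ = log(x/4π)`, with an explicit
`K = K(T₀, A₁, K₁, Λ, Y)`. [folklore] -/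
private theorem rt_phase_real {T₀ t x y a α β u A₁ K₁ Λ Y : ℝ} (ht : t ∈ Icc (-T₀) 0)
    (hx : 1 ≤ x) (ha0 : 0 ≤ a) (ha9 : a ≤ 9) (hy0 : 0 ≤ y) (hyY : y ≤ Y)
    (hβ0 : 0 ≤ β) (hβ1 : β < π / 8) (hu0 : 0 < u)
    (h24 : u * Real.cos (4 * β) = a + y + 2 * t * α)
    (hux : |u - x| ≤ K₁) (hK₁x : K₁ ≤ x / 2)
    (hℓ : |Real.log (x / (4 * π))| ≤ Λ) (hΛ : 1 ≤ Λ)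
    (hα : |α - Real.log (x / (4 * π)) / 4| ≤ A₁ / x) (hA₁ : 0 ≤ A₁) (hA₁x : A₁ ≤ x) :
    |(t * (α ^ 2 - β ^ 2) - (a + y + 2 * t * α) / 4 + (a + y) * α - x * β) -
        ((a + y) / 4 * Real.log (x / (4 * π)) + t / 16 * Real.log (x / (4 * π)) ^ 2 -
          t * π ^ 2 / 64 - π * x / 8) + Real.log (x / u) / 2| ≤
      ((9 + Y + T₀ * (Λ + 4)) * K₁ + 3 * (9 + Y + T₀ * (Λ + 4)) ^ 3 + (9 + Y) * A₁ +
        T₀ * A₁ * (Λ + 1) + 4 * T₀ * (9 + Y + T₀ * (Λ + 4)) + K₁) / x := by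
  have hx0 : 0 < x := by linarith
  have hT₀ : 0 ≤ T₀ := by linarith [ht.1, ht.2]
  have htabs : |t| ≤ T₀ := by rw [abs_of_nonpos ht.2]; linarith [ht.1]
  have hK₁ : 0 ≤ K₁ := (abs_nonneg _).trans hux
  set ℓ : ℝ := Real.log (x / (4 * π)) with hℓdef
  set R₀ : ℝ := 9 + Y + T₀ * (Λ + 4) with hR₀
  set R : ℝ := a + y + 2 * t * α with hR
  -- α bounds
  have hαd := abs_le.1 hα
  have hℓ' := abs_le.1 hℓ
  have hA₁x' : A₁ / x ≤ 1 := by rw [div_le_one hx0]; exact hA₁x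
  have hαabs : |α| ≤ Λ / 4 + 1 := by
    rw [abs_le]; constructor <;> linarith
  have hαsum : |α + ℓ / 4| ≤ Λ / 2 + 1 := by
    rw [abs_le]; constructor <;> linarith
  -- |2tα| ≤ T₀ (Λ/2 + 2)
  have h2tα : |2 * t * α| ≤ T₀ * (Λ / 2 + 2) := by
    rw [abs_mul, abs_mul, abs_two]
    calc 2 * |t| * |α| ≤ 2 * T₀ * (Λ / 4 + 1) :=
          mul_le_mul (by linarith) hαabs (abs_nonneg _) (by positivity)
      _ = T₀ * (Λ / 2 + 2) := by ring
  have h2tα' := abs_le.1 h2tα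
  -- 0 ≤ R ≤ R₀
  have h4β1 : 4 * β < π / 2 := by linarith
  have hcos0 : 0 < Real.cos (4 * β) := Real.cos_pos_of_mem_Ioo ⟨by linarith [Real.pi_pos], h4β1⟩
  have hR0 : 0 ≤ R := by rw [← h24]; positivity
  have hTΛ : 0 ≤ T₀ * (Λ + 4) := by positivity
  have hTΛ2 : T₀ * (Λ / 2 + 2) ≤ T₀ * (Λ + 4) := mul_le_mul_of_nonneg_left (by linarith) hT₀
  have hRR₀ : R ≤ R₀ := by simp only [hR, hR₀]; linarith only [h2tα'.2, ha9, hyY, hTΛ2]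
  have hY0 : 0 ≤ Y := hy0.trans hyY
  have hR₀9 : 9 ≤ R₀ := by simp only [hR₀]; linarith only [hY0, hTΛ]
  -- u ≥ x/2, c = R/u ≤ 2R₀/x
  have hud := abs_le.1 hux
  have hu2 : x / 2 ≤ u := by linarith
  set c : ℝ := R / u with hc
  have hc0 : 0 ≤ c := by positivity
  have hc1 : c ≤ 2 * R₀ / x := by
    rw [hc, div_le_div_iff₀ hu0 hx0]
    calc R * x ≤ R₀ * x := mul_le_mul_of_nonneg_right hRR₀ hx0.le
      _ = 2 * R₀ * (x / 2) := by ring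
      _ ≤ 2 * R₀ * u := by gcongr
  -- θ
  set θ : ℝ := π / 2 - 4 * β with hθ
  have hθ0 : 0 < θ := by simp only [hθ]; linarith
  have hθ1 : θ ≤ π / 2 := by simp only [hθ]; linarith
  have hsinθ : Real.sin θ = c := by
    simp only [hθ, hc]; rw [Real.sin_pi_div_two_sub, ← h24]; field_simp
  have hθc : |θ - c| ≤ (2 * c) ^ 3 / 6 := by rw [← hsinθ]; exact rt_abs_sub_sin_le hθ0 hθ1
  have hθ2c : θ ≤ 2 * c := by
    have hj := Real.mul_le_sin hθ0.le hθ1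
    rw [hsinθ] at hj
    have : θ / 2 ≤ 2 / π * θ := by
      rw [div_mul_eq_mul_div, le_div_iff₀ Real.pi_pos]; nlinarith only [Real.pi_lt_four, hθ0]
    linarith
  -- the pieces
  -- (1) xθ/4 − R/4 = (R/4)(x−u)/u + x(θ−c)/4
  have e1 : x * θ / 4 - R / 4 = R / 4 * ((x - u) / u) + x * (θ - c) / 4 := by
    simp only [hc]; field_simp; ring
  have b1 : |R / 4 * ((x - u) / u)| ≤ R₀ * K₁ / x := by
    rw [abs_mul, abs_div, abs_of_nonneg hR0, abs_of_pos (by norm_num : (0:ℝ) < 4), abs_div,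
      abs_of_pos hu0, abs_sub_comm]
    rw [div_mul_div_comm, div_le_div_iff₀ (by positivity) hx0]
    calc R * |u - x| * x ≤ R₀ * K₁ * x := by
          have := mul_le_mul hRR₀ hux (abs_nonneg _) (by linarith); nlinarith only [this, hx0]
      _ ≤ R₀ * K₁ * (4 * u) := by
          have : x ≤ 4 * u := by linarith
          exact mul_le_mul_of_nonneg_left this (by positivity)
      _ = R₀ * K₁ * (4 * u) := rfl
  have b2 : |x * (θ - c) / 4| ≤ 3 * R₀ ^ 3 / x := by
    rw [abs_div, abs_mul, abs_of_pos hx0, abs_of_pos (by norm_num : (0:ℝ) < 4)]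
    have e4 : 4 * R₀ / x = 2 * (2 * R₀ / x) := by ring
    have h1 : (2 * c) ^ 3 ≤ (4 * R₀ / x) ^ 3 :=
      pow_le_pow_left₀ (by positivity) (by rw [e4]; linarith only [hc1]) 3
    have h2 : x * |θ - c| ≤ x * ((4 * R₀ / x) ^ 3 / 6) :=
      mul_le_mul_of_nonneg_left (hθc.trans (by linarith only [h1])) hx0.le
    have h3 : x * ((4 * R₀ / x) ^ 3 / 6) = 64 * R₀ ^ 3 / (6 * x ^ 2) := by
      field_simp; ring
    have hR3 : 0 ≤ R₀ ^ 3 := by positivity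
    have h4 : 64 * R₀ ^ 3 / (6 * x ^ 2) ≤ 12 * R₀ ^ 3 / x := by
      rw [div_le_div_iff₀ (by positivity) hx0]
      nlinarith only [mul_nonneg hR3 (mul_nonneg hx0.le (by linarith only [hx] : (0:ℝ) ≤ x - 1)),
        mul_nonneg hR3 (sq_nonneg x)]
    have h5 : x * |θ - c| ≤ 12 * R₀ ^ 3 / x := by rw [h3] at h2; exact h2.trans h4
    have e12 : 12 * R₀ ^ 3 / x = 4 * (3 * R₀ ^ 3 / x) := by ring
    rw [e12] at h5
    linarith only [h5]
  -- (2) (a+y)(α − ℓ/4)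
  have b3 : |(a + y) * (α - ℓ / 4)| ≤ (9 + Y) * A₁ / x := by
    rw [abs_mul, abs_of_nonneg (by linarith : 0 ≤ a + y), mul_div_assoc]
    exact mul_le_mul (by linarith) hα (abs_nonneg _) (by linarith)
  -- (3) t(α² − ℓ²/16) = t (α − ℓ/4)(α + ℓ/4)
  have b4 : |t * (α ^ 2 - ℓ ^ 2 / 16)| ≤ T₀ * A₁ * (Λ + 1) / x := by
    have e : t * (α ^ 2 - ℓ ^ 2 / 16) = t * ((α - ℓ / 4) * (α + ℓ / 4)) := by ring
    rw [e, abs_mul, abs_mul]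
    calc |t| * (|α - ℓ / 4| * |α + ℓ / 4|) ≤ T₀ * (A₁ / x * (Λ / 2 + 1)) :=
          mul_le_mul htabs (mul_le_mul hα hαsum (abs_nonneg _) (by positivity)) (by positivity) hT₀
      _ ≤ T₀ * (A₁ / x * (Λ + 1)) :=
          mul_le_mul_of_nonneg_left (mul_le_mul_of_nonneg_left (by linarith only [hΛ])
            (by positivity)) hT₀
      _ = T₀ * A₁ * (Λ + 1) / x := by ring
  -- (4) t(πθ/16 − θ²/16)
  have b5 : |t * (π * θ / 16 - θ ^ 2 / 16)| ≤ 4 * T₀ * R₀ / x := by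
    rw [abs_mul]
    have hθabs : |π * θ / 16 - θ ^ 2 / 16| ≤ θ := by
      rw [abs_le]; constructor <;> nlinarith only [hθ0, hθ1, Real.pi_lt_four, Real.pi_pos]
    calc |t| * |π * θ / 16 - θ ^ 2 / 16| ≤ T₀ * (2 * (2 * R₀ / x)) :=
          mul_le_mul htabs (hθabs.trans (hθ2c.trans (by linarith))) (abs_nonneg _) hT₀
      _ = 4 * T₀ * R₀ / x := by ring
  -- (5) ½ log(x/u)
  have b6 : |Real.log (x / u) / 2| ≤ K₁ / x := by
    have h := rt_abs_log_div_le hx0 hux hK₁x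
    have e : Real.log (x / u) = -Real.log (u / x) := by
      rw [Real.log_div hx0.ne' hu0.ne', Real.log_div hu0.ne' hx0.ne']; ring
    rw [e, abs_div, abs_neg, abs_two]
    have e2 : 2 * K₁ / x = 2 * (K₁ / x) := by ring
    rw [e2] at h
    linarith only [h]
  -- assemble: the expression equals the sum of the pieces
  have hxβ : x * β = π * x / 8 - x * θ / 4 := by simp only [hθ]; ring
  have key : (t * (α ^ 2 - β ^ 2) - (a + y + 2 * t * α) / 4 + (a + y) * α - x * β) -
      ((a + y) / 4 * ℓ + t / 16 * ℓ ^ 2 - t * π ^ 2 / 64 - π * x / 8) + Real.log (x / u) / 2 =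
      (R / 4 * ((x - u) / u) + x * (θ - c) / 4) + (a + y) * (α - ℓ / 4) +
        t * (α ^ 2 - ℓ ^ 2 / 16) + t * (π * θ / 16 - θ ^ 2 / 16) + Real.log (x / u) / 2 := by
    rw [← e1, hxβ]
    have hβθ : β = π / 8 - θ / 4 := by simp only [hθ]; ring
    rw [hβθ]; simp only [hR]; ring
  rw [key]
  have hsum := abs_add_le (R / 4 * ((x - u) / u) + x * (θ - c) / 4 + (a + y) * (α - ℓ / 4) +
    t * (α ^ 2 - ℓ ^ 2 / 16) + t * (π * θ / 16 - θ ^ 2 / 16)) (Real.log (x / u) / 2)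
  have hsum2 := abs_add_le (R / 4 * ((x - u) / u) + x * (θ - c) / 4 + (a + y) * (α - ℓ / 4) +
    t * (α ^ 2 - ℓ ^ 2 / 16)) (t * (π * θ / 16 - θ ^ 2 / 16))
  have hsum3 := abs_add_le (R / 4 * ((x - u) / u) + x * (θ - c) / 4 + (a + y) * (α - ℓ / 4))
    (t * (α ^ 2 - ℓ ^ 2 / 16))
  have hsum4 := abs_add_le (R / 4 * ((x - u) / u) + x * (θ - c) / 4) ((a + y) * (α - ℓ / 4))
  have hsum5 := abs_add_le (R / 4 * ((x - u) / u)) (x * (θ - c) / 4)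
  have etot : (R₀ * K₁ + 3 * R₀ ^ 3 + (9 + Y) * A₁ + T₀ * A₁ * (Λ + 1) + 4 * T₀ * R₀ + K₁) / x =
      R₀ * K₁ / x + 3 * R₀ ^ 3 / x + (9 + Y) * A₁ / x + T₀ * A₁ * (Λ + 1) / x +
        4 * T₀ * R₀ / x + K₁ / x := by ring
  rw [etot]
  linarith only [hsum, hsum2, hsum3, hsum4, hsum5, b1, b2, b3, b4, b5, b6]


/-- real part of the phase `tw₀² − πe^{4w₀} + ζw₀` at `w₀ = α + iβ`. [folklore] -/
private theorem rt_phase_re_eq (t : ℝ) (ζ w₀ : ℂ) :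
    ((t : ℂ) * w₀ ^ 2 - (π : ℂ) * Complex.exp (4 * w₀) + ζ * w₀).re =
      t * (w₀.re ^ 2 - w₀.im ^ 2) - π * Real.exp (4 * w₀.re) * Real.cos (4 * w₀.im) +
        (ζ.re * w₀.re - ζ.im * w₀.im) := by
  have h4re : ((4 : ℂ) * w₀).re = 4 * w₀.re := by simp
  have h4im : ((4 : ℂ) * w₀).im = 4 * w₀.im := by simp
  simp only [Complex.sub_re, Complex.add_re, Complex.mul_re, Complex.ofReal_re, Complex.ofReal_im,
    Complex.exp_re, h4re, h4im, sq, zero_mul, sub_zero, Complex.mul_im]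
  ring

/-- `‖z^{-1/2}‖ = ‖z‖^{-1/2}` (principal branch, `z ≠ 0`). [folklore] -/
private theorem rt_norm_cpow_neg_half {z : ℂ} (hz : z ≠ 0) :
    ‖z ^ (-(1 / 2 : ℂ))‖ = ‖z‖ ^ (-(1 / 2 : ℝ)) := by
  rw [Complex.norm_cpow_of_ne_zero hz]
  have him : (-(1 / 2 : ℂ)).im = 0 := by simp
  have hre : (-(1 / 2 : ℂ)).re = -(1 / 2 : ℝ) := by simp
  rw [him, hre, mul_zero, Real.exp_zero, div_one]

/-- `√v = exp(log v / 2)` for `v > 0`. [folklore] -/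
private theorem rt_sqrt_eq_exp {v : ℝ} (hv : 0 < v) : Real.sqrt v = Real.exp (Real.log v / 2) := by
  rw [← Real.log_sqrt hv.le, Real.exp_log (Real.sqrt_pos.2 hv)]

/-- closeness of `u = 4πe^{4α}` to `x` from the expansion of `α`. [folklore] -/
private theorem rt_u_close {x α A₁ : ℝ} (hx : 0 < x) (hA : 4 * A₁ ≤ x)
    (hα : |α - Real.log (x / (4 * π)) / 4| ≤ A₁ / x) :
    |4 * π * Real.exp (4 * α) - x| ≤ 8 * A₁ := by
  set δ : ℝ := α - Real.log (x / (4 * π)) / 4 with hδ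
  have hA₁ : 0 ≤ A₁ := by
    have h0 : 0 ≤ A₁ / x := (abs_nonneg _).trans hα
    by_contra h
    rw [not_le] at h
    have : A₁ / x < 0 := div_neg_of_neg_of_pos h hx
    linarith
  have e : 4 * π * Real.exp (4 * α) = x * Real.exp (4 * δ) := by
    have : 4 * α = Real.log (x / (4 * π)) + 4 * δ := by simp only [hδ]; ring
    rw [this, Real.exp_add, Real.exp_log (by positivity)]
    field_simp
  rw [e]
  have h4δ : |4 * δ| ≤ 1 := by
    rw [abs_mul, show |(4:ℝ)| = 4 by norm_num]
    have : |δ| ≤ A₁ / x := hα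
    have h2 : A₁ / x ≤ 1 / 4 := by rw [div_le_div_iff₀ hx (by norm_num)]; linarith
    linarith
  have h1 := Real.abs_exp_sub_one_le h4δ
  have e2 : x * Real.exp (4 * δ) - x = x * (Real.exp (4 * δ) - 1) := by ring
  rw [e2, abs_mul, abs_of_pos hx]
  have h3 : |δ| ≤ A₁ / x := hα
  rw [abs_mul, show |(4:ℝ)| = 4 by norm_num] at h1
  calc x * |Real.exp (4 * δ) - 1| ≤ x * (2 * (4 * (A₁ / x))) := by
        refine mul_le_mul_of_nonneg_left (h1.trans ?_) hx.le; linarith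
    _ = 8 * A₁ := by field_simp; ring

/-- the identity `√(π/8) e^E (u/4)^{-1/2} = (x/4π)^{q/4} · (√(π/(2x)) e^G) · e^D` with
`D = E − (q/4 · ℓ + G) + ½ log(x/u)`, `ℓ = log(x/4π)`. [folklore] -/
private theorem rt_main_eq {x u E G q : ℝ} (hx : 0 < x) (hu : 0 < u) :
    Real.sqrt (π / 8) * Real.exp E * (u / 4) ^ (-(1 / 2 : ℝ)) =
      (x / (4 * π)) ^ (q / 4) * (Real.sqrt (π / (2 * x)) * Real.exp G) *
        Real.exp (E - (q / 4 * Real.log (x / (4 * π)) + G) + Real.log (x / u) / 2) := by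
  rw [rt_sqrt_eq_exp (by positivity : 0 < π / 8), rt_sqrt_eq_exp (by positivity : 0 < π / (2 * x)),
    Real.rpow_def_of_pos (by positivity : 0 < u / 4), Real.rpow_def_of_pos (by positivity : 0 < x / (4 * π))]
  rw [← Real.exp_add, ← Real.exp_add, ← Real.exp_add, ← Real.exp_add, ← Real.exp_add]
  congr 1
  have h8 : Real.log (π / 8) = Real.log π - Real.log 4 - Real.log 2 := by
    rw [Real.log_div Real.pi_pos.ne' (by norm_num), show (8:ℝ) = 4 * 2 by norm_num,
      Real.log_mul (by norm_num) (by norm_num)]; ring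
  have hu4 : Real.log (u / 4) = Real.log u - Real.log 4 := Real.log_div hu.ne' (by norm_num)
  have h2x : Real.log (π / (2 * x)) = Real.log π - Real.log 2 - Real.log x := by
    rw [Real.log_div Real.pi_pos.ne' (by positivity), Real.log_mul two_ne_zero hx.ne']; ring
  have hxu : Real.log (x / u) = Real.log x - Real.log u := Real.log_div hx.ne' hu.ne'
  rw [h8, hu4, h2x, hxu]; ring

/-- from the (31) error to a relative error: `A e^E/(u/4)^{3/2} ≤ (16A/x) · (√(π/8) e^E (u/4)^{-1/2})`
when `x/2 ≤ u`. [folklore] -/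
private theorem rt_err_rel {x u E A : ℝ} (hx : 0 < x) (hu : x / 2 ≤ u) (hA : 0 ≤ A) :
    A * Real.exp E / (u / 4) ^ (3 / 2 : ℝ) ≤
      16 * A / x * (Real.sqrt (π / 8) * Real.exp E * (u / 4) ^ (-(1 / 2 : ℝ))) := by
  have hv : 0 < u / 4 := by linarith
  have hsq : (1 : ℝ) / 2 ≤ Real.sqrt (π / 8) := by
    rw [show (1:ℝ)/2 = Real.sqrt (1/4) by rw [show (1:ℝ)/4 = (1/2)^2 by norm_num, Real.sqrt_sq (by norm_num)]]
    exact Real.sqrt_le_sqrt (by linarith [Real.pi_gt_three])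
  have h32 : (u / 4) ^ (3 / 2 : ℝ) = (u / 4) * (u / 4) ^ (1 / 2 : ℝ) := by
    rw [show (3 / 2 : ℝ) = 1 + 1 / 2 by norm_num, Real.rpow_add hv, Real.rpow_one]
  have hm12 : (u / 4) ^ (-(1 / 2 : ℝ)) = 1 / (u / 4) ^ (1 / 2 : ℝ) := by
    rw [Real.rpow_neg hv.le, inv_eq_one_div]
  have hr : 0 < (u / 4) ^ (1 / 2 : ℝ) := Real.rpow_pos_of_pos hv _
  rw [h32, hm12, div_le_iff₀ (by positivity)]
  -- A e^E ≤ (16A/x) √(π/8) e^E / r * ((u/4) r)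
  have e : 16 * A / x * (Real.sqrt (π / 8) * Real.exp E * (1 / (u / 4) ^ (1 / 2 : ℝ))) *
      (u / 4 * (u / 4) ^ (1 / 2 : ℝ)) = A * Real.exp E * (16 * Real.sqrt (π / 8) * (u / 4) / x) := by
    field_simp
  rw [e]
  have hfac : 1 ≤ 16 * Real.sqrt (π / 8) * (u / 4) / x := by
    rw [le_div_iff₀ hx]; nlinarith [hsq, hu]
  have hAE : 0 ≤ A * Real.exp E := mul_nonneg hA (Real.exp_pos _).le
  nlinarith [hfac, hAE]

/-- `log(2+x) ≤ 4 (2+x)^{1/4}` as `log(2+x) ≤ 4 √(√(2+x))` (`x ≥ 0`). [folklore] -/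
private theorem rt_log_le_four_q {x : ℝ} (hx : 0 ≤ x) :
    Real.log (2 + x) ≤ 4 * Real.sqrt (Real.sqrt (2 + x)) := by
  have h2 : 0 < 2 + x := by linarith
  have hs : 0 < Real.sqrt (2 + x) := Real.sqrt_pos.2 h2
  have hss : 0 < Real.sqrt (Real.sqrt (2 + x)) := Real.sqrt_pos.2 hs
  have e : Real.log (2 + x) = 4 * Real.log (Real.sqrt (Real.sqrt (2 + x))) := by
    rw [Real.log_sqrt hs.le, Real.log_sqrt h2.le]; ring
  rw [e]; linarith [Real.log_le_sub_one_of_pos hss]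

/-- the threshold that makes `K₀ L³ ≤ x`: if `x ≥ (64K₀ + 2)⁴` then `K₀ log(2+x)³ ≤ x`. [folklore] -/
private theorem rt_KL3_le {K₀ x : ℝ} (hK : 0 ≤ K₀) (hx : (64 * K₀ + 2) ^ 4 ≤ x) :
    K₀ * Real.log (2 + |x|) ^ 3 ≤ x := by
  have hx0 : 0 < x := lt_of_lt_of_le (by positivity) hx
  rw [abs_of_pos hx0]
  set q : ℝ := Real.sqrt (Real.sqrt (2 + x)) with hq
  have hq0 : 0 < q := Real.sqrt_pos.2 (Real.sqrt_pos.2 (by linarith))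
  have hq4 : q ^ 4 = 2 + x := by
    rw [show (4:ℕ) = 2 * 2 from rfl, pow_mul, hq, Real.sq_sqrt (Real.sqrt_nonneg _),
      Real.sq_sqrt (by linarith)]
  have hL := rt_log_le_four_q hx0.le
  rw [← hq] at hL
  have hL0 : 0 ≤ Real.log (2 + x) := Real.log_nonneg (by linarith)
  have hL3 : Real.log (2 + x) ^ 3 ≤ (4 * q) ^ 3 := pow_le_pow_left₀ hL0 hL 3
  have hqK : 64 * K₀ + 2 ≤ q := by
    have : (64 * K₀ + 2) ^ 4 ≤ q ^ 4 := by rw [hq4]; linarith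
    exact (pow_le_pow_iff_left₀ (by positivity) hq0.le (by norm_num)).1 this
  -- K₀ (4q)³ = 64 K₀ q³ ≤ q³ (q − 2) ≤ q⁴ − 2 = x   (q ≥ 2, q³ ≥ 1)
  have hq1 : 1 ≤ q := by linarith
  have hq3 : 1 ≤ q ^ 3 := one_le_pow₀ hq1
  calc K₀ * Real.log (2 + x) ^ 3 ≤ K₀ * (4 * q) ^ 3 := mul_le_mul_of_nonneg_left hL3 hK
    _ = 64 * K₀ * q ^ 3 := by ring
    _ ≤ (q - 2) * q ^ 3 := mul_le_mul_of_nonneg_right (by linarith) (by positivity)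
    _ ≤ q ^ 4 - 2 := by nlinarith only [hq3, hq1]
    _ = x := by rw [hq4]; ring

/-- the constant of `rt_phase_real` with `K₁ = 8A₁`, `Λ = L + 3`, `Y = (1+|C|)L` is `≤ K₀ L³`. [folklore] -/
private theorem rt_K_bound {T₀ A₁ C L : ℝ} (hT : 0 ≤ T₀) (hA : 0 ≤ A₁) (hL : 1 ≤ L) :
    ((9 + (1 + |C|) * L + T₀ * ((L + 3) + 4)) * (8 * A₁) + 3 * (9 + (1 + |C|) * L + T₀ * ((L + 3) + 4)) ^ 3 +
        (9 + (1 + |C|) * L) * A₁ + T₀ * A₁ * ((L + 3) + 1) +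
        4 * T₀ * (9 + (1 + |C|) * L + T₀ * ((L + 3) + 4)) + 8 * A₁) ≤
      (8 * A₁ * (17 + |C| + 8 * T₀) + 3 * (17 + |C| + 8 * T₀) ^ 3 + (10 + |C|) * A₁ + 5 * T₀ * A₁ +
        4 * T₀ * (17 + |C| + 8 * T₀) + 8 * A₁) * L ^ 3 := by
  set r₀ : ℝ := 17 + |C| + 8 * T₀ with hr₀
  set R₀ : ℝ := 9 + (1 + |C|) * L + T₀ * ((L + 3) + 4) with hR₀
  have hC := abs_nonneg C
  have hR₀le : R₀ ≤ r₀ * L := by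
    simp only [hR₀, hr₀]; nlinarith only [hL, hT, hC]
  have hR₀0 : 0 ≤ R₀ := by simp only [hR₀]; positivity
  have hL2 : 1 ≤ L ^ 2 := one_le_pow₀ hL
  have hL3 : L ≤ L ^ 3 := by nlinarith only [hL, hL2]
  have hL13 : 1 ≤ L ^ 3 := one_le_pow₀ hL
  have hr0 : 0 ≤ r₀ := by simp only [hr₀]; positivity
  have h1 : R₀ * (8 * A₁) ≤ 8 * A₁ * r₀ * L ^ 3 := by
    have e1 := mul_le_mul_of_nonneg_right hR₀le (by positivity : 0 ≤ 8 * A₁)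
    have e2 := mul_le_mul_of_nonneg_left hL3 (by positivity : 0 ≤ 8 * A₁ * r₀)
    linarith only [e1, e2]
  have h2 : R₀ ^ 3 ≤ r₀ ^ 3 * L ^ 3 := by
    rw [← mul_pow]; exact pow_le_pow_left₀ hR₀0 hR₀le 3
  have h3 : (9 + (1 + |C|) * L) * A₁ ≤ (10 + |C|) * A₁ * L ^ 3 := by
    have : 9 + (1 + |C|) * L ≤ (10 + |C|) * L := by nlinarith only [hL, hC]
    have e1 := mul_le_mul_of_nonneg_right this hA
    have e2 := mul_le_mul_of_nonneg_left hL3 (by positivity : 0 ≤ (10 + |C|) * A₁)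
    linarith only [e1, e2]
  have h4 : T₀ * A₁ * ((L + 3) + 1) ≤ 5 * T₀ * A₁ * L ^ 3 := by
    have : (L + 3) + 1 ≤ 5 * L := by linarith
    have hTA : 0 ≤ T₀ * A₁ := mul_nonneg hT hA
    have e1 := mul_le_mul_of_nonneg_left this hTA
    have e2 := mul_le_mul_of_nonneg_left hL3 (by positivity : 0 ≤ 5 * T₀ * A₁)
    linarith only [e1, e2]
  have h5 : 4 * T₀ * R₀ ≤ 4 * T₀ * r₀ * L ^ 3 := by
    have e1 := mul_le_mul_of_nonneg_left hR₀le (by positivity : 0 ≤ 4 * T₀)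
    have e2 := mul_le_mul_of_nonneg_left hL3 (by positivity : 0 ≤ 4 * T₀ * r₀)
    linarith only [e1, e2]
  have h6 : 8 * A₁ ≤ 8 * A₁ * L ^ 3 := by nlinarith only [hL13, hA]
  linarith only [h1, h2, h3, h4, h5, h6]

set_option maxHeartbeats 1600000 in
/-- **Key lemma toward eq. (36)** (Rodgers–Tao 2020, §2, FMP p. 18: «for `n = 1` we have the
refinement `|Q_{t,1}| = (2π² + O_C(x^{−1/2}))(x/4π)^{(9+y)/4} J_t` … after a routine but somewhat
tedious calculation»), RH-FREE CONTENT: for `0 ≤ a ≤ 9`, `y = κ log₊ x` with `C' ≤ κ ≤ C` and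
`−T₀ ≤ t < 0`, `|I_t(π, a + y + ix)| = (x/4π)^{(a+y)/4} J_t(x) (1 + O_{C,T₀}(log³₊ x / x))`. Proof:
eq. (31) (`rodgersTao_I_asymp_holds`) at `b = π`, the saddle-point expansion of Lemma 2.3 (ii)
(`rodgersTao_saddleEq_expansion`) and the real computation `rt_phase_real` of the modulus of
`exp(tw₀² − πe^{4w₀} + ζw₀)`. [cite: RodgersTaoFMP2020, §2 eq. (36) (FMP p. 18)] -/
theorem rodgersTao_norm_I_pi_asymp (T₀ : ℝ) :
    ∃ C'₀ : ℝ, 0 < C'₀ ∧ ∀ C' : ℝ, C'₀ ≤ C' → ∀ C : ℝ, ∃ C''₀ A : ℝ, 0 < C''₀ ∧ 0 < A ∧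
      ∀ C'' : ℝ, C''₀ ≤ C'' → ∀ t ∈ Ico (-T₀) 0, ∀ x : ℝ, C'' ≤ x → ∀ κ ∈ Icc C' C,
        ∀ a ∈ Icc (0 : ℝ) 9,
        |‖rodgersTaoI t π (((a + κ * Real.log (2 + |x|) : ℝ) : ℂ) + x * I)‖ /
            ((x / (4 * π)) ^ ((a + κ * Real.log (2 + |x|)) / 4) * rodgersTaoJ t x) - 1| ≤
          A * Real.log (2 + |x|) ^ 3 / x := by
  obtain ⟨C₁, hC₁, h31⟩ := rodgersTao_I_asymp_of_I_stationary rodgersTao_I_stationary_holds T₀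
  obtain ⟨C₂, hC₂, hex⟩ := rodgersTao_saddleEq_exists T₀
  obtain ⟨A₁, hA₁, hexp⟩ := rodgersTao_saddleEq_expansion T₀
  refine ⟨max C₁ (max C₂ 1), lt_max_of_lt_left hC₁, fun C' hC' C ↦ ?_⟩
  have hC'1 : C₁ ≤ C' := le_trans (le_max_left _ _) hC'
  have hC'2 : C₂ ≤ C' := le_trans ((le_max_left _ _).trans (le_max_right _ _)) hC'
  have hC'3 : 1 ≤ C' := le_trans ((le_max_right _ _).trans (le_max_right _ _)) hC'
  obtain ⟨D₁, A₃₁, hD₁, hA₃₁, h31'⟩ := h31 C' hC'1 (C + 5)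
  obtain ⟨D₂, hD₂, hex'⟩ := hex C' hC'2 (C + 5)
  obtain ⟨D₃, A₂, hD₃, hA₂, hexp'⟩ := hexp C' (by linarith) (C + 5)
  set K₀ : ℝ := 8 * A₁ * (17 + |C| + 8 * |T₀|) + 3 * (17 + |C| + 8 * |T₀|) ^ 3 + (10 + |C|) * A₁ +
    5 * |T₀| * A₁ + 4 * |T₀| * (17 + |C| + 8 * |T₀|) + 8 * A₁ with hK₀
  have hK₀0 : 0 ≤ K₀ := by positivity
  refine ⟨max D₁ (max D₂ (max D₃ ((64 * K₀ + 2) ^ 4 + 16 * A₁ + 16))), 48 * A₃₁ + 2 * K₀ + 1,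
    lt_max_of_lt_left hD₁, by positivity, fun C'' hC'' t ht x hx κ hκ a ha ↦ ?_⟩
  -- thresholds
  have hx1 : D₁ ≤ x := le_trans ((le_max_left _ _).trans hC'') hx
  have hx2 : D₂ ≤ x := le_trans (((le_max_left _ _).trans (le_max_right _ _)).trans hC'') hx
  have hx3 : D₃ ≤ x :=
    le_trans ((((le_max_left _ _).trans (le_max_right _ _)).trans (le_max_right _ _)).trans hC'') hx
  have hx4 : (64 * K₀ + 2) ^ 4 + 16 * A₁ + 16 ≤ x :=
    le_trans ((((le_max_right _ _).trans (le_max_right _ _)).trans (le_max_right _ _)).trans hC'') hx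
  have hK4 : 0 ≤ (64 * K₀ + 2) ^ 4 := by positivity
  have hx16 : 16 ≤ x := by linarith only [hx4, hK4, hA₁.le]
  have hx0 : 0 < x := by linarith only [hx16]
  have hxge1 : 1 ≤ x := by linarith only [hx16]
  have hT₀ : 0 < T₀ := by linarith only [ht.1, ht.2]
  have haT : |T₀| = T₀ := abs_of_pos hT₀
  have ht' : t ∈ Icc (-T₀) 0 := ⟨ht.1, ht.2.le⟩
  -- L, y, ζ
  set L : ℝ := Real.log (2 + |x|) with hL
  have hL1 : 1 ≤ L := by
    rw [hL, abs_of_pos hx0, ← Real.log_exp 1]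
    refine Real.log_le_log (Real.exp_pos 1) ?_
    have := Real.exp_one_lt_d9; norm_num at this; linarith only [this, hx16]
  have hL0 : 0 < L := by linarith only [hL1]
  have hκ0 : 0 ≤ κ := by linarith only [hκ.1, hC'3]
  have hκC : κ ≤ |C| := hκ.2.trans (le_abs_self C)
  set y : ℝ := κ * L with hy
  have hy0 : 0 ≤ y := mul_nonneg hκ0 hL0.le
  have hyY : y ≤ (1 + |C|) * L := by
    have := mul_le_mul_of_nonneg_right hκC hL0.le; simp only [hy]; nlinarith only [this, hL0]
  set ζ : ℂ := ((a + y : ℝ) : ℂ) + x * I with hζ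
  have hζre : ζ.re = a + y := by simp [hζ]
  have hζim : ζ.im = x := by simp [hζ]
  have hΩ : ζ ∈ rodgersTaoOmega (C + 5) C' C'' := by
    change C'' ≤ ζ.im ∧ C' * Real.log (2 + |ζ.im|) ≤ ζ.re ∧ ζ.re ≤ 2 * (C + 5) * Real.log (2 + |ζ.im|)
    rw [hζre, hζim, ← hL]
    refine ⟨hx, ?_, ?_⟩
    · have := mul_le_mul_of_nonneg_right hκ.1 hL0.le; simp only [hy]; linarith only [this, ha.1]
    · have h1 := mul_le_mul_of_nonneg_right hκ.2 hL0.le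
      have hC0 : 0 ≤ C := by linarith only [hκ.1, hκ.2, hC'3]
      simp only [hy]; nlinarith only [h1, ha.2, hL1, hC0]
  have hπ1 : (1 : ℝ) ≤ π := by linarith only [Real.pi_gt_three]
  obtain ⟨w₀, hw₀, hE⟩ := hex' C'' (le_trans ((le_max_left _ _).trans (le_max_right _ _)) hC'')
    t ht' π hπ1 ζ hΩ
  have h31x := h31' C'' (le_trans (le_max_left _ _) hC'') t ht π hπ1 ζ hΩ w₀ hw₀ hE
  have hbπ : π ≤ ζ.im * Real.exp (100 * Real.sqrt ζ.im / |t|) := by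
    rw [hζim]
    have : 1 ≤ Real.exp (100 * Real.sqrt x / |t|) := Real.one_le_exp (by positivity)
    have h2 := mul_le_mul_of_nonneg_left this hx0.le
    linarith only [h2, Real.pi_lt_four, hx16]
  obtain ⟨hαx, -⟩ := hexp' C'' (le_trans (((le_max_left _ _).trans (le_max_right _ _)).trans
    (le_max_right _ _)) hC'') t ht π hπ1 ζ hΩ w₀ hw₀ hE hbπ
  rw [hζim] at hαx
  clear h31' hex' hexp' h31 hex hexp
  obtain ⟨h24, -⟩ := rt_saddle_re_im hE
  rw [hζre] at h24
  -- u and its closeness to x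
  set α : ℝ := w₀.re with hαdef
  set β : ℝ := w₀.im with hβdef
  set u : ℝ := 4 * π * Real.exp (4 * α) with hu
  have hu0 : 0 < u := by positivity
  have hux : |u - x| ≤ 8 * A₁ := rt_u_close hx0 (by linarith only [hx4, hK4, hA₁.le]) hαx
  have hu2 : x / 2 ≤ u := by have := (abs_le.1 hux).1; linarith only [this, hx4, hK4, hA₁.le]
  have h24' : u * Real.cos (4 * β) = a + y + 2 * t * α := by rw [hu]; exact h24
  -- ℓ and Λ
  have hℓ : |Real.log (x / (4 * π))| ≤ L + 3 := by rw [hL]; exact rt_abs_log_div_four_pi_le hxge1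
  -- the phase estimate
  have hA₁x : A₁ ≤ x := by linarith only [hx4, hK4, hA₁.le]
  have hD := rt_phase_real (T₀ := T₀) ht' hxge1 ha.1 ha.2 hy0 hyY hw₀.1 hw₀.2 hu0 h24' hux
    (by linarith only [hx4, hK4, hA₁.le]) hℓ (by linarith only [hL1]) hαx hA₁.le hA₁x
  -- K ≤ K₀ L³ ≤ x
  have hKK := rt_K_bound (C := C) hT₀.le hA₁.le hL1
  have hK₀' : 8 * A₁ * (17 + |C| + 8 * T₀) + 3 * (17 + |C| + 8 * T₀) ^ 3 + (10 + |C|) * A₁ +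
      5 * T₀ * A₁ + 4 * T₀ * (17 + |C| + 8 * T₀) + 8 * A₁ = K₀ := by rw [hK₀, haT]
  rw [hK₀'] at hKK
  have hKx : K₀ * L ^ 3 ≤ x := rt_KL3_le hK₀0 (by linarith only [hx4, hA₁.le])
  set D : ℝ := (t * (α ^ 2 - β ^ 2) - (a + y + 2 * t * α) / 4 + (a + y) * α - x * β) -
    ((a + y) / 4 * Real.log (x / (4 * π)) + t / 16 * Real.log (x / (4 * π)) ^ 2 -
      t * π ^ 2 / 64 - π * x / 8) + Real.log (x / u) / 2 with hDdef
  have hDle : |D| ≤ K₀ * L ^ 3 / x := by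
    refine hD.trans ?_
    rw [div_le_div_iff_of_pos_right hx0]
    exact hKK
  have hD1 : |D| ≤ 1 := hDle.trans (by rw [div_le_one hx0]; exact hKx)
  -- norms
  set Φ : ℂ := (t : ℂ) * w₀ ^ 2 - (π : ℂ) * Complex.exp (4 * w₀) + ζ * w₀ with hΦ
  have hΦre : Φ.re = t * (α ^ 2 - β ^ 2) - (a + y + 2 * t * α) / 4 + (a + y) * α - x * β := by
    rw [hΦ, rt_phase_re_eq, hζre, hζim, ← hαdef, ← hβdef]
    have : π * Real.exp (4 * α) * Real.cos (4 * β) = (a + y + 2 * t * α) / 4 := by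
      have e : π * Real.exp (4 * α) * Real.cos (4 * β) = u * Real.cos (4 * β) / 4 := by
        rw [hu]; ring
      rw [e, h24']
    rw [this]; ring
  have hnexp : ‖Complex.exp Φ‖ = Real.exp Φ.re := Complex.norm_exp _
  have hnb : ‖(π : ℂ) * Complex.exp (4 * w₀)‖ = u / 4 := by
    rw [norm_mul, Complex.norm_real, Real.norm_of_nonneg Real.pi_pos.le, Complex.norm_exp]
    have : ((4 : ℂ) * w₀).re = 4 * α := by simp [hαdef]
    rw [this, hu]; ring
  have hbne : (π : ℂ) * Complex.exp (4 * w₀) ≠ 0 :=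
    mul_ne_zero (by exact_mod_cast Real.pi_pos.ne') (Complex.exp_ne_zero _)
  set main : ℂ := (Real.sqrt (π / 8) : ℂ) * Complex.exp Φ *
    ((π : ℂ) * Complex.exp (4 * w₀)) ^ (-(1 / 2 : ℂ)) with hmain
  have hmain_norm : ‖main‖ = Real.sqrt (π / 8) * Real.exp Φ.re * (u / 4) ^ (-(1 / 2 : ℝ)) := by
    rw [hmain, norm_mul, norm_mul, Complex.norm_real, Real.norm_of_nonneg (Real.sqrt_nonneg _),
      hnexp, rt_norm_cpow_neg_half hbne, hnb]
  -- T and main = T e^D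
  set T : ℝ := (x / (4 * π)) ^ ((a + y) / 4) * rodgersTaoJ t x with hT
  have hxπ : 0 < x / (4 * π) := div_pos hx0 (mul_pos four_pos Real.pi_pos)
  have hP0 : 0 < (x / (4 * π)) ^ ((a + y) / 4) := Real.rpow_pos_of_pos hxπ _
  have hT0 : 0 < T := mul_pos hP0 (rodgersTaoJ_pos t hx0)
  have hmainT : ‖main‖ = T * Real.exp D := by
    rw [hmain_norm, hΦre, hT, rodgersTaoJ, hDdef]
    rw [rt_main_eq (E := t * (α ^ 2 - β ^ 2) - (a + y + 2 * t * α) / 4 + (a + y) * α - x * β)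
      (G := t / 16 * Real.log (x / (4 * π)) ^ 2 - t * π ^ 2 / 64 - π * x / 8) (q := a + y) hx0 hu0]
    congr 2; ring
  -- the (31) error in relative form
  have herr : ‖rodgersTaoI t π ζ - main‖ ≤ 16 * A₃₁ / x * ‖main‖ := by
    have h1 : ‖rodgersTaoI t π ζ - main‖ ≤ A₃₁ * ‖Complex.exp Φ‖ /
        ‖(π : ℂ) * Complex.exp (4 * w₀)‖ ^ (3 / 2 : ℝ) := by
      simpa [hmain, hΦ] using h31x
    rw [hnexp, hnb] at h1
    rw [hmain_norm]
    exact h1.trans (rt_err_rel hx0 hu2 hA₃₁.le)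
  -- assemble
  have hn := norm_sub_norm_le (rodgersTaoI t π ζ) main
  have hn' := norm_sub_norm_le main (rodgersTaoI t π ζ)
  rw [norm_sub_rev] at hn'
  set n : ℝ := ‖rodgersTaoI t π ζ‖ with hn_def
  have hm0 : 0 ≤ ‖main‖ := norm_nonneg _
  have heD := Real.abs_exp_sub_one_le hD1
  have heD' := abs_le.1 heD
  have hDabs := abs_nonneg D
  -- n/T - 1 = (n - ‖main‖)/T + (exp D - 1)
  have e : n / T - 1 = (n - ‖main‖) / T + (Real.exp D - 1) := by
    rw [hmainT]; field_simp; ring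
  rw [e]
  have h1 : |(n - ‖main‖) / T| ≤ 48 * A₃₁ / x := by
    rw [abs_div, abs_of_pos hT0, div_le_iff₀ hT0]
    have h2 : |n - ‖main‖| ≤ 16 * A₃₁ / x * ‖main‖ := by
      rw [abs_le]; constructor <;> linarith only [hn, hn', herr]
    refine h2.trans ?_
    rw [hmainT]
    have h3 : Real.exp D ≤ 3 := by linarith only [heD'.2, hD1]
    have h4 : 0 ≤ 16 * A₃₁ / x := by positivity
    calc 16 * A₃₁ / x * (T * Real.exp D) ≤ 16 * A₃₁ / x * (T * 3) := by gcongr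
      _ = 48 * A₃₁ / x * T := by ring
  have h2 : |Real.exp D - 1| ≤ 2 * K₀ * L ^ 3 / x := by
    refine heD.trans ?_
    have : 2 * K₀ * L ^ 3 / x = 2 * (K₀ * L ^ 3 / x) := by ring
    rw [this]; linarith only [heD, hDle]
  have hL3 : 1 ≤ L ^ 3 := one_le_pow₀ hL1
  have h3 : 48 * A₃₁ / x ≤ 48 * A₃₁ * L ^ 3 / x := by
    rw [div_le_div_iff_of_pos_right hx0]; nlinarith only [hL3, hA₃₁]
  calc |(n - ‖main‖) / T + (Real.exp D - 1)| ≤ |(n - ‖main‖) / T| + |Real.exp D - 1| := abs_add_le _ _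
    _ ≤ 48 * A₃₁ * L ^ 3 / x + 2 * K₀ * L ^ 3 / x := add_le_add (h1.trans h3) h2
    _ ≤ (48 * A₃₁ + 2 * K₀ + 1) * L ^ 3 / x := by
        rw [← add_div, div_le_div_iff_of_pos_right hx0]; nlinarith only [hL3]

/-- `log(2+x)³ ≤ 432 √x` for `x ≥ 2` (via `log u ≤ 6 u^{1/6}`). [folklore] -/
private theorem rt_L3_le_sqrt {x : ℝ} (hx : 2 ≤ x) : Real.log (2 + |x|) ^ 3 ≤ 432 * Real.sqrt x := by
  have hx0 : 0 < x := by linarith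
  rw [abs_of_pos hx0]
  have h1 := Real.log_le_rpow_div (by linarith : (0:ℝ) ≤ 2 + x) (by norm_num : (0:ℝ) < 1 / 6)
  have hq0 : 0 ≤ (2 + x) ^ (1 / 6 : ℝ) := Real.rpow_nonneg (by linarith) _
  have hL0 : 0 ≤ Real.log (2 + x) := Real.log_nonneg (by linarith)
  have h2 : Real.log (2 + x) ≤ 6 * (2 + x) ^ (1 / 6 : ℝ) := by
    have e : (2 + x) ^ (1 / 6 : ℝ) / (1 / 6) = 6 * (2 + x) ^ (1 / 6 : ℝ) := by ring
    rw [e] at h1; exact h1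
  have h3 : Real.log (2 + x) ^ 3 ≤ (6 * (2 + x) ^ (1 / 6 : ℝ)) ^ 3 := pow_le_pow_left₀ hL0 h2 3
  have h4 : ((2 + x) ^ (1 / 6 : ℝ)) ^ 3 = Real.sqrt (2 + x) := by
    rw [← Real.rpow_natCast, ← Real.rpow_mul (by linarith)]; norm_num; rw [← Real.sqrt_eq_rpow]
  have h5 : Real.sqrt (2 + x) ≤ 2 * Real.sqrt x := by
    rw [Real.sqrt_le_left (by positivity), mul_pow, Real.sq_sqrt hx0.le]; linarith
  calc Real.log (2 + x) ^ 3 ≤ (6 * (2 + x) ^ (1 / 6 : ℝ)) ^ 3 := h3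
    _ = 216 * Real.sqrt (2 + x) := by rw [mul_pow, h4]; norm_num
    _ ≤ 432 * Real.sqrt x := by linarith

/-- **DISCHARGE of `rodgersTao_Q_one_asymp`** (Rodgers–Tao 2020, §2 eq. (36), FMP p. 18: «for `n = 1`
we have the refinement `|Q_{t,1}| = (2π² + O_C(x^{−1/2}))(x/4π)^{(9+y)/4} J_t`»), CONTENT: from the
key lemma `rodgersTao_norm_I_pi_asymp` at `a = 9` and `a = 5` (`|I_t(π, a+y+ix)| = (x/4π)^{(a+y)/4}
J_t(x)(1 + O(log³₊x/x))`, so the `n = 1`, `a = 5` term is smaller by the factor `4π/x`) and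
`log³₊ x ≤ 432 √x`. [cite: RodgersTaoFMP2020, §2 eq. (36) (FMP p. 18)] -/
theorem rodgersTao_Q_one_asymp_holds : rodgersTao_Q_one_asymp := by
  intro T₀
  obtain ⟨C₁, hC₁, hkey⟩ := rodgersTao_norm_I_pi_asymp T₀
  refine ⟨C₁, hC₁, fun C ↦ ?_⟩
  obtain ⟨D₁, A, hD₁, hA, hkey'⟩ := hkey C₁ le_rfl C
  refine ⟨max D₁ 2, 432 * (140 * A + 120) + 1, lt_max_of_lt_left hD₁, by positivity,
    fun t ht x hx κ hκ ↦ ?_⟩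
  have hx2 : 2 ≤ x := le_trans (le_max_right _ _) hx
  have hx0 : 0 < x := by linarith only [hx2]
  have hx1 : 1 ≤ x := by linarith only [hx2]
  have h9 := hkey' (max D₁ 2) (le_max_left _ _) t ht x hx κ hκ 9 ⟨by norm_num, le_rfl⟩
  have h5 := hkey' (max D₁ 2) (le_max_left _ _) t ht x hx κ hκ 5 ⟨by norm_num, by norm_num⟩
  set L : ℝ := Real.log (2 + |x|) with hL
  have hπ2 : π ^ 2 ≤ 10 := by nlinarith only [Real.pi_lt_d2, Real.pi_pos]
  have hL1 : 1 ≤ L := by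
    rw [hL, abs_of_pos hx0, ← Real.log_exp 1]
    refine Real.log_le_log (Real.exp_pos 1) ?_
    have := Real.exp_one_lt_d9; norm_num at this; linarith only [this, hx2]
  have hL3 : 1 ≤ L ^ 3 := one_le_pow₀ hL1
  set y : ℝ := κ * L with hy
  change |‖rodgersTaoQ t 1 x y‖ / ((x / (4 * π)) ^ ((9 + y) / 4) * rodgersTaoJ t x) - 2 * π ^ 2| ≤
    (432 * (140 * A + 120) + 1) / Real.sqrt x
  -- the two main terms
  set T₉ : ℝ := (x / (4 * π)) ^ ((9 + y) / 4) * rodgersTaoJ t x with hT₉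
  set T₅ : ℝ := (x / (4 * π)) ^ ((5 + y) / 4) * rodgersTaoJ t x with hT₅
  have hxπ : 0 < x / (4 * π) := div_pos hx0 (mul_pos four_pos Real.pi_pos)
  have hJ := rodgersTaoJ_pos t hx0
  have hT₉0 : 0 < T₉ := mul_pos (Real.rpow_pos_of_pos hxπ _) hJ
  have hT₅0 : 0 < T₅ := mul_pos (Real.rpow_pos_of_pos hxπ _) hJ
  have hT₅₉ : T₅ = T₉ * (4 * π / x) := by
    simp only [hT₅, hT₉]
    have e : (5 + y) / 4 = (9 + y) / 4 + (-1) := by ring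
    rw [e, Real.rpow_add hxπ, Real.rpow_neg_one, inv_div]; ring
  -- the norms of the two I's
  set n₉ : ℝ := ‖rodgersTaoI t π (((9 + κ * L : ℝ) : ℂ) + x * I)‖ with hn₉
  set n₅ : ℝ := ‖rodgersTaoI t π (((5 + κ * L : ℝ) : ℂ) + x * I)‖ with hn₅
  have hQ : rodgersTaoQ t 1 x y = 2 * π ^ 2 * rodgersTaoI t π (((9 + κ * L : ℝ) : ℂ) + x * I) -
      3 * π * rodgersTaoI t π (((5 + κ * L : ℝ) : ℂ) + x * I) := by
    simp only [rodgersTaoQ, hy, Nat.cast_one, one_pow, mul_one]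
    push_cast; ring_nf
  set ε : ℝ := A * L ^ 3 / x with hε
  have hε0 : 0 ≤ ε := div_nonneg (mul_nonneg hA.le (by positivity)) hx0.le
  have h9' : |n₉ / T₉ - 1| ≤ ε := h9
  have h5' : |n₅ / T₅ - 1| ≤ ε := h5
  have h9d := abs_le.1 h9'
  have h5d := abs_le.1 h5'
  -- n₉ ∈ T₉ (1 ± ε), n₅ ≤ T₅ (1 + ε)
  have hn₉le : n₉ ≤ T₉ * (1 + ε) := by
    have := h9d.2; rw [sub_le_iff_le_add, div_le_iff₀ hT₉0] at this; linarith only [this]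
  have hn₉ge : T₉ * (1 - ε) ≤ n₉ := by
    have := h9d.1; rw [le_sub_iff_add_le, le_div_iff₀ hT₉0] at this; linarith only [this]
  have hn₅le : n₅ ≤ T₅ * (1 + ε) := by
    have := h5d.2; rw [sub_le_iff_le_add, div_le_iff₀ hT₅0] at this; linarith only [this]
  -- ‖Q₁‖ between 2π² n₉ ∓ 3π n₅
  have hn2 : ‖(2 * π ^ 2 : ℂ) * rodgersTaoI t π (((9 + κ * L : ℝ) : ℂ) + x * I)‖ = 2 * π ^ 2 * n₉ := by
    rw [norm_mul]; congr 1
    rw [show (2 * π ^ 2 : ℂ) = ((2 * π ^ 2 : ℝ) : ℂ) by push_cast; ring, Complex.norm_real,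
      Real.norm_of_nonneg (by positivity)]
  have hn3 : ‖(3 * π : ℂ) * rodgersTaoI t π (((5 + κ * L : ℝ) : ℂ) + x * I)‖ = 3 * π * n₅ := by
    rw [norm_mul]; congr 1
    rw [show (3 * π : ℂ) = ((3 * π : ℝ) : ℂ) by push_cast; ring, Complex.norm_real,
      Real.norm_of_nonneg (by positivity)]
  have hQhi : ‖rodgersTaoQ t 1 x y‖ ≤ 2 * π ^ 2 * n₉ + 3 * π * n₅ := by
    rw [hQ, ← hn2, ← hn3]; exact norm_sub_le _ _
  have hQlo : 2 * π ^ 2 * n₉ - 3 * π * n₅ ≤ ‖rodgersTaoQ t 1 x y‖ := by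
    rw [hQ, ← hn2, ← hn3]; exact norm_sub_norm_le _ _
  -- divide by T₉
  have hn₅T : 3 * π * n₅ / T₉ ≤ 12 * π ^ 2 * (1 + ε) / x := by
    rw [div_le_div_iff₀ hT₉0 hx0]
    have h1 : 3 * π * n₅ ≤ 3 * π * (T₅ * (1 + ε)) := mul_le_mul_of_nonneg_left hn₅le (by positivity)
    rw [hT₅₉] at h1
    have e : 3 * π * (T₉ * (4 * π / x) * (1 + ε)) * x = 12 * π ^ 2 * (1 + ε) * T₉ := by
      field_simp; ring
    nlinarith only [h1, e, hx0, mul_le_mul_of_nonneg_right h1 hx0.le]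
  have hup : ‖rodgersTaoQ t 1 x y‖ / T₉ - 2 * π ^ 2 ≤ 2 * π ^ 2 * ε + 12 * π ^ 2 * (1 + ε) / x := by
    have h1 : ‖rodgersTaoQ t 1 x y‖ / T₉ ≤ (2 * π ^ 2 * n₉ + 3 * π * n₅) / T₉ :=
      div_le_div_of_nonneg_right hQhi hT₉0.le
    have h2 : (2 * π ^ 2 * n₉ + 3 * π * n₅) / T₉ = 2 * π ^ 2 * (n₉ / T₉) + 3 * π * n₅ / T₉ := by
      field_simp
    have h3 : n₉ / T₉ ≤ 1 + ε := by linarith only [h9d.2]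
    have h4 : 0 ≤ 2 * π ^ 2 := by positivity
    nlinarith only [h1, h2, h3, hn₅T, h4]
  have hlo : -(2 * π ^ 2 * ε + 12 * π ^ 2 * (1 + ε) / x) ≤ ‖rodgersTaoQ t 1 x y‖ / T₉ - 2 * π ^ 2 := by
    have h1 : (2 * π ^ 2 * n₉ - 3 * π * n₅) / T₉ ≤ ‖rodgersTaoQ t 1 x y‖ / T₉ :=
      div_le_div_of_nonneg_right hQlo hT₉0.le
    have h2 : (2 * π ^ 2 * n₉ - 3 * π * n₅) / T₉ = 2 * π ^ 2 * (n₉ / T₉) - 3 * π * n₅ / T₉ := by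
      field_simp
    have h3 : 1 - ε ≤ n₉ / T₉ := by linarith only [h9d.1]
    have h4 : 0 ≤ 2 * π ^ 2 := by positivity
    nlinarith only [h1, h2, h3, hn₅T, h4]
  have habs : |‖rodgersTaoQ t 1 x y‖ / T₉ - 2 * π ^ 2| ≤ 2 * π ^ 2 * ε + 12 * π ^ 2 * (1 + ε) / x :=
    abs_le.2 ⟨hlo, hup⟩
  refine habs.trans ?_
  -- 2π² ε + 12π²(1+ε)/x ≤ (140A + 120) L³/x ≤ 432(140A+120)/√x
  have hεx : ε / x ≤ ε := by
    rw [div_le_iff₀ hx0]; nlinarith only [hε0, hx1]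
  have h1x : 1 / x ≤ L ^ 3 / x := div_le_div_of_nonneg_right hL3 hx0.le
  have hB : 2 * π ^ 2 * ε + 12 * π ^ 2 * (1 + ε) / x ≤ (140 * A + 120) * (L ^ 3 / x) := by
    have e1 : 12 * π ^ 2 * (1 + ε) / x = 12 * π ^ 2 * (1 / x) + 12 * π ^ 2 * (ε / x) := by ring
    have e2 : ε = A * (L ^ 3 / x) := by simp only [hε]; ring
    rw [e1]
    have h0 : 0 ≤ L ^ 3 / x := by positivity
    nlinarith only [hπ2, hεx, h1x, e2, hε0, h0, hA, Real.pi_pos]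
  have hsx : 0 < Real.sqrt x := Real.sqrt_pos.2 hx0
  have hL3x : L ^ 3 / x ≤ 432 / Real.sqrt x := by
    have h := rt_L3_le_sqrt hx2
    rw [← hL] at h
    rw [div_le_div_iff₀ hx0 hsx]
    have : Real.sqrt x * Real.sqrt x = x := Real.mul_self_sqrt hx0.le
    nlinarith only [h, this, hsx]
  calc 2 * π ^ 2 * ε + 12 * π ^ 2 * (1 + ε) / x ≤ (140 * A + 120) * (L ^ 3 / x) := hB
    _ ≤ (140 * A + 120) * (432 / Real.sqrt x) := mul_le_mul_of_nonneg_left hL3x (by positivity)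
    _ ≤ (432 * (140 * A + 120) + 1) / Real.sqrt x := by
        rw [mul_div_assoc', div_le_div_iff_of_pos_right hsx]; linarith only [hA]


end Literature.NumberTheory.LFunctions
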